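import Literature.MathematicalPhysics.QuantumFieldTheory.Balaban1983to89.B9SectBCodedChainR2
import Literature.MathematicalPhysics.QuantumFieldTheory.Balaban1983to89.B9Eq38SecondOrderCrossL2
import Literature.MathematicalPhysics.QuantumFieldTheory.Balaban1983to89.B9SectBL2SecondOrderY
import Literature.MathematicalPhysics.QuantumFieldTheory.Balaban1983to89.B9SectBCodedClassR
import Literature.MathematicalPhysics.QuantumFieldTheory.Balaban1983to89.B9SectBStepFamilyTransferPos
import Literature.MathematicalPhysics.QuantumFieldTheory.Balaban1983to89.B9SectBCodedChainL2
import Literature.MathematicalPhysics.QuantumFieldTheory.Balaban1983to89.Node00.OpsYULetters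
import Literature.MathematicalPhysics.QuantumFieldTheory.Balaban1983to89.B9SectBH1ReadWriteY
import Literature.MathematicalPhysics.QuantumFieldTheory.Balaban1983to89.B9SectBCodedReadingsU
import Literature.MathematicalPhysics.QuantumFieldTheory.Balaban1983to89.B9SectBStepPosFamilyTransfer
import Literature.MathematicalPhysics.QuantumFieldTheory.Balaban1983to89.B9SectBEGlobAnStepRecordOn
import Literature.MathematicalPhysics.QuantumFieldTheory.Balaban1983to89.B9SectBStepsKSCU
import Literature.MathematicalPhysics.QuantumFieldTheory.Balaban1983to89.B9CubeLettersInvReadDictBMajorants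
import Literature.MathematicalPhysics.QuantumFieldTheory.Balaban1983to89.B9CubeLettersInvWriteDictB
import Literature.MathematicalPhysics.QuantumFieldTheory.Balaban1983to89.B9Thm314WholeExpansionReads
import Literature.MathematicalPhysics.QuantumFieldTheory.Balaban1983to89.B9SectBGReadY

/-!
# `Balaban1983to89.B9SectBCodedChainR3` — CASCADE-R BUNDLE 3∕7 (director-ym №279 GO-R; №277 (3) `hunitA` cure): the class-parametric twins
# `B9SectBL2SecondOrderYR`, `B9SectBCodedChainL2R`, `B9SectBCodedReadingsUR`, `B9SectBEGlobAnStepRecordOnR`, `B9SectBStepsKSCUR`, `B9SectBGReadYR`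

statement-level skeleton of published theorems with citation tags; proofs where landed; nothing here is a claim about the
Yang–Mills mass gap

WHY A BUNDLE.  The minimal R-sub-path of №279 (3) is a 47-module dependency chain; post-accept olean builds are the latency of record today, so the
chain is filed as 7 layered modules instead of 47.  This module is the VERBATIM concatenation, in dependency order, of the 6 generated twin files
named above (each keeps its own namespace `…<Original>R`, its own honest twin header and a pointer to the original module documentation; consumers `open` the
namespaces exactly as they would the per-file twins).  Generated by dag-n06-c g16 (`mkbundle.py`, HOME `pub-ymgap-dag-n06-c/lean/g16/`).

HONEST SCOPE.  Re-typing bookkeeping; nothing of [B9] asserted beyond the originals; COUNT-NEUTRAL; N06 NOT discharged; nothing continuum ∕ OS ∕ mass gap ∕ Clay.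
-/

/-!
# `Balaban1983to89.B9SectBL2SecondOrderYR` — THE CLASS-PARAMETRIC TWIN of `B9SectBL2SecondOrderY` (CASCADE-R, director-ym №279 GO-R; №277 (3) `hunitA` cure; dag-n06-d SOCKET-(α) class question)

statement-level skeleton of published theorems with citation tags; proofs where landed; nothing here is a claim about the
Yang–Mills mass gap

WHAT THIS FILE IS.  The original module `B9SectBL2SecondOrderY` types its objects over MODULE 3's member carrier `bg9Y 𝔸 G x` (MODULE 2's small-cube class (3.35)).  This file RE-DECLARES, with UNCHANGED NAMES inside the namespace `…B9SectBL2SecondOrderYR`, exactly its 5 class-dependent declarations over the CLASS-PARAMETRIC carrier `B9SectBCodedClassR.bg9YC 𝔸 G P x` (`P : RegExtraY …` = the two cube conditions of (3.35)∕(3.36) as a parameter; `bg9Y 𝔸 G x = bg9YC 𝔸 G (extraY 𝔸 G) x` by `rfl`, so every declaration here specialises definitionally to its original; at the record's reading of PRINT's class, `P := extraYPb 𝔸 G`, the displayed laws `hreg335P` ((3.35) on plaquettes) and the class-keyed `hunitA` become theorems).  The text is the original's VERBATIM under the token surgery `bg9Y 𝔸 G ↦ bg9YC 𝔸 G P`,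 `NAME ↦ NAME P` for the class-dependent names (P the first explicit argument), and — №277 — the binder `hunitA` re-keyed from «all G-valued U» to «all (3.35)-regular U of the carrier» (`∀ j α₀ U, (bg9YC 𝔸 G P (f j)).Reg335 c35 α₀ U → IsUnit (deltaAY …)`).  Class-free declarations of the original are NOT copied: they are imported and used BY NAME (`open … hiding` the re-declared ones).  Generated by dag-n06-c g16's `gen.py` (HOME `pub-ymgap-dag-n06-c/lean/g16/`); the ORIGINAL MODULE DOCUMENTATION FOLLOWS VERBATIM and describes the mathematics.

HONEST SCOPE.  Re-typing bookkeeping; nothing of [B9] asserted beyond the original; COUNT-NEUTRAL; N06 NOT discharged; nothing continuum ∕ OS ∕ mass gap ∕ Clay.  Cell `pub-ymgap` (D-0062), Track A node N06 [B9], seat `pub-ymgap-dag-n06-c` g16, 2026-08-29.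
-/

/-! Module documentation: that of the original `Balaban1983to89.B9SectBL2SecondOrderY` applies verbatim to this twin (not repeated here). -/

noncomputable section

namespace Literature.MathematicalPhysics.QuantumFieldTheory.Balaban1983to89.B9SectBL2SecondOrderYR

open Literature.MathematicalPhysics.QuantumFieldTheory.Balaban1983to89.B9SectBCodedClassR (RegExtraY bg9YC)
open Literature.MathematicalPhysics.QuantumFieldTheory.Balaban1983to89.B9SectBL2SecondOrderY hiding hasL2Majorant_secondPatterns_of_l2Block secondWords_at_W l2Block_record_at_W_of_KSC₃' l2_KSC₃_base_of_record₃₅ l2Block_KSC₃_base_of_record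

open NormedSpace Complex
open Literature.MathematicalPhysics.QuantumFieldTheory.Balaban1983to89
open Literature.MathematicalPhysics.QuantumFieldTheory.Balaban1983to89.B6KLevelCensusIndexV1 (KIdx kGeo)
open Literature.MathematicalPhysics.QuantumFieldTheory.Balaban1983to89.B6Ineq2142KLevelV1 (β)
open Literature.MathematicalPhysics.QuantumFieldTheory.Balaban1983to89.B6RandomWalk (Triangle254 Ineq261)
open Literature.MathematicalPhysics.QuantumFieldTheory.Balaban1983to89.B6RandomWalkL2 (HasL2Majorant hasL2Majorant_mono)
open Literature.MathematicalPhysics.QuantumFieldTheory.Balaban1983to89.B9Thm34Ext (toB6)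
open Literature.MathematicalPhysics.QuantumFieldTheory.Balaban1983to89.B9Ineq347 (ScaleTransfer)
open Literature.MathematicalPhysics.QuantumFieldTheory.Balaban1983to89.B9FromB6 (L2Block pref6_nonneg)
open Literature.MathematicalPhysics.QuantumFieldTheory.Balaban1983to89.B9Eq39Adjoint (R fluct prodCfg covD covDstar)
open Literature.MathematicalPhysics.QuantumFieldTheory.Balaban1983to89.B9Eq352DivForm (tauB)
open Literature.MathematicalPhysics.QuantumFieldTheory.Balaban1983to89.B9Eq352DivFormLetters (conj)
open Literature.MathematicalPhysics.QuantumFieldTheory.Balaban1983to89.B9Eq352GradLetters (diffLetter)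
open Literature.MathematicalPhysics.QuantumFieldTheory.Balaban1983to89.B9Ineq363L2 (hasL2Majorant_rate_mono)
open Literature.MathematicalPhysics.QuantumFieldTheory.Balaban1983to89.B9SectBCodedCarrier (CCfg)
open Literature.MathematicalPhysics.QuantumFieldTheory.Balaban1983to89.B9Eq360DeltaPrimeAY (AfldY mulY chartA UboxY_mulY_fluct)
open Literature.MathematicalPhysics.QuantumFieldTheory.Balaban1983to89.B9PinMembersKLevelV1 (MemberY geo9Y bg9Y)
open Literature.MathematicalPhysics.QuantumFieldTheory.Balaban1983to89.B9SectBGpLettersY (GVal coordC expAC blkC stencilF_blkC stencilB_blkC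
  norm_le_one_and_inv_of_mem letters_base_of_gVal)
open Literature.MathematicalPhysics.QuantumFieldTheory.Balaban1983to89.B9SectBGpFrameCodedYR (codingYx)
open Literature.MathematicalPhysics.QuantumFieldTheory.Balaban1983to89.B9SectBGpFrameCodedY (CplxLettersY)
open Literature.MathematicalPhysics.QuantumFieldTheory.Balaban1983to89.B9SectBGpReadingsY (etaS_eq_eta)
open Literature.MathematicalPhysics.QuantumFieldTheory.Balaban1983to89.B9SectBGpTransferConvY (letters337_of_cplxLettersY)
open Literature.MathematicalPhysics.QuantumFieldTheory.Balaban1983to89.B9SectBL2DictionaryYR (KSC₃ KSC₃_l2)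
open Literature.MathematicalPhysics.QuantumFieldTheory.Balaban1983to89.B9SectBL2DictionaryY (wordSL wordL e6 dirS l2AugS l2OfY_wordL l2AugS_le_of_hasL2Majorant_wordL hasL2Majorant_wordL_of_l2AugS)
open Literature.MathematicalPhysics.QuantumFieldTheory.Balaban1983to89.B9SectBL2TransferInYR (hasL2Majorant_allPatterns_of_l2Block)
open Literature.MathematicalPhysics.QuantumFieldTheory.Balaban1983to89.B9SectBL2TransferInY (hasL2Majorant_recordWords_of_l2Block crossConstL2 crossConstL2_nonneg l2Block_kernelFamilyS_of_printWords)
open Literature.MathematicalPhysics.QuantumFieldTheory.Balaban1983to89.B9SectBL2TransferConvYR (hconvL2_words_at)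
open Literature.MathematicalPhysics.QuantumFieldTheory.Balaban1983to89.B9SectBL2TransferConvY (convConstL2 cDef cDef_nonneg)
open Literature.MathematicalPhysics.QuantumFieldTheory.Balaban1983to89.B9Eq38CrossLettersL2 (hasL2Majorant_cross_left hasL2Majorant_cross_right)
open Literature.MathematicalPhysics.QuantumFieldTheory.Balaban1983to89.B9Eq38SecondOrderCrossL2 (hasL2Majorant_cross2_left_inner hasL2Majorant_cross2_right_inner
  scaleTransfer_one)
open Literature.MathematicalPhysics.QuantumFieldTheory.Balaban1983to89.B9Eq370SecondOrderConversionL2 (hasL2Majorant_diffLetter2_prodCfg_mul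
  hasL2Majorant_mul_diffLetter2_prodCfg conv2ConstL conv2ConstR le_of_scaleTransfer sigma_two_of_scaleTransfer)
open Literature.MathematicalPhysics.QuantumFieldTheory.Balaban1983to89.B9GeoLemma21KLevelV1 (geo9Y_dist_triangle geo9Y_len_pos geo9K_eta_pos geo9K_one_le_L)
open Literature.MathematicalPhysics.QuantumFieldTheory.Balaban1983to89.B9RWSums347DefiniteFacesWindow (geo9Y_dist_nonneg)
open Literature.MathematicalPhysics.QuantumFieldTheory.Balaban1983to89.Node00 (SiteY BlkY IBondY CfgY BallY SiteOpY SiteParY UboxY shiftY cdS cdsS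
  liftY l2OfY etaS kernelFamilyS GpY)

variable {𝔸 : Type} [NormedRing 𝔸] [NormedAlgebra ℂ 𝔸] [CompleteSpace 𝔸] [NormOneClass 𝔸] [FiniteDimensional ℝ 𝔸]
variable {d ℓ : ℕ} {hd : 1 ≤ d + 1} {hL : Odd (ℓ + 1) ∧ 1 < ℓ + 1} {b₀ b₁ : ℝ} {Mstar : ℕ} (P : RegExtraY d ℓ hd hL b₀ b₁ Mstar 𝔸)

/-! ## §0  Record facts: commuting shifts, the plaquette law, the (3.37) second clause in the frames' letters -/

section Facts

variable (G : Subgroup 𝔸ˣ) (x : MemberY d ℓ hd hL b₀ b₁ Mstar) (par : SiteParY 𝔸 x.toKIdx) (ιB : BlkY x.toKIdx → IBondY x.toKIdx)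

end Facts

/-! ## §1  ★★ hin: every orientation pattern of the second-order words at the base from print's patterns -/

section Hin

variable (G : Subgroup 𝔸ˣ) (x : MemberY d ℓ hd hL b₀ b₁ Mstar) (par : SiteParY 𝔸 x.toKIdx) {ι : Type} [Fintype ι] [DecidableEq ι]
  (b : Module.Basis ι ℝ 𝔸) (ιB : BlkY x.toKIdx → IBondY x.toKIdx) [Fintype (geo9Y x).Site] [DecidableEq (geo9Y x).Site]
set_option maxHeartbeats 400000 in
omit [NormOneClass 𝔸] in
/-- ★★ **EVERY ORIENTATION PATTERN OF THE SECOND-ORDER WORDS AT THE BASE** (p. 398 first remark, twice): at a member with a section `ιB` of `β`, unit-norm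
structure group, a real basis, Lemma 2.1 of [4] at `(δ₀, 1/12)`, the scale transfers of `ℓ` and `ℓ⁻²` with one constant `Λ ≧ 1`, and the plaquette law
`PlaqLawY c_P U` of the `G`-valued base `U`: if the record `kernelFamilyS … id (GpY par) par` has the (3.46) block `(B₀, δ₀)` at `U`, then for ALL
`k, l ∈ κ ⊕ κ` the words `∇♯_k∇♯_l·G` (index 3) and `G·∇♯_k∇♯_l` (index 5) have block-`ℓ²` majorants `cross2ConstL2 · pref6_n(ℓ) · e^{−(δ₀/2)d}` —
print's `∇∇G`, `G∇*∇*` read from the record, the inner letter switched by `B9Eq38SecondOrderCrossL2` (the plaquette), the outer by `B9Eq38CrossLettersL2`.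
[cite: Balaban1985BackgroundPropagators, p.398 (first remark), Thm 3.1 (3.46) p.398, (3.8) p.392, p.404 (after (3.69)); Balaban1984PropagatorsII, Prop. 2.6 (2.140)–(2.141) p.247, Lemma 2.1 p.234] -/
theorem hasL2Majorant_secondPatterns_of_l2Block (hι : ∀ s : BlkY x.toKIdx, β x.toKIdx.hN x.toKIdx.D x.toKIdx.hk (ιB s) = s)
    (hG1 : ∀ u : 𝔸ˣ, u ∈ G → ‖(u : 𝔸)‖ ≤ 1) {M₂ : ℝ} (hM₂ : 0 ≤ M₂) (hrepr : ∀ (v : 𝔸) (j : ι), |b.repr v j| ≤ M₂ * ‖v‖)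
    {δ₀ : ℝ} (hδ₀ : 0 < δ₀) {dL : ℕ} (h261 : Ineq261 dL (toB6 (geo9Y x) (0 : ℝ) True) δ₀ (1 / 12)) {Λ : ℝ} (hΛ : 1 ≤ Λ)
    (hT1 : ScaleTransfer (geo9Y x) δ₀ (1 / 12) Λ (fun a => (geo9Y x).len a))
    (hTi2 : ScaleTransfer (geo9Y x) δ₀ (1 / 12) Λ (fun a => ((geo9Y x).len a)⁻¹ ^ 2))
    {cP : ℝ} (hcP : 0 ≤ cP) {B₀ : ℝ} (hB₀ : 0 ≤ B₀) {U : CfgY 𝔸 x.toKIdx} (hU : GVal G x.toKIdx U) (hplaq : PlaqLawY x ιB cP U)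
    (hL2 : L2Block (kernelFamilyS x.toKIdx (bg9YC 𝔸 G P x) (fun U => U) (GpY x.toKIdx par) par) B₀ δ₀ U) :
    (∀ k l : Fin (d + 1) ⊕ Fin (d + 1), HasL2Majorant (g := toB6 (geo9Y x) (0 : ℝ) True) (fun p : SiteY x.toKIdx × ι => blkC x.toKIdx ιB p.1)
        (conj b (wordL x.toKIdx (GpY x.toKIdx par) U U (kGeo x.toKIdx).eta 3 k l))
        (fun a a' => cross2ConstL2 cP M₂ (∑ j, ‖b j‖) (Real.sqrt (Fintype.card ι)) d dL δ₀ Λ B₀ * B9.pref6 ((geo9Y x).len a) 3 *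
          Real.exp (-(δ₀ / 2 * (geo9Y x).dist a a')))) ∧
      (∀ k l : Fin (d + 1) ⊕ Fin (d + 1), HasL2Majorant (g := toB6 (geo9Y x) (0 : ℝ) True) (fun p : SiteY x.toKIdx × ι => blkC x.toKIdx ιB p.1)
        (conj b (wordL x.toKIdx (GpY x.toKIdx par) U U (kGeo x.toKIdx).eta 5 k l))
        (fun a a' => cross2ConstL2 cP M₂ (∑ j, ‖b j‖) (Real.sqrt (Fintype.card ι)) d dL δ₀ Λ B₀ * B9.pref6 ((geo9Y x).len a) 5 *
          Real.exp (-(δ₀ / 2 * (geo9Y x).dist a a')))) := by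
  -- constants and geometry
  set η : ℝ := (kGeo x.toKIdx).eta with hηdef
  have hη0 : 0 < η := geo9K_eta_pos x.toKIdx
  set Sb : ℝ := ∑ j, ‖b j‖ with hSbdef
  set sι : ℝ := Real.sqrt (Fintype.card ι) with hsι
  set cL : ℝ := sι * M₂ * Sb with hcL
  set Bin : ℝ := cL * B₀ with hBin
  set c₁ : ℝ := B6.c1 dL δ₀ (1 / 12) with hc₁
  set d₀ : ℝ := 2 * ((d : ℝ) + 1) with hd₀
  set σ₁ : ℝ := Λ * Real.exp (1 / 12 * δ₀ * d₀) with hσ₁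
  set gX : ℝ := 1 + ((1 : ℝ) ^ 2 * M₂ * Sb * sι * Real.exp (δ₀ * d₀)) * Λ * c₁ with hgX
  set gI : ℝ := 1 + c₁ * M₂ * Sb * sι * ((1 : ℝ) ^ 2 * Real.exp (δ₀ * d₀) * Λ + (1 : ℝ) ^ 4 * cP * σ₁ * Real.exp (δ₀ * (2 * d₀)) * Λ) with hgI
  set Bx : ℝ := cross2ConstL2 cP M₂ Sb sι d dL δ₀ Λ B₀ with hBxdef
  have hSb : 0 ≤ Sb := Finset.sum_nonneg fun i _ => norm_nonneg _
  have hsι0 : 0 ≤ sι := Real.sqrt_nonneg _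
  have hcL0 : 0 ≤ cL := by positivity
  have hBin0 : 0 ≤ Bin := mul_nonneg hcL0 hB₀
  have hΛ0 : 0 ≤ Λ := le_trans zero_le_one hΛ
  have hc₁0 : 0 ≤ c₁ := B6RandomWalk.c1_nonneg dL δ₀ (1 / 12)
  have hσ₁0 : 0 ≤ σ₁ := by positivity
  have hgX1 : 1 ≤ gX := by rw [hgX]; exact le_add_of_nonneg_right (by positivity)
  have hgX0 : 0 ≤ gX := le_trans zero_le_one hgX1
  have hgI1 : 1 ≤ gI := by rw [hgI]; exact le_add_of_nonneg_right (by positivity)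
  have hgI0 : 0 ≤ gI := le_trans zero_le_one hgI1
  have hBx : Bx = gX * gI * Bin := by rw [hBxdef, hgX, hgI, hσ₁, hBin, hcL, hc₁, hd₀]; rfl
  have hdnn : ∀ y y' : (geo9Y x).Site, 0 ≤ (geo9Y x).dist y y' := geo9Y_dist_nonneg x
  have htri : Triangle254 (toB6 (geo9Y x) (0 : ℝ) True) := fun p q r => geo9Y_dist_triangle x p q r
  have htri' : ∀ p q r : (geo9Y x).Site, (geo9Y x).dist p r ≤ (geo9Y x).dist p q + (geo9Y x).dist q r := fun p q r => geo9Y_dist_triangle x p q r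
  have hlen : ∀ y : (geo9Y x).Site, 0 < (geo9Y x).len y := geo9Y_len_pos x
  have hwℓ : ∀ p : (geo9Y x).Site, 0 ≤ (geo9Y x).len p := fun p => (hlen p).le
  have hd₀F : ∀ (μ : Fin (d + 1)) (z : SiteY x.toKIdx), (geo9Y x).dist (blkC x.toKIdx ιB z) (blkC x.toKIdx ιB (shiftY x.toKIdx μ z)) ≤ d₀ :=
    fun μ z => stencilF_blkC x.toKIdx ιB hι μ z
  have hd₀B : ∀ (μ : Fin (d + 1)) (z : SiteY x.toKIdx), (geo9Y x).dist (blkC x.toKIdx ιB z) (blkC x.toKIdx ιB ((shiftY x.toKIdx μ).symm z)) ≤ d₀ :=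
    fun μ z => stencilB_blkC x.toKIdx ιB hι μ z
  have hd₀FB : ∀ (μ : Fin (d + 1)) (z : SiteY x.toKIdx), (geo9Y x).dist (blkC x.toKIdx ιB z) (blkC x.toKIdx ιB (shiftY x.toKIdx μ z)) ≤ d₀ ∧
      (geo9Y x).dist (blkC x.toKIdx ιB z) (blkC x.toKIdx ιB ((shiftY x.toKIdx μ).symm z)) ≤ d₀ := fun μ z => ⟨hd₀F μ z, hd₀B μ z⟩
  have hρu : ∀ (μ : Fin (d + 1)) (z : SiteY x.toKIdx), ‖((UboxY x.toKIdx U μ z : 𝔸ˣ) : 𝔸)‖ ≤ 1 ∧ ‖(((UboxY x.toKIdx U μ z)⁻¹ : 𝔸ˣ) : 𝔸)‖ ≤ 1 :=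
    fun μ z => norm_le_one_and_inv_of_mem G hG1 (hU μ _ : UboxY x.toKIdx U μ z ∈ G)
  have hαδ : 0 ≤ 1 / 12 * δ₀ := by positivity
  have hT0 : ScaleTransfer (geo9Y x) δ₀ (1 / 12) Λ (fun _ => (1 : ℝ)) := fun y y' => by
    rw [mul_one, mul_one]
    have : Real.exp (-(1 / 12 * δ₀ * (geo9Y x).dist y y')) ≤ 1 := Real.exp_le_one_iff.2 (by nlinarith [hdnn y y', hδ₀.le])
    exact this.trans hΛ
  have heta : ∀ y : (geo9Y x).Site, η ≤ (geo9Y x).len y := eta_le_len x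
  have hcomm : ∀ (μ ν : Fin (d + 1)) (z : SiteY x.toKIdx), shiftY x.toKIdx μ (shiftY x.toKIdx ν z) = shiftY x.toKIdx ν (shiftY x.toKIdx μ z) :=
    shiftY_comm x
  -- the one-step backward scale comparability from the transfer of `ℓ⁻²`
  have hσ : ∀ (ν : Fin (d + 1)) (z : SiteY x.toKIdx), ((geo9Y x).len (blkC x.toKIdx ιB ((shiftY x.toKIdx ν).symm z)))⁻¹ ^ 2
      ≤ σ₁ * ((geo9Y x).len (blkC x.toKIdx ιB z))⁻¹ ^ 2 := fun ν z =>
    le_of_scaleTransfer (w := fun a => ((geo9Y x).len a)⁻¹ ^ 2) hTi2 hαδ (hd₀B ν z) (pow_nonneg (inv_nonneg.mpr (hlen _).le) _)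
  have hplaq' : ∀ (μ ν : Fin (d + 1)) (z : SiteY x.toKIdx) (X : 𝔸),
      ‖R (UboxY x.toKIdx U μ z * UboxY x.toKIdx U ν (shiftY x.toKIdx μ z)) X - R (UboxY x.toKIdx U ν z * UboxY x.toKIdx U μ (shiftY x.toKIdx ν z)) X‖
        ≤ cP * (η * ((geo9Y x).len (blkC x.toKIdx ιB z))⁻¹) ^ 2 * ‖X‖ := fun μ ν z X => hplaq μ ν z X
  -- the letters
  set Gu : Module.End ℝ (SiteY x.toKIdx → 𝔸) := (η ^ 2) • (GpY x.toKIdx par U).restrictScalars ℝ with hGu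
  set D : Fin (d + 1) ⊕ Fin (d + 1) → Module.End ℝ (SiteY x.toKIdx → 𝔸) := fun k => diffLetter (shiftY x.toKIdx) (UboxY x.toKIdx U) (((η : ℂ))⁻¹) k
    with hD
  -- READ the record: print's patterns, rate δ₀, constant Bin
  have hK : ∀ (n : Fin 6) (p q : (geo9Y x).Site), (Real.sqrt (Fintype.card ι) * M₂ * ∑ j, ‖b j‖) * B₀ * B9.pref6 ((geo9Y x).len p) n *
      Real.exp (-(δ₀ * (geo9Y x).dist p q)) = Bin * B9.pref6 ((geo9Y x).len p) n * Real.exp (-(δ₀ * (geo9Y x).dist p q)) := fun n p q => by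
    rw [hBin, hcL, hsι, hSbdef]
  have rr := fun μ ν => hasL2Majorant_recordWords_of_l2Block x ιB b hι hM₂ hrepr (0 : ℝ) True (B := bg9YC 𝔸 G P x) (fun U => U) (GpY x.toKIdx par) par hB₀
    hL2 μ ν
  have r1 : ∀ μ, HasL2Majorant (g := toB6 (geo9Y x) (0 : ℝ) True) (fun p : SiteY x.toKIdx × ι => blkC x.toKIdx ιB p.1) (conj b (D (Sum.inl μ)) * conj b Gu)
      (fun p q => Bin * (geo9Y x).len p * Real.exp (-(δ₀ * (geo9Y x).dist p q))) := fun μ => by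
    have h : HasL2Majorant (g := toB6 (geo9Y x) (0 : ℝ) True) (fun p : SiteY x.toKIdx × ι => blkC x.toKIdx ιB p.1) (conj b (D (Sum.inl μ) * Gu))
        (fun a a' => (Real.sqrt (Fintype.card ι) * M₂ * ∑ j, ‖b j‖) * B₀ * B9.pref6 ((geo9Y x).len a) 1 * Real.exp (-(δ₀ * (geo9Y x).dist a a'))) :=
      (rr μ μ).1
    rw [B9Eq352DivFormLetters.conj_mul] at h
    exact hasL2Majorant_mono (g := toB6 (geo9Y x) (0 : ℝ) True) _ h fun p q => le_of_eq (by rw [hK]; rfl)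
  have r2 : ∀ μ, HasL2Majorant (g := toB6 (geo9Y x) (0 : ℝ) True) (fun p : SiteY x.toKIdx × ι => blkC x.toKIdx ιB p.1) (conj b Gu * conj b (D (Sum.inr μ)))
      (fun p q => Bin * (geo9Y x).len p * Real.exp (-(δ₀ * (geo9Y x).dist p q))) := fun μ => by
    have h : HasL2Majorant (g := toB6 (geo9Y x) (0 : ℝ) True) (fun p : SiteY x.toKIdx × ι => blkC x.toKIdx ιB p.1) (conj b (Gu * D (Sum.inr μ)))
        (fun a a' => (Real.sqrt (Fintype.card ι) * M₂ * ∑ j, ‖b j‖) * B₀ * B9.pref6 ((geo9Y x).len a) 2 * Real.exp (-(δ₀ * (geo9Y x).dist a a'))) :=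
      (rr μ μ).2.1
    rw [B9Eq352DivFormLetters.conj_mul] at h
    exact hasL2Majorant_mono (g := toB6 (geo9Y x) (0 : ℝ) True) _ h fun p q => le_of_eq (by rw [hK]; rfl)
  have r3 : ∀ μ ν, HasL2Majorant (g := toB6 (geo9Y x) (0 : ℝ) True) (fun p : SiteY x.toKIdx × ι => blkC x.toKIdx ιB p.1)
      (conj b (D (Sum.inl μ)) * conj b (D (Sum.inl ν)) * conj b Gu) (fun p q => Bin * 1 * Real.exp (-(δ₀ * (geo9Y x).dist p q))) := fun μ ν => by
    have h : HasL2Majorant (g := toB6 (geo9Y x) (0 : ℝ) True) (fun p : SiteY x.toKIdx × ι => blkC x.toKIdx ιB p.1) (conj b (D (Sum.inl μ) * D (Sum.inl ν) * Gu))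
        (fun a a' => (Real.sqrt (Fintype.card ι) * M₂ * ∑ j, ‖b j‖) * B₀ * B9.pref6 ((geo9Y x).len a) 3 * Real.exp (-(δ₀ * (geo9Y x).dist a a'))) :=
      (rr μ ν).2.2.1
    rw [B9Eq352DivFormLetters.conj_mul, B9Eq352DivFormLetters.conj_mul] at h
    exact hasL2Majorant_mono (g := toB6 (geo9Y x) (0 : ℝ) True) _ h fun p q => le_of_eq (by rw [hK]; rfl)
  have r5 : ∀ μ ν, HasL2Majorant (g := toB6 (geo9Y x) (0 : ℝ) True) (fun p : SiteY x.toKIdx × ι => blkC x.toKIdx ιB p.1)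
      (conj b Gu * conj b (D (Sum.inr μ)) * conj b (D (Sum.inr ν))) (fun p q => Bin * 1 * Real.exp (-(δ₀ * (geo9Y x).dist p q))) := fun μ ν => by
    have h : HasL2Majorant (g := toB6 (geo9Y x) (0 : ℝ) True) (fun p : SiteY x.toKIdx × ι => blkC x.toKIdx ιB p.1) (conj b (Gu * D (Sum.inr μ) * D (Sum.inr ν)))
        (fun a a' => (Real.sqrt (Fintype.card ι) * M₂ * ∑ j, ‖b j‖) * B₀ * B9.pref6 ((geo9Y x).len a) 5 * Real.exp (-(δ₀ * (geo9Y x).dist a a'))) :=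
      (rr μ ν).2.2.2.2
    rw [B9Eq352DivFormLetters.conj_mul, B9Eq352DivFormLetters.conj_mul] at h
    exact hasL2Majorant_mono (g := toB6 (geo9Y x) (0 : ℝ) True) _ h fun p q => le_of_eq (by rw [hK]; rfl)
  -- rates
  set ρ₁ : ℝ := 5 * δ₀ / 6 with hρ₁
  set ρ₂ : ℝ := 2 * δ₀ / 3 with hρ₂
  have hρ₁0 : 0 ≤ ρ₁ := by rw [hρ₁]; positivity
  have hρ₂0 : 0 ≤ ρ₂ := by rw [hρ₂]; positivity
  have hr₁ : ρ₁ + (1 / 12 + 1 / 12) * δ₀ ≤ δ₀ := by rw [hρ₁]; linarith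
  have hρ₁δ : ρ₁ ≤ δ₀ := by rw [hρ₁]; linarith
  have hr₂ : ρ₂ + (1 / 12 + 1 / 12) * δ₀ ≤ ρ₁ := by rw [hρ₁, hρ₂]; linarith
  have hρ₂₁ : ρ₂ ≤ ρ₁ := by rw [hρ₁, hρ₂]; linarith
  -- the outer and inner step constants are bounded by `g_X`, `g_I` times the input constant (rates `≦ δ₀`)
  have hexp1 : ∀ r : ℝ, r ≤ δ₀ → Real.exp (r * d₀) ≤ Real.exp (δ₀ * d₀) := fun r hr =>
    Real.exp_le_exp.2 (mul_le_mul_of_nonneg_right hr (by rw [hd₀]; positivity))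
  have hexp2 : ∀ r : ℝ, r ≤ δ₀ → Real.exp (r * (2 * d₀)) ≤ Real.exp (δ₀ * (2 * d₀)) := fun r hr =>
    Real.exp_le_exp.2 (mul_le_mul_of_nonneg_right hr (by rw [hd₀]; positivity))
  have hstep : ∀ (r Bc : ℝ), r ≤ δ₀ → 0 ≤ Bc →
      (1 : ℝ) ^ 2 * M₂ * (∑ i, ‖b i‖) * Real.sqrt (Fintype.card ι) * Real.exp (r * d₀) * Λ * B6.c1 dL δ₀ (1 / 12) * Bc ≤ gX * Bc := by
    intro r Bc hr hBc
    have h1 : (1 : ℝ) ^ 2 * M₂ * (∑ i, ‖b i‖) * Real.sqrt (Fintype.card ι) * Real.exp (r * d₀) * Λ * B6.c1 dL δ₀ (1 / 12)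
        ≤ (1 : ℝ) ^ 2 * M₂ * Sb * sι * Real.exp (δ₀ * d₀) * Λ * c₁ := by
      rw [← hSbdef, ← hsι, ← hc₁]
      exact mul_le_mul_of_nonneg_right (mul_le_mul_of_nonneg_right (mul_le_mul_of_nonneg_left (hexp1 r hr) (by positivity)) hΛ0) hc₁0
    have h2 : (1 : ℝ) ^ 2 * M₂ * Sb * sι * Real.exp (δ₀ * d₀) * Λ * c₁ ≤ gX := by rw [hgX]; linarith
    exact mul_le_mul_of_nonneg_right (h1.trans h2) hBc
  have hstepI : ∀ (r Bc : ℝ), r ≤ δ₀ → 0 ≤ Bc →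
      (B6.c1 dL δ₀ (1 / 12) * M₂ * (∑ i, ‖b i‖) * Real.sqrt (Fintype.card ι)
        * ((1 : ℝ) ^ 2 * Real.exp (r * d₀) * Λ + (1 : ℝ) ^ 4 * cP * σ₁ * Real.exp (r * (2 * d₀)) * Λ)) * Bc ≤ gI * Bc := by
    intro r Bc hr hBc
    refine mul_le_mul_of_nonneg_right ?_ hBc
    rw [← hSbdef, ← hsι, ← hc₁, hgI]
    have hin : (1 : ℝ) ^ 2 * Real.exp (r * d₀) * Λ + (1 : ℝ) ^ 4 * cP * σ₁ * Real.exp (r * (2 * d₀)) * Λ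
        ≤ (1 : ℝ) ^ 2 * Real.exp (δ₀ * d₀) * Λ + (1 : ℝ) ^ 4 * cP * σ₁ * Real.exp (δ₀ * (2 * d₀)) * Λ :=
      add_le_add (mul_le_mul_of_nonneg_right (mul_le_mul_of_nonneg_left (hexp1 r hr) (by positivity)) hΛ0)
        (mul_le_mul_of_nonneg_right (mul_le_mul_of_nonneg_left (hexp2 r hr) (by positivity)) hΛ0)
    have h0 : 0 ≤ c₁ * M₂ * Sb * sι := by positivity
    have := mul_le_mul_of_nonneg_left hin h0
    linarith
  -- WORD 3.  inner switch (inl μ, inr ν) at rate ρ₁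
  have w3_li : ∀ μ ν, HasL2Majorant (g := toB6 (geo9Y x) (0 : ℝ) True) (fun p : SiteY x.toKIdx × ι => blkC x.toKIdx ιB p.1)
      (conj b (D (Sum.inl μ)) * conj b (D (Sum.inr ν)) * conj b Gu) (fun p q => (gI * Bin) * 1 * Real.exp (-(ρ₁ * (geo9Y x).dist p q))) := fun μ ν => by
    have h := hasL2Majorant_cross2_left_inner b (shiftY x.toKIdx) (UboxY x.toKIdx U) (Rr := (0 : ℝ)) (H := True) (g := geo9Y x)
      (fun z => blkC x.toKIdx ιB z) dL hη0 1 cP σ₁ d₀ M₂ δ₀ δ₀ (1 / 12) (1 / 12) ρ₁ Λ Λ Bin hcP hσ₁0 hδ₀.le hM₂ hBin0 hΛ0 hΛ0 hρ₁0 hr₁ hρ₁δ hrepr hdnn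
      htri hlen h261 hT0 hT1 μ ν (hcomm μ ν) hρu (hplaq' μ ν) hd₀FB (hσ ν) heta (Gp := conj b Gu) (r3 μ ν) (r1 ν)
    exact hasL2Majorant_mono (g := toB6 (geo9Y x) (0 : ℝ) True) _ h fun p q =>
      mul_le_mul_of_nonneg_right (mul_le_mul_of_nonneg_right (hstepI δ₀ Bin le_rfl hBin0) zero_le_one) (Real.exp_nonneg _)
  -- outer switch (inr μ, inl ν) at rate ρ₁ and (inr μ, inr ν) at rate ρ₂
  have w3_rl : ∀ μ ν, HasL2Majorant (g := toB6 (geo9Y x) (0 : ℝ) True) (fun p : SiteY x.toKIdx × ι => blkC x.toKIdx ιB p.1)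
      (conj b (D (Sum.inr μ)) * (conj b (D (Sum.inl ν)) * conj b Gu)) (fun p q => (gX * Bin) * 1 * Real.exp (-(ρ₁ * (geo9Y x).dist p q))) := fun μ ν => by
    have hin : HasL2Majorant (g := toB6 (geo9Y x) (0 : ℝ) True) (fun p : SiteY x.toKIdx × ι => blkC x.toKIdx ιB p.1)
        (conj b (D (Sum.inl μ)) * (conj b (D (Sum.inl ν)) * conj b Gu)) (fun p q => Bin * 1 * Real.exp (-(δ₀ * (geo9Y x).dist p q))) := by
      rw [← mul_assoc]; exact r3 μ ν
    have h := hasL2Majorant_cross_left b (shiftY x.toKIdx) (UboxY x.toKIdx U) (Rr := (0 : ℝ)) (H := True) (g := geo9Y x) (fun z => blkC x.toKIdx ιB z) dL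
      (((η : ℂ))⁻¹) 1 d₀ M₂ δ₀ δ₀ (1 / 12) (1 / 12) ρ₁ Λ Bin (fun _ => (1 : ℝ)) (fun _ => zero_le_one) hδ₀.le hM₂ hBin0 hΛ0 hρ₁0 hr₁ hρ₁δ hrepr hdnn htri
      h261 hT0 hρu hd₀B μ (Gp := conj b (D (Sum.inl ν)) * conj b Gu) hin
    exact hasL2Majorant_mono (g := toB6 (geo9Y x) (0 : ℝ) True) _ h fun p q =>
      mul_le_mul_of_nonneg_right (mul_le_mul_of_nonneg_right (hstep δ₀ Bin le_rfl hBin0) zero_le_one) (Real.exp_nonneg _)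
  have w3_rr : ∀ μ ν, HasL2Majorant (g := toB6 (geo9Y x) (0 : ℝ) True) (fun p : SiteY x.toKIdx × ι => blkC x.toKIdx ιB p.1)
      (conj b (D (Sum.inr μ)) * (conj b (D (Sum.inr ν)) * conj b Gu)) (fun p q => (gX * (gI * Bin)) * 1 * Real.exp (-(ρ₂ * (geo9Y x).dist p q))) :=
    fun μ ν => by
    have hin : HasL2Majorant (g := toB6 (geo9Y x) (0 : ℝ) True) (fun p : SiteY x.toKIdx × ι => blkC x.toKIdx ιB p.1)
        (conj b (D (Sum.inl μ)) * (conj b (D (Sum.inr ν)) * conj b Gu)) (fun p q => (gI * Bin) * 1 * Real.exp (-(ρ₁ * (geo9Y x).dist p q))) := by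
      rw [← mul_assoc]; exact w3_li μ ν
    have h := hasL2Majorant_cross_left b (shiftY x.toKIdx) (UboxY x.toKIdx U) (Rr := (0 : ℝ)) (H := True) (g := geo9Y x) (fun z => blkC x.toKIdx ιB z) dL
      (((η : ℂ))⁻¹) 1 d₀ M₂ δ₀ ρ₁ (1 / 12) (1 / 12) ρ₂ Λ (gI * Bin) (fun _ => (1 : ℝ)) (fun _ => zero_le_one) hρ₁0 hM₂ (mul_nonneg hgI0 hBin0) hΛ0 hρ₂0 hr₂
      hρ₂₁ hrepr hdnn htri h261 hT0 hρu hd₀B μ (Gp := conj b (D (Sum.inr ν)) * conj b Gu) hin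
    exact hasL2Majorant_mono (g := toB6 (geo9Y x) (0 : ℝ) True) _ h fun p q =>
      mul_le_mul_of_nonneg_right (mul_le_mul_of_nonneg_right (hstep ρ₁ (gI * Bin) hρ₁δ (mul_nonneg hgI0 hBin0)) zero_le_one) (Real.exp_nonneg _)
  -- WORD 5.  inner switch (inl μ, inr ν) at rate ρ₁
  have w5_li : ∀ μ ν, HasL2Majorant (g := toB6 (geo9Y x) (0 : ℝ) True) (fun p : SiteY x.toKIdx × ι => blkC x.toKIdx ιB p.1)
      (conj b Gu * conj b (D (Sum.inl μ)) * conj b (D (Sum.inr ν))) (fun p q => (gI * Bin) * 1 * Real.exp (-(ρ₁ * (geo9Y x).dist p q))) := fun μ ν => by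
    have h := hasL2Majorant_cross2_right_inner b (shiftY x.toKIdx) (UboxY x.toKIdx U) (Rr := (0 : ℝ)) (H := True) (g := geo9Y x)
      (fun z => blkC x.toKIdx ιB z) dL hη0 1 cP σ₁ d₀ M₂ δ₀ δ₀ (1 / 12) (1 / 12) ρ₁ Λ Λ Bin hcP hσ₁0 hM₂ hBin0 hΛ0 hΛ0 hρ₁0 hr₁ hrepr hdnn
      htri hlen h261 hT0 hTi2 μ ν (hcomm μ ν) hρu (hplaq' μ ν) hd₀FB (hσ ν) heta (Gp := conj b Gu) (r5 μ ν) (r2 μ)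
    exact hasL2Majorant_mono (g := toB6 (geo9Y x) (0 : ℝ) True) _ h fun p q =>
      mul_le_mul_of_nonneg_right (mul_le_mul_of_nonneg_right (hstepI ρ₁ Bin hρ₁δ hBin0) zero_le_one) (Real.exp_nonneg _)
  -- outer switch (inr μ, inl ν) at rate ρ₁ and (inl μ, inl ν) at rate ρ₂
  have w5_rl : ∀ μ ν, HasL2Majorant (g := toB6 (geo9Y x) (0 : ℝ) True) (fun p : SiteY x.toKIdx × ι => blkC x.toKIdx ιB p.1)
      (conj b Gu * conj b (D (Sum.inr μ)) * conj b (D (Sum.inl ν))) (fun p q => (gX * Bin) * 1 * Real.exp (-(ρ₁ * (geo9Y x).dist p q))) := fun μ ν => by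
    have h := hasL2Majorant_cross_right b (shiftY x.toKIdx) (UboxY x.toKIdx U) (Rr := (0 : ℝ)) (H := True) (g := geo9Y x) (fun z => blkC x.toKIdx ιB z) dL
      (((η : ℂ))⁻¹) 1 d₀ M₂ δ₀ δ₀ (1 / 12) (1 / 12) ρ₁ Λ Bin (fun _ => (1 : ℝ)) (fun _ => zero_le_one) hM₂ hBin0 hΛ hρ₁0 hr₁ hαδ hrepr hdnn htri h261
      hρu hd₀F ν (Gp := conj b Gu * conj b (D (Sum.inr μ))) (r5 μ ν)
    exact hasL2Majorant_mono (g := toB6 (geo9Y x) (0 : ℝ) True) _ h fun p q =>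
      mul_le_mul_of_nonneg_right (mul_le_mul_of_nonneg_right (hstep ρ₁ Bin hρ₁δ hBin0) zero_le_one) (Real.exp_nonneg _)
  have w5_ll : ∀ μ ν, HasL2Majorant (g := toB6 (geo9Y x) (0 : ℝ) True) (fun p : SiteY x.toKIdx × ι => blkC x.toKIdx ιB p.1)
      (conj b Gu * conj b (D (Sum.inl μ)) * conj b (D (Sum.inl ν))) (fun p q => (gX * (gI * Bin)) * 1 * Real.exp (-(ρ₂ * (geo9Y x).dist p q))) :=
    fun μ ν => by
    have h := hasL2Majorant_cross_right b (shiftY x.toKIdx) (UboxY x.toKIdx U) (Rr := (0 : ℝ)) (H := True) (g := geo9Y x) (fun z => blkC x.toKIdx ιB z) dL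
      (((η : ℂ))⁻¹) 1 d₀ M₂ δ₀ ρ₁ (1 / 12) (1 / 12) ρ₂ Λ (gI * Bin) (fun _ => (1 : ℝ)) (fun _ => zero_le_one) hM₂ (mul_nonneg hgI0 hBin0) hΛ hρ₂0 hr₂ hαδ
      hrepr hdnn htri h261 hρu hd₀F ν (Gp := conj b Gu * conj b (D (Sum.inl μ))) (w5_li μ ν)
    exact hasL2Majorant_mono (g := toB6 (geo9Y x) (0 : ℝ) True) _ h fun p q =>
      mul_le_mul_of_nonneg_right (mul_le_mul_of_nonneg_right (hstep ρ₂ (gI * Bin) (hρ₂₁.trans hρ₁δ) (mul_nonneg hgI0 hBin0)) zero_le_one)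
        (Real.exp_nonneg _)
  -- assemble: common constant `Bx = g_X·g_I·Bin`, common rate `δ₀/2`
  have hBx0 : 0 ≤ Bx := by rw [hBx]; positivity
  have hle1 : Bin ≤ Bx := by
    rw [hBx]
    calc Bin ≤ gI * Bin := le_mul_of_one_le_left hBin0 hgI1
      _ ≤ gX * (gI * Bin) := le_mul_of_one_le_left (mul_nonneg hgI0 hBin0) hgX1
      _ = gX * gI * Bin := by ring
  have hle2 : gX * Bin ≤ Bx := by
    rw [hBx, mul_assoc]; exact mul_le_mul_of_nonneg_left (le_mul_of_one_le_left hBin0 hgI1) hgX0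
  have hle3 : gI * Bin ≤ Bx := by rw [hBx, mul_assoc]; exact le_mul_of_one_le_left (mul_nonneg hgI0 hBin0) hgX1
  have hle4 : gX * (gI * Bin) ≤ Bx := by rw [hBx, mul_assoc]
  have mono : ∀ {Tm : Module.End ℝ (SiteY x.toKIdx × ι → ℝ)} {Bc r : ℝ} (n : Fin 6), 0 ≤ Bc → Bc ≤ Bx → δ₀ / 2 ≤ r →
      (∀ p : (geo9Y x).Site, (1 : ℝ) = B9.pref6 ((geo9Y x).len p) n) →
      HasL2Majorant (g := toB6 (geo9Y x) (0 : ℝ) True) (fun p : SiteY x.toKIdx × ι => blkC x.toKIdx ιB p.1) Tm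
        (fun p q => Bc * 1 * Real.exp (-(r * (geo9Y x).dist p q))) →
      HasL2Majorant (g := toB6 (geo9Y x) (0 : ℝ) True) (fun p : SiteY x.toKIdx × ι => blkC x.toKIdx ιB p.1) Tm
        (fun p q => Bx * B9.pref6 ((geo9Y x).len p) n * Real.exp (-(δ₀ / 2 * (geo9Y x).dist p q))) := by
    intro Tm Bc r n hBc hBcx hr hwn h
    have h' := hasL2Majorant_rate_mono (R := (0 : ℝ)) (H := True) (g := geo9Y x) _ Bc (fun _ => (1 : ℝ)) hBc (fun _ => zero_le_one) hr hdnn h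
    exact hasL2Majorant_mono (g := toB6 (geo9Y x) (0 : ℝ) True) _ h' fun p q => by
      rw [← hwn p]; exact mul_le_mul_of_nonneg_right (mul_le_mul_of_nonneg_right hBcx zero_le_one) (Real.exp_nonneg _)
  have h01 : δ₀ / 2 ≤ ρ₁ := by rw [hρ₁]; linarith
  have h02 : δ₀ / 2 ≤ ρ₂ := by rw [hρ₂]; linarith
  have h00 : δ₀ / 2 ≤ δ₀ := by linarith
  refine ⟨fun k l => ?_, fun k l => ?_⟩
  · -- word 3: `D k * D l * Gu`
    show HasL2Majorant (g := toB6 (geo9Y x) (0 : ℝ) True) (fun p : SiteY x.toKIdx × ι => blkC x.toKIdx ιB p.1) (conj b (D k * D l * Gu)) _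
    rw [B9Eq352DivFormLetters.conj_mul, B9Eq352DivFormLetters.conj_mul]
    cases k with
    | inl μ =>
      cases l with
      | inl ν => exact mono 3 hBin0 hle1 h00 (fun p => rfl) (r3 μ ν)
      | inr ν => exact mono 3 (mul_nonneg hgI0 hBin0) hle3 h01 (fun p => rfl) (w3_li μ ν)
    | inr μ =>
      cases l with
      | inl ν =>
        rw [mul_assoc]
        exact mono 3 (mul_nonneg hgX0 hBin0) hle2 h01 (fun p => rfl) (w3_rl μ ν)
      | inr ν =>
        rw [mul_assoc]
        exact mono 3 (mul_nonneg hgX0 (mul_nonneg hgI0 hBin0)) hle4 h02 (fun p => rfl) (w3_rr μ ν)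
  · -- word 5: `Gu * D k * D l`
    show HasL2Majorant (g := toB6 (geo9Y x) (0 : ℝ) True) (fun p : SiteY x.toKIdx × ι => blkC x.toKIdx ιB p.1) (conj b (Gu * D k * D l)) _
    rw [B9Eq352DivFormLetters.conj_mul, B9Eq352DivFormLetters.conj_mul]
    cases k with
    | inl μ =>
      cases l with
      | inl ν => exact mono 5 (mul_nonneg hgX0 (mul_nonneg hgI0 hBin0)) hle4 h02 (fun p => rfl) (w5_ll μ ν)
      | inr ν => exact mono 5 (mul_nonneg hgI0 hBin0) hle3 h01 (fun p => rfl) (w5_li μ ν)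
    | inr μ =>
      cases l with
      | inl ν => exact mono 5 (mul_nonneg hgX0 hBin0) hle2 h01 (fun p => rfl) (w5_rl μ ν)
      | inr ν => exact mono 5 hBin0 hle1 h00 (fun p => rfl) (r5 μ ν)

end Hin

/-! ## §2  ★★ hout: the record's (3.46) block at `U′U` from the augmented member's block, second differences included -/

section Hout

variable (G : Subgroup 𝔸ˣ) (x : MemberY d ℓ hd hL b₀ b₁ Mstar) (par : SiteParY 𝔸 x.toKIdx) {ι : Type} [Fintype ι] [DecidableEq ι]
  (b : Module.Basis ι ℝ 𝔸) (ιB : BlkY x.toKIdx → IBondY x.toKIdx) [Fintype (geo9Y x).Site] [DecidableEq (geo9Y x).Site]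
  (C37 C38 : ℝ → CfgY 𝔸 x.toKIdx → AfldY 𝔸 x.toKIdx → Prop)

/-- ★★ **THE TWO SECOND-ORDER `W`-FAMILIES AT ONE MEMBER** (the displayed hypotheses `hLL`, `hRR` of `B9SectBL2TransferConvY.l2Block_record_at_W_of_KSC₃`,
DISCHARGED modulo the plaquette law): for `(U, a)` in the coded class at `α₁ ≦ 1/4`, from `L2Block (KSC₃ …) B₀ δ₀ (.prod U a)` (letters at `U`, operator
`G′(W)`, `W = U′U`), the plaquette law `PlaqLawY c_P U`, Lemma 2.1 of [4] at `(δ₀, 1/12)` and the transfers of `ℓ, ℓ², ℓ⁻¹, ℓ⁻²`: block-`ℓ²` majorants at rate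
`2δ₀/3` of print's `∇_{W,μ}∇_{W,ν}·G_W` (constant `K_L·B_in`) and `G_W·∇*_{W,μ}∇*_{W,ν}` (constant `K_R·B_in`), `G_W = η²G′(W)`, `B_in = sι·M₂·Sb·B₀`.
[cite: Balaban1985BackgroundPropagators, p.403 l.1–9, (3.70) p.404, (3.74) p.405, (3.46) p.398, (3.37) p.396, p.404 (after (3.69)); Balaban1984PropagatorsII, Prop. 2.6 (2.140)–(2.141) p.247] -/
theorem secondWords_at_W (hι : ∀ s : BlkY x.toKIdx, β x.toKIdx.hN x.toKIdx.D x.toKIdx.hk (ιB s) = s)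
    (hG1 : ∀ u : 𝔸ˣ, u ∈ G → ‖(u : 𝔸)‖ ≤ 1) {M₂ : ℝ} (hM₂ : 0 ≤ M₂) (hrepr : ∀ (v : 𝔸) (j : ι), |b.repr v j| ≤ M₂ * ‖v‖)
    {Cq : ℝ} (hC37 : ∀ β' U a, C37 β' U a → GVal G x.toKIdx U ∧ CplxLettersY G x par ιB Cq β' U a)
    {δ₀ : ℝ} (hδ₀ : 0 < δ₀) {dL : ℕ} (h261 : Ineq261 dL (toB6 (geo9Y x) (0 : ℝ) True) δ₀ (1 / 12)) {Λ : ℝ} (hΛ : 0 ≤ Λ)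
    (hT1 : ScaleTransfer (geo9Y x) δ₀ (1 / 12) Λ (fun a => (geo9Y x).len a))
    (hT2 : ScaleTransfer (geo9Y x) δ₀ (1 / 12) Λ (fun a => (geo9Y x).len a ^ 2))
    (hTi : ScaleTransfer (geo9Y x) δ₀ (1 / 12) Λ (fun a => ((geo9Y x).len a)⁻¹))
    (hTi2 : ScaleTransfer (geo9Y x) δ₀ (1 / 12) Λ (fun a => ((geo9Y x).len a)⁻¹ ^ 2))
    {cP : ℝ} (hcP : 0 ≤ cP) {B₀ : ℝ} (hB₀ : 0 ≤ B₀) {U : CfgY 𝔸 x.toKIdx} {a : AfldY 𝔸 x.toKIdx} {α₁ : ℝ} (hα₁c : α₁ ≤ 1 / 4) (hC : C37 α₁ U a)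
    (hplaq : PlaqLawY x ιB cP U) (hL2 : L2Block (KSC₃ P G x par C37 C38) B₀ δ₀ (.prod U a)) :
    (∀ μ ν : Fin (d + 1), HasL2Majorant (g := toB6 (geo9Y x) (0 : ℝ) True) (fun p : SiteY x.toKIdx × ι => blkC x.toKIdx ιB p.1)
      (conj b (diffLetter (shiftY x.toKIdx) (UboxY x.toKIdx (mulY x.toKIdx (fluct (kGeo x.toKIdx).eta a) U)) ((((kGeo x.toKIdx).eta : ℂ))⁻¹) (Sum.inl μ)) *
        conj b (diffLetter (shiftY x.toKIdx) (UboxY x.toKIdx (mulY x.toKIdx (fluct (kGeo x.toKIdx).eta a) U)) ((((kGeo x.toKIdx).eta : ℂ))⁻¹) (Sum.inl ν)) *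
        conj b (((kGeo x.toKIdx).eta ^ 2) • (GpY x.toKIdx par (mulY x.toKIdx (fluct (kGeo x.toKIdx).eta a) U)).restrictScalars ℝ))
      (fun p q => (conv2ConstL cP M₂ (∑ j, ‖b j‖) (Real.sqrt (Fintype.card ι)) (2 * ((d : ℝ) + 1)) δ₀ (5 * δ₀ / 6) (1 / 4) Λ Λ (B6.c1 dL δ₀ (1 / 12))
          * ((Real.sqrt (Fintype.card ι) * M₂ * ∑ j, ‖b j‖) * B₀)) * 1 * Real.exp (-(2 * δ₀ / 3 * (geo9Y x).dist p q)))) ∧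
    (∀ μ ν : Fin (d + 1), HasL2Majorant (g := toB6 (geo9Y x) (0 : ℝ) True) (fun p : SiteY x.toKIdx × ι => blkC x.toKIdx ιB p.1)
      (conj b (((kGeo x.toKIdx).eta ^ 2) • (GpY x.toKIdx par (mulY x.toKIdx (fluct (kGeo x.toKIdx).eta a) U)).restrictScalars ℝ) *
        conj b (diffLetter (shiftY x.toKIdx) (UboxY x.toKIdx (mulY x.toKIdx (fluct (kGeo x.toKIdx).eta a) U)) ((((kGeo x.toKIdx).eta : ℂ))⁻¹) (Sum.inr μ)) *
        conj b (diffLetter (shiftY x.toKIdx) (UboxY x.toKIdx (mulY x.toKIdx (fluct (kGeo x.toKIdx).eta a) U)) ((((kGeo x.toKIdx).eta : ℂ))⁻¹) (Sum.inr ν)))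
      (fun p q => (conv2ConstR cP (Λ * Real.exp (1 / 12 * δ₀ * (2 * (2 * ((d : ℝ) + 1))))) M₂ (∑ j, ‖b j‖) (Real.sqrt (Fintype.card ι))
          (2 * ((d : ℝ) + 1)) (5 * δ₀ / 6) (2 * δ₀ / 3) (1 / 4) Λ Λ (B6.c1 dL δ₀ (1 / 12)) * ((Real.sqrt (Fintype.card ι) * M₂ * ∑ j, ‖b j‖) * B₀)) * 1 *
        Real.exp (-(2 * δ₀ / 3 * (geo9Y x).dist p q)))) := by
  -- constants
  set η : ℝ := (kGeo x.toKIdx).eta with hηdef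
  have hη0 : 0 < η := geo9K_eta_pos x.toKIdx
  set W : CfgY 𝔸 x.toKIdx := mulY x.toKIdx (fluct η a) U with hW
  set Bin : ℝ := (Real.sqrt (Fintype.card ι) * M₂ * ∑ j, ‖b j‖) * B₀ with hBin
  set d₀ : ℝ := 2 * ((d : ℝ) + 1) with hd₀
  set ρ₁ : ℝ := 5 * δ₀ / 6 with hρ₁
  set ρ₂ : ℝ := 2 * δ₀ / 3 with hρ₂
  set σ₂ : ℝ := Λ * Real.exp (1 / 12 * δ₀ * (2 * d₀)) with hσ₂
  have hSb : 0 ≤ ∑ j, ‖b j‖ := Finset.sum_nonneg fun j _ => norm_nonneg _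
  have hBin0 : 0 ≤ Bin := by positivity
  have hσ₂0 : 0 ≤ σ₂ := by positivity
  -- geometry of the member
  have hdnn : ∀ y y' : (geo9Y x).Site, 0 ≤ (geo9Y x).dist y y' := geo9Y_dist_nonneg x
  have htri : Triangle254 (toB6 (geo9Y x) (0 : ℝ) True) := fun p q r => geo9Y_dist_triangle x p q r
  have htri' : ∀ p q r : (geo9Y x).Site, (geo9Y x).dist p r ≤ (geo9Y x).dist p q + (geo9Y x).dist q r := fun p q r => geo9Y_dist_triangle x p q r
  have hlen : ∀ y : (geo9Y x).Site, 0 < (geo9Y x).len y := geo9Y_len_pos x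
  have hd₀FB : ∀ (μ : Fin (d + 1)) (z : SiteY x.toKIdx), (geo9Y x).dist (blkC x.toKIdx ιB z) (blkC x.toKIdx ιB (shiftY x.toKIdx μ z)) ≤ d₀ ∧
      (geo9Y x).dist (blkC x.toKIdx ιB z) (blkC x.toKIdx ιB ((shiftY x.toKIdx μ).symm z)) ≤ d₀ :=
    fun μ z => ⟨stencilF_blkC x.toKIdx ιB hι μ z, stencilB_blkC x.toKIdx ιB hι μ z⟩
  have heta : ∀ y : (geo9Y x).Site, η ≤ (geo9Y x).len y := eta_le_len x
  have hcomm : ∀ (μ ν : Fin (d + 1)) (z : SiteY x.toKIdx), shiftY x.toKIdx μ (shiftY x.toKIdx ν z) = shiftY x.toKIdx ν (shiftY x.toKIdx μ z) :=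
    shiftY_comm x
  have hαδ : 0 ≤ 1 / 12 * δ₀ := by positivity
  have hσ : ∀ (μ ν : Fin (d + 1)) (z : SiteY x.toKIdx),
      ((geo9Y x).len (blkC x.toKIdx ιB ((shiftY x.toKIdx ν).symm ((shiftY x.toKIdx μ).symm z))))⁻¹ ^ 2 ≤ σ₂ * ((geo9Y x).len (blkC x.toKIdx ιB z))⁻¹ ^ 2 := by
    intro μ ν z
    have hd2 : (geo9Y x).dist (blkC x.toKIdx ιB z) (blkC x.toKIdx ιB ((shiftY x.toKIdx ν).symm ((shiftY x.toKIdx μ).symm z))) ≤ 2 * d₀ := by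
      have h1 := (hd₀FB μ z).2
      have h2 := (hd₀FB ν ((shiftY x.toKIdx μ).symm z)).2
      have h3 := htri' (blkC x.toKIdx ιB z) (blkC x.toKIdx ιB ((shiftY x.toKIdx μ).symm z))
        (blkC x.toKIdx ιB ((shiftY x.toKIdx ν).symm ((shiftY x.toKIdx μ).symm z)))
      linarith
    exact le_of_scaleTransfer (w := fun a => ((geo9Y x).len a)⁻¹ ^ 2) hTi2 hαδ hd2 (pow_nonneg (inv_nonneg.mpr (hlen _).le) _)
  -- the class: `U` is `G`-valued, the (3.37) letters at `α₁ ≤ 1/4`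
  obtain ⟨hU, hcl⟩ := hC37 α₁ U a hC
  obtain ⟨hA, -⟩ := letters337_of_cplxLettersY G x par ιB hα₁c hU hcl
  have hA2 := letters337b_of_cplxLettersY G x par ιB hα₁c hU hcl
  have hρu : ∀ (μ : Fin (d + 1)) (z : SiteY x.toKIdx), ‖((UboxY x.toKIdx U μ z : 𝔸ˣ) : 𝔸)‖ ≤ 1 ∧ ‖(((UboxY x.toKIdx U μ z)⁻¹ : 𝔸ˣ) : 𝔸)‖ ≤ 1 :=
    fun μ z => norm_le_one_and_inv_of_mem G hG1 (hU μ _ : UboxY x.toKIdx U μ z ∈ G)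
  have hsmall : ∀ y : (geo9Y x).Site, η * ((1 / 4 : ℝ) * ((geo9Y x).len y)⁻¹) ≤ 1 / 4 := by
    intro y
    have hl := hlen y
    rw [show η * ((1 / 4 : ℝ) * ((geo9Y x).len y)⁻¹) = (1 / 4) * (η / (geo9Y x).len y) by ring]
    have : η / (geo9Y x).len y ≤ 1 := (div_le_one hl).mpr (heta y)
    linarith
  have hplaq' : ∀ (μ ν : Fin (d + 1)) (z : SiteY x.toKIdx) (X : 𝔸),
      ‖R (UboxY x.toKIdx U μ z * UboxY x.toKIdx U ν (shiftY x.toKIdx μ z)) X - R (UboxY x.toKIdx U ν z * UboxY x.toKIdx U μ (shiftY x.toKIdx ν z)) X‖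
        ≤ cP * (η * ((geo9Y x).len (blkC x.toKIdx ιB z))⁻¹) ^ 2 * ‖X‖ := fun μ ν z X => hplaq μ ν z X
  -- the letters
  set Gw : Module.End ℝ (SiteY x.toKIdx → 𝔸) := (η ^ 2) • (GpY x.toKIdx par W).restrictScalars ℝ with hGw
  set DU : Fin (d + 1) ⊕ Fin (d + 1) → Module.End ℝ (SiteY x.toKIdx → 𝔸) := fun k => diffLetter (shiftY x.toKIdx) (UboxY x.toKIdx U) (((η : ℂ))⁻¹) k
    with hDU
  have hUW : UboxY x.toKIdx W = prodCfg (UboxY x.toKIdx U) η (chartA x.toKIdx a) := by rw [UboxY_mulY_fluct]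
  -- READ: the words of `KSC₃` at the product, letters at `U`, rate δ₀, constant `Bin`
  have hRd := fun n k l => hasL2Majorant_wordL_of_l2AugS x ιB b hι hM₂ hrepr (0 : ℝ) True (B := (codingYx P G x C37 C38).bg) (fun c => c)
    (GpY x.toKIdx par) hB₀ (c := .prod U a) n (fun lam hh y y' hc hs => hL2 n lam hh y y' hc hs) k l
  have hK : ∀ (n : Fin 6) (p q : (geo9Y x).Site), (Real.sqrt (Fintype.card ι) * M₂ * ∑ j, ‖b j‖) * B₀ * B9.pref6 ((geo9Y x).len p) n *
      Real.exp (-(δ₀ * (geo9Y x).dist p q)) = Bin * B9.pref6 ((geo9Y x).len p) n * Real.exp (-(δ₀ * (geo9Y x).dist p q)) := fun n p q => by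
    rw [hBin]
  have g0 : HasL2Majorant (g := toB6 (geo9Y x) (0 : ℝ) True) (fun p : SiteY x.toKIdx × ι => blkC x.toKIdx ιB p.1) (conj b Gw)
      (fun p q => Bin * (geo9Y x).len p ^ 2 * Real.exp (-(δ₀ * (geo9Y x).dist p q))) :=
    hasL2Majorant_mono (g := toB6 (geo9Y x) (0 : ℝ) True) _ (hRd 0 (Sum.inl 0) (Sum.inl 0)) fun p q => le_of_eq (by rw [hK]; rfl)
  have g1 : ∀ k, HasL2Majorant (g := toB6 (geo9Y x) (0 : ℝ) True) (fun p : SiteY x.toKIdx × ι => blkC x.toKIdx ιB p.1) (conj b (DU k) * conj b Gw)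
      (fun p q => Bin * (geo9Y x).len p * Real.exp (-(δ₀ * (geo9Y x).dist p q))) := fun k => by
    have h : HasL2Majorant (g := toB6 (geo9Y x) (0 : ℝ) True) (fun p : SiteY x.toKIdx × ι => blkC x.toKIdx ιB p.1) (conj b (DU k * Gw))
        (fun p q => (Real.sqrt (Fintype.card ι) * M₂ * ∑ j, ‖b j‖) * B₀ * B9.pref6 ((geo9Y x).len p) 1 * Real.exp (-(δ₀ * (geo9Y x).dist p q))) :=
      hRd 1 k k
    rw [B9Eq352DivFormLetters.conj_mul] at h
    exact hasL2Majorant_mono (g := toB6 (geo9Y x) (0 : ℝ) True) _ h fun p q => le_of_eq (by rw [hK]; rfl)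
  have g2 : ∀ k, HasL2Majorant (g := toB6 (geo9Y x) (0 : ℝ) True) (fun p : SiteY x.toKIdx × ι => blkC x.toKIdx ιB p.1) (conj b Gw * conj b (DU k))
      (fun p q => Bin * (geo9Y x).len p * Real.exp (-(δ₀ * (geo9Y x).dist p q))) := fun k => by
    have h : HasL2Majorant (g := toB6 (geo9Y x) (0 : ℝ) True) (fun p : SiteY x.toKIdx × ι => blkC x.toKIdx ιB p.1) (conj b (Gw * DU k))
        (fun p q => (Real.sqrt (Fintype.card ι) * M₂ * ∑ j, ‖b j‖) * B₀ * B9.pref6 ((geo9Y x).len p) 2 * Real.exp (-(δ₀ * (geo9Y x).dist p q))) :=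
      hRd 2 k k
    rw [B9Eq352DivFormLetters.conj_mul] at h
    exact hasL2Majorant_mono (g := toB6 (geo9Y x) (0 : ℝ) True) _ h fun p q => le_of_eq (by rw [hK]; rfl)
  have g3 : ∀ k l, HasL2Majorant (g := toB6 (geo9Y x) (0 : ℝ) True) (fun p : SiteY x.toKIdx × ι => blkC x.toKIdx ιB p.1)
      (conj b (DU k) * conj b (DU l) * conj b Gw) (fun p q => Bin * 1 * Real.exp (-(δ₀ * (geo9Y x).dist p q))) := fun k l => by
    have h : HasL2Majorant (g := toB6 (geo9Y x) (0 : ℝ) True) (fun p : SiteY x.toKIdx × ι => blkC x.toKIdx ιB p.1) (conj b (DU k * DU l * Gw))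
        (fun p q => (Real.sqrt (Fintype.card ι) * M₂ * ∑ j, ‖b j‖) * B₀ * B9.pref6 ((geo9Y x).len p) 3 * Real.exp (-(δ₀ * (geo9Y x).dist p q))) :=
      hRd 3 k l
    rw [B9Eq352DivFormLetters.conj_mul, B9Eq352DivFormLetters.conj_mul] at h
    exact hasL2Majorant_mono (g := toB6 (geo9Y x) (0 : ℝ) True) _ h fun p q => le_of_eq (by rw [hK]; rfl)
  have g5 : ∀ k l, HasL2Majorant (g := toB6 (geo9Y x) (0 : ℝ) True) (fun p : SiteY x.toKIdx × ι => blkC x.toKIdx ιB p.1)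
      (conj b Gw * conj b (DU k) * conj b (DU l)) (fun p q => Bin * 1 * Real.exp (-(δ₀ * (geo9Y x).dist p q))) := fun k l => by
    have h : HasL2Majorant (g := toB6 (geo9Y x) (0 : ℝ) True) (fun p : SiteY x.toKIdx × ι => blkC x.toKIdx ιB p.1) (conj b (Gw * DU k * DU l))
        (fun p q => (Real.sqrt (Fintype.card ι) * M₂ * ∑ j, ‖b j‖) * B₀ * B9.pref6 ((geo9Y x).len p) 5 * Real.exp (-(δ₀ * (geo9Y x).dist p q))) :=
      hRd 5 k l
    rw [B9Eq352DivFormLetters.conj_mul, B9Eq352DivFormLetters.conj_mul] at h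
    exact hasL2Majorant_mono (g := toB6 (geo9Y x) (0 : ℝ) True) _ h fun p q => le_of_eq (by rw [hK]; rfl)
  -- rates
  have hρ₁0 : 0 ≤ ρ₁ := by rw [hρ₁]; positivity
  have hρ₂0 : 0 ≤ ρ₂ := by rw [hρ₂]; positivity
  have hr₁ : ρ₁ + (1 / 12 + 1 / 12) * δ₀ ≤ δ₀ := by rw [hρ₁]; linarith
  have hρ₁δ : ρ₁ ≤ δ₀ := by rw [hρ₁]; linarith
  have hr₂ : ρ₂ + (1 / 12 + 1 / 12) * δ₀ ≤ ρ₁ := by rw [hρ₁, hρ₂]; linarith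
  have hρ₂₁ : ρ₂ ≤ ρ₁ := by rw [hρ₁, hρ₂]; linarith
  refine ⟨fun μ ν => ?_, fun μ ν => ?_⟩
  · -- LEFT: `∇_{W,μ}∇_{W,ν}·Gw`
    rw [hUW]
    exact hasL2Majorant_diffLetter2_prodCfg_mul b (shiftY x.toKIdx) (UboxY x.toKIdx U) (Rr := (0 : ℝ)) (H := True) (g := geo9Y x)
      (fun z => blkC x.toKIdx ιB z) dL hη0 (chartA x.toKIdx a) d₀ M₂ (1 / 4) cP δ₀ δ₀ (1 / 12) (1 / 12) ρ₁ ρ₂ Λ Λ Bin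
      (by norm_num) hcP hM₂ hBin0 hΛ hΛ hρ₂0 hρ₁0 hr₁ hr₂ hρ₁δ hρ₂₁ hrepr hdnn htri hlen h261 hT1 hT2 hsmall hA hA2 hρu hd₀FB hcomm hplaq' heta μ ν
      (Gp := conj b Gw) g0 (g1 (Sum.inl μ)) (g1 (Sum.inl ν)) (g3 (Sum.inl μ) (Sum.inl ν))
  · -- RIGHT: `Gw·∇*_{W,μ}∇*_{W,ν}`
    rw [hUW]
    exact hasL2Majorant_mul_diffLetter2_prodCfg b (shiftY x.toKIdx) (UboxY x.toKIdx U) (Rr := (0 : ℝ)) (H := True) (g := geo9Y x)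
      (fun z => blkC x.toKIdx ιB z) dL hη0 (chartA x.toKIdx a) d₀ M₂ (1 / 4) cP σ₂ δ₀ δ₀ (1 / 12) (1 / 12) ρ₁ ρ₂ Λ Λ Bin
      (by norm_num) hcP hσ₂0 hM₂ hBin0 hΛ hΛ hρ₂0 hρ₁0 hr₁ hr₂ hρ₁δ hρ₂₁ hrepr hdnn htri hlen h261 hTi hTi2 hsmall hA hA2 hρu hd₀FB hcomm hplaq' hσ heta μ ν
      (Gp := conj b Gw) g0 (g2 (Sum.inr μ)) (g2 (Sum.inr ν)) (g5 (Sum.inr μ) (Sum.inr ν))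

/-- ★★ **THE RECORD's (3.46) BLOCK AT `W = U′U`, ALL SIX MEMBERS, FROM THE AUGMENTED MEMBER's BLOCK AT THE PRODUCT** — the hout side of the `L²` member
with the second differences supplied by `secondWords_at_W` (no displayed second-difference hypotheses; the plaquette law `PlaqLawY c_P U` of the base
instead): for `(U, a)` in the coded class at `α₁ ≦ 1/4`, `L2Block (KSC₃ …) B₀ δ₀ (.prod U a)`, Lemma 2.1 of [4] at `(δ₀, 1/12)` and the scale transfers of
`ℓ, ℓ², ℓ⁻¹, ℓ⁻²` give `L2Block (kernelFamilyS … id (GpY par) par) (c_L·convConst2L2) (δ₀/2) (U′U)` — members `0, 1, 2` and the mixed one by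
`hconvL2_words_at`, `∇_{U′U}∇_{U′U}G′` and `G′∇*_{U′U}∇*_{U′U}` by `secondWords_at_W`, written by `l2Block_kernelFamilyS_of_printWords`.
[cite: Balaban1985BackgroundPropagators, p.403 l.1–9, (3.70) p.404, (3.74) p.405, Thm 3.1 (3.46) p.398, Thm 3.4 p.400; Balaban1984PropagatorsII, Prop. 2.6 (2.140)–(2.141) p.247, Lemma 2.1 p.234] -/
theorem l2Block_record_at_W_of_KSC₃' (hι : ∀ s : BlkY x.toKIdx, β x.toKIdx.hN x.toKIdx.D x.toKIdx.hk (ιB s) = s)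
    (hG1 : ∀ u : 𝔸ˣ, u ∈ G → ‖(u : 𝔸)‖ ≤ 1) {M₂ : ℝ} (hM₂ : 0 ≤ M₂) (hrepr : ∀ (v : 𝔸) (j : ι), |b.repr v j| ≤ M₂ * ‖v‖)
    {Cq : ℝ} (hC37 : ∀ β' U a, C37 β' U a → GVal G x.toKIdx U ∧ CplxLettersY G x par ιB Cq β' U a)
    {δ₀ : ℝ} (hδ₀ : 0 < δ₀) {dL : ℕ} (h261 : Ineq261 dL (toB6 (geo9Y x) (0 : ℝ) True) δ₀ (1 / 12)) {Λ : ℝ} (hΛ : 0 ≤ Λ)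
    (hT1 : ScaleTransfer (geo9Y x) δ₀ (1 / 12) Λ (fun a => (geo9Y x).len a))
    (hT2 : ScaleTransfer (geo9Y x) δ₀ (1 / 12) Λ (fun a => (geo9Y x).len a ^ 2))
    (hTi : ScaleTransfer (geo9Y x) δ₀ (1 / 12) Λ (fun a => ((geo9Y x).len a)⁻¹))
    (hTi2 : ScaleTransfer (geo9Y x) δ₀ (1 / 12) Λ (fun a => ((geo9Y x).len a)⁻¹ ^ 2))
    {cP : ℝ} (hcP : 0 ≤ cP) {B₀ : ℝ} (hB₀ : 0 ≤ B₀) {U : CfgY 𝔸 x.toKIdx} {a : AfldY 𝔸 x.toKIdx} {α₁ : ℝ} (hα₁c : α₁ ≤ 1 / 4) (hC : C37 α₁ U a)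
    (hplaq : PlaqLawY x ιB cP U) (hL2 : L2Block (KSC₃ P G x par C37 C38) B₀ δ₀ (.prod U a)) :
    L2Block (kernelFamilyS x.toKIdx (bg9YC 𝔸 G P x) (fun U => U) (GpY x.toKIdx par) par)
      ((Real.sqrt (Fintype.card ι) * M₂ * ∑ j, ‖b j‖) * convConst2L2 cP M₂ (∑ j, ‖b j‖) (Real.sqrt (Fintype.card ι)) d dL δ₀ Λ B₀) (δ₀ / 2)
      (mulY x.toKIdx (fluct (kGeo x.toKIdx).eta a) U) := by
  obtain ⟨h0, h1, h2, h4⟩ := hconvL2_words_at P G x par b ιB C37 C38 hι hG1 hM₂ hrepr hC37 hδ₀ h261 hΛ hT1 hT2 hTi hB₀ hα₁c hC hL2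
  obtain ⟨hLL, hRR⟩ := secondWords_at_W P G x par b ιB C37 C38 hι hG1 hM₂ hrepr hC37 hδ₀ h261 hΛ hT1 hT2 hTi hTi2 hcP hB₀ hα₁c hC hplaq hL2
  have hSb : 0 ≤ ∑ j, ‖b j‖ := Finset.sum_nonneg fun j _ => norm_nonneg _
  obtain ⟨hBc0, hBL0, hBR0, hBx0⟩ := convConst2L2_nonneg (dL := dL) (δ₀ := δ₀) hcP hM₂ hSb (Real.sqrt_nonneg (Fintype.card ι)) d hΛ hB₀
  have hBx : convConst2L2 cP M₂ (∑ j, ‖b j‖) (Real.sqrt (Fintype.card ι)) d dL δ₀ Λ B₀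
      = max (convConstL2 M₂ (∑ j, ‖b j‖) (Real.sqrt (Fintype.card ι)) d dL δ₀ Λ B₀)
        (max (conv2ConstL cP M₂ (∑ j, ‖b j‖) (Real.sqrt (Fintype.card ι)) (2 * ((d : ℝ) + 1)) δ₀ (5 * δ₀ / 6) (1 / 4) Λ Λ (B6.c1 dL δ₀ (1 / 12))
            * ((Real.sqrt (Fintype.card ι) * M₂ * ∑ j, ‖b j‖) * B₀))
          (conv2ConstR cP (Λ * Real.exp (1 / 12 * δ₀ * (2 * (2 * ((d : ℝ) + 1))))) M₂ (∑ j, ‖b j‖) (Real.sqrt (Fintype.card ι))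
            (2 * ((d : ℝ) + 1)) (5 * δ₀ / 6) (2 * δ₀ / 3) (1 / 4) Λ Λ (B6.c1 dL δ₀ (1 / 12)) * ((Real.sqrt (Fintype.card ι) * M₂ * ∑ j, ‖b j‖) * B₀))) := rfl
  revert h0 h1 h2 h4 hLL hRR hBc0 hBL0 hBR0 hBx0 hBx
  generalize convConst2L2 cP M₂ (∑ j, ‖b j‖) (Real.sqrt (Fintype.card ι)) d dL δ₀ Λ B₀ = Bx
  generalize convConstL2 M₂ (∑ j, ‖b j‖) (Real.sqrt (Fintype.card ι)) d dL δ₀ Λ B₀ = Bc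
  generalize conv2ConstL cP M₂ (∑ j, ‖b j‖) (Real.sqrt (Fintype.card ι)) (2 * ((d : ℝ) + 1)) δ₀ (5 * δ₀ / 6) (1 / 4) Λ Λ (B6.c1 dL δ₀ (1 / 12))
    * ((Real.sqrt (Fintype.card ι) * M₂ * ∑ j, ‖b j‖) * B₀) = BL
  generalize conv2ConstR cP (Λ * Real.exp (1 / 12 * δ₀ * (2 * (2 * ((d : ℝ) + 1))))) M₂ (∑ j, ‖b j‖) (Real.sqrt (Fintype.card ι))
    (2 * ((d : ℝ) + 1)) (5 * δ₀ / 6) (2 * δ₀ / 3) (1 / 4) Λ Λ (B6.c1 dL δ₀ (1 / 12)) * ((Real.sqrt (Fintype.card ι) * M₂ * ∑ j, ‖b j‖) * B₀) = BR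
  intro h0 h1 h2 h4 hLL hRR hBc0 hBL0 hBR0 hBx0 hBx
  have hlen : ∀ y : (geo9Y x).Site, 0 < (geo9Y x).len y := geo9Y_len_pos x
  have hdnn : ∀ y y' : (geo9Y x).Site, 0 ≤ (geo9Y x).dist y y' := geo9Y_dist_nonneg x
  have hwℓ : ∀ p : (geo9Y x).Site, 0 ≤ (geo9Y x).len p := fun p => (hlen p).le
  have hBc_le : Bc ≤ Bx := by rw [hBx]; exact le_max_left _ _
  have hBL_le : BL ≤ Bx := by rw [hBx]; exact (le_max_left _ _).trans (le_max_right _ _)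
  have hBR_le : BR ≤ Bx := by rw [hBx]; exact (le_max_right _ _).trans (le_max_right _ _)
  -- every family up to the common constant `Bx` and the common rate `δ₀/2`
  have mono : ∀ {T : Module.End ℝ (SiteY x.toKIdx × ι → ℝ)} {B r : ℝ} (n : Fin 6) (w : (geo9Y x).Site → ℝ), (∀ p, 0 ≤ w p) → 0 ≤ B → B ≤ Bx → δ₀ / 2 ≤ r →
      (∀ p, w p = B9.pref6 ((geo9Y x).len p) n) →
      HasL2Majorant (g := toB6 (geo9Y x) (0 : ℝ) True) (fun p : SiteY x.toKIdx × ι => blkC x.toKIdx ιB p.1) T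
        (fun p q => B * w p * Real.exp (-(r * (geo9Y x).dist p q))) →
      HasL2Majorant (g := toB6 (geo9Y x) (0 : ℝ) True) (fun p : SiteY x.toKIdx × ι => blkC x.toKIdx ιB p.1) T
        (fun p q => Bx * B9.pref6 ((geo9Y x).len p) n * Real.exp (-(δ₀ / 2 * (geo9Y x).dist p q))) := by
    intro T B r n w hw hB hBx' hr hwn h
    have h' := hasL2Majorant_rate_mono (R := (0 : ℝ)) (H := True) (g := geo9Y x) _ B w hB hw hr hdnn h
    exact hasL2Majorant_mono (g := toB6 (geo9Y x) (0 : ℝ) True) _ h' fun p q => by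
      rw [← hwn p]; exact mul_le_mul_of_nonneg_right (mul_le_mul_of_nonneg_right hBx' (hw p)) (Real.exp_nonneg _)
  have hle : δ₀ / 2 ≤ δ₀ / 2 := le_rfl
  have hhalf₂ : δ₀ / 2 ≤ 2 * δ₀ / 3 := by linarith
  refine l2Block_kernelFamilyS_of_printWords x ιB b hι hM₂ hrepr (0 : ℝ) True (B := bg9YC 𝔸 G P x) (fun U => U) (GpY x.toKIdx par) par hBx0
    (c := mulY x.toKIdx (fluct (kGeo x.toKIdx).eta a) U) ?_ (fun μ => ?_) (fun μ => ?_) (fun μ ν => ?_) (fun μ ν => ?_) (fun μ ν => ?_)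
  · exact mono 0 (fun p => (geo9Y x).len p ^ 2) (fun p => sq_nonneg _) hBc0 hBc_le hle (fun p => rfl) h0
  · have h := h1 (Sum.inl μ)
    rw [← B9Eq352DivFormLetters.conj_mul] at h
    exact mono 1 (fun p => (geo9Y x).len p) hwℓ hBc0 hBc_le hle (fun p => rfl) h
  · have h := h2 (Sum.inr μ)
    rw [← B9Eq352DivFormLetters.conj_mul] at h
    exact mono 2 (fun p => (geo9Y x).len p) hwℓ hBc0 hBc_le hle (fun p => rfl) h
  · have h := hLL μ ν
    rw [← B9Eq352DivFormLetters.conj_mul, ← B9Eq352DivFormLetters.conj_mul] at h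
    exact mono 3 (fun _ => (1 : ℝ)) (fun _ => zero_le_one) hBL0 hBL_le hhalf₂ (fun p => rfl) h
  · have h := h4 (Sum.inl μ) (Sum.inr ν)
    rw [← B9Eq352DivFormLetters.conj_mul, ← B9Eq352DivFormLetters.conj_mul] at h
    exact mono 4 (fun _ => (1 : ℝ)) (fun _ => zero_le_one) hBc0 hBc_le hle (fun p => rfl) h
  · have h := hRR μ ν
    rw [← B9Eq352DivFormLetters.conj_mul, ← B9Eq352DivFormLetters.conj_mul] at h
    exact mono 5 (fun _ => (1 : ℝ)) (fun _ => zero_le_one) hBR0 hBR_le hhalf₂ (fun p => rfl) h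

end Hout


/-! ## §3  ★★ hin assembled: every member of the augmented `KSC₃` at a base from the record's (3.46) block -/

section Members

variable (G : Subgroup 𝔸ˣ) (x : MemberY d ℓ hd hL b₀ b₁ Mstar) (par : SiteParY 𝔸 x.toKIdx) {ι : Type} [Fintype ι] [DecidableEq ι]
  (b : Module.Basis ι ℝ 𝔸) (ιB : BlkY x.toKIdx → IBondY x.toKIdx) [Fintype (geo9Y x).Site] [DecidableEq (geo9Y x).Site]
  (C37 C38 : ℝ → CfgY 𝔸 x.toKIdx → AfldY 𝔸 x.toKIdx → Prop)

omit [NormOneClass 𝔸] in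
/-- ★ **THE AUGMENTED MEMBERS 3 AND 5 OF `KSC₃` AT A BASE** (the two second-order words in all patterns), completing
`B9SectBL2TransferInY.l2_KSC₃_base_of_record` (members 0, 1, 2, 4): from the record's (3.46) block `(B₀, δ₀)` at the `G`-valued base `U` and the
plaquette law `PlaqLawY c_P U`, with constant `c_L·cross2ConstL2` and rate `δ₀/2`.
[cite: Balaban1985BackgroundPropagators, Thm 3.1 (3.46) p.398, p.398 (first remark), p.404 (after (3.69)); Balaban1984PropagatorsII, Prop. 2.6 (2.140)–(2.141) p.247] -/
theorem l2_KSC₃_base_of_record₃₅ (hι : ∀ s : BlkY x.toKIdx, β x.toKIdx.hN x.toKIdx.D x.toKIdx.hk (ιB s) = s)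
    (hG1 : ∀ u : 𝔸ˣ, u ∈ G → ‖(u : 𝔸)‖ ≤ 1) {M₂ : ℝ} (hM₂ : 0 ≤ M₂) (hrepr : ∀ (v : 𝔸) (j : ι), |b.repr v j| ≤ M₂ * ‖v‖)
    {δ₀ : ℝ} (hδ₀ : 0 < δ₀) {dL : ℕ} (h261 : Ineq261 dL (toB6 (geo9Y x) (0 : ℝ) True) δ₀ (1 / 12)) {Λ : ℝ} (hΛ : 1 ≤ Λ)
    (hT1 : ScaleTransfer (geo9Y x) δ₀ (1 / 12) Λ (fun a => (geo9Y x).len a))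
    (hTi2 : ScaleTransfer (geo9Y x) δ₀ (1 / 12) Λ (fun a => ((geo9Y x).len a)⁻¹ ^ 2))
    {cP : ℝ} (hcP : 0 ≤ cP) {B₀ : ℝ} (hB₀ : 0 ≤ B₀) {U : CfgY 𝔸 x.toKIdx} (hU : GVal G x.toKIdx U) (hplaq : PlaqLawY x ιB cP U)
    (hL2 : L2Block (kernelFamilyS x.toKIdx (bg9YC 𝔸 G P x) (fun U => U) (GpY x.toKIdx par) par) B₀ δ₀ U)
    (n : Fin 6) (hn : n = 3 ∨ n = 5)
    (lam : (geo9Y x).Loc) (h : (geo9Y x).Cut) (y y' : IBondY x.toKIdx) (hcut : (geo9Y x).cutIn h y) (hsupp : (geo9Y x).suppIn lam y') :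
    (KSC₃ P G x par C37 C38).l2 n (.base U) lam h ≤
      ((Real.sqrt (Fintype.card ι) * M₂ * ∑ j, ‖b j‖) * cross2ConstL2 cP M₂ (∑ j, ‖b j‖) (Real.sqrt (Fintype.card ι)) d dL δ₀ Λ B₀) *
        B9.pref6 ((geo9Y x).len y) n * (geo9Y x).cutSup h * Real.exp (-(δ₀ / 2 * (geo9Y x).dist y y')) * (geo9Y x).l2Norm lam := by
  obtain ⟨h3, h5⟩ := hasL2Majorant_secondPatterns_of_l2Block P G x par b ιB hι hG1 hM₂ hrepr hδ₀ h261 hΛ hT1 hTi2 hcP hB₀ hU hplaq hL2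
  have hSb : 0 ≤ ∑ j, ‖b j‖ := Finset.sum_nonneg fun j _ => norm_nonneg _
  have hBx0 : 0 ≤ cross2ConstL2 cP M₂ (∑ j, ‖b j‖) (Real.sqrt (Fintype.card ι)) d dL δ₀ Λ B₀ :=
    cross2ConstL2_nonneg hcP hM₂ hSb (Real.sqrt_nonneg _) d dL δ₀ (le_trans zero_le_one hΛ) hB₀
  rw [KSC₃_l2]
  refine l2AugS_le_of_hasL2Majorant_wordL x ιB b hι hM₂ hrepr (0 : ℝ) True (B := (codingYx P G x C37 C38).bg) (fun c => c) (GpY x.toKIdx par) hBx0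
    (c := .base U) n (fun k l => ?_) lam h y y' hcut hsupp
  rcases hn with rfl | rfl
  · exact h3 k l
  · exact h5 k l

omit [NormOneClass 𝔸] in
/-- ★★ **hin FOR THE `L²` MEMBER: THE (3.46) BLOCK OF THE AUGMENTED FAMILY `KSC₃` AT A BASE FROM THE RECORD's** — all six members, every orientation
pattern, from the record's block `(B₀, δ₀)` at the `G`-valued base `U`, the plaquette law `PlaqLawY c_P U`, Lemma 2.1 of [4] at `(δ₀, 1/12)` and the scale
transfers of `ℓ`, `ℓ⁻²` (one constant `Λ ≧ 1`): `L2Block (KSC₃ …) (c_L·max(crossConstL2, cross2ConstL2)) (δ₀/2) (.base U)`.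
[cite: Balaban1985BackgroundPropagators, Thm 3.1 (3.46) p.398, p.398 (first remark), p.404 (after (3.69)); Balaban1984PropagatorsII, Prop. 2.6 (2.140)–(2.141) p.247, Lemma 2.1 p.234] -/
theorem l2Block_KSC₃_base_of_record (hι : ∀ s : BlkY x.toKIdx, β x.toKIdx.hN x.toKIdx.D x.toKIdx.hk (ιB s) = s)
    (hG1 : ∀ u : 𝔸ˣ, u ∈ G → ‖(u : 𝔸)‖ ≤ 1) {M₂ : ℝ} (hM₂ : 0 ≤ M₂) (hrepr : ∀ (v : 𝔸) (j : ι), |b.repr v j| ≤ M₂ * ‖v‖)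
    {δ₀ : ℝ} (hδ₀ : 0 < δ₀) {dL : ℕ} (h261 : Ineq261 dL (toB6 (geo9Y x) (0 : ℝ) True) δ₀ (1 / 12)) {Λ : ℝ} (hΛ : 1 ≤ Λ)
    (hT1 : ScaleTransfer (geo9Y x) δ₀ (1 / 12) Λ (fun a => (geo9Y x).len a))
    (hTi2 : ScaleTransfer (geo9Y x) δ₀ (1 / 12) Λ (fun a => ((geo9Y x).len a)⁻¹ ^ 2))
    {cP : ℝ} (hcP : 0 ≤ cP) {B₀ : ℝ} (hB₀ : 0 ≤ B₀) {U : CfgY 𝔸 x.toKIdx} (hU : GVal G x.toKIdx U) (hplaq : PlaqLawY x ιB cP U)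
    (hL2 : L2Block (kernelFamilyS x.toKIdx (bg9YC 𝔸 G P x) (fun U => U) (GpY x.toKIdx par) par) B₀ δ₀ U) :
    L2Block (KSC₃ P G x par C37 C38)
      ((Real.sqrt (Fintype.card ι) * M₂ * ∑ j, ‖b j‖) *
        max (crossConstL2 M₂ (∑ j, ‖b j‖) (Real.sqrt (Fintype.card ι)) d dL δ₀ Λ B₀)
          (cross2ConstL2 cP M₂ (∑ j, ‖b j‖) (Real.sqrt (Fintype.card ι)) d dL δ₀ Λ B₀)) (δ₀ / 2) (.base U) := by
  intro n lam h y y' hcut hsupp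
  have hcL : 0 ≤ Real.sqrt (Fintype.card ι) * M₂ * ∑ j, ‖b j‖ := by
    have := Finset.sum_nonneg fun j (_ : j ∈ Finset.univ) => norm_nonneg (b j); positivity
  have hrest : 0 ≤ B9.pref6 ((geo9Y x).len y) n * (geo9Y x).cutSup h * Real.exp (-(δ₀ / 2 * (geo9Y x).dist y y')) * (geo9Y x).l2Norm lam := by
    have := pref6_nonneg (geo9Y_len_pos x y).le n
    have := B9GeoNormsKLevelV1.geo9K_cutSup_nonneg x.toKIdx h
    have := B9GeoNormsKLevelV1.geo9K_l2Norm_nonneg x.toKIdx lam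
    positivity
  have up : ∀ {Bc : ℝ}, Bc ≤ max (crossConstL2 M₂ (∑ j, ‖b j‖) (Real.sqrt (Fintype.card ι)) d dL δ₀ Λ B₀)
        (cross2ConstL2 cP M₂ (∑ j, ‖b j‖) (Real.sqrt (Fintype.card ι)) d dL δ₀ Λ B₀) →
      (KSC₃ P G x par C37 C38).l2 n (.base U) lam h ≤ ((Real.sqrt (Fintype.card ι) * M₂ * ∑ j, ‖b j‖) * Bc) *
        B9.pref6 ((geo9Y x).len y) n * (geo9Y x).cutSup h * Real.exp (-(δ₀ / 2 * (geo9Y x).dist y y')) * (geo9Y x).l2Norm lam →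
      (KSC₃ P G x par C37 C38).l2 n (.base U) lam h ≤ ((Real.sqrt (Fintype.card ι) * M₂ * ∑ j, ‖b j‖) *
        max (crossConstL2 M₂ (∑ j, ‖b j‖) (Real.sqrt (Fintype.card ι)) d dL δ₀ Λ B₀)
          (cross2ConstL2 cP M₂ (∑ j, ‖b j‖) (Real.sqrt (Fintype.card ι)) d dL δ₀ Λ B₀)) *
        B9.pref6 ((geo9Y x).len y) n * (geo9Y x).cutSup h * Real.exp (-(δ₀ / 2 * (geo9Y x).dist y y')) * (geo9Y x).l2Norm lam := by
    intro Bc hBc hle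
    refine hle.trans ?_
    have h1 : (Real.sqrt (Fintype.card ι) * M₂ * ∑ j, ‖b j‖) * Bc ≤ (Real.sqrt (Fintype.card ι) * M₂ * ∑ j, ‖b j‖) *
        max (crossConstL2 M₂ (∑ j, ‖b j‖) (Real.sqrt (Fintype.card ι)) d dL δ₀ Λ B₀)
          (cross2ConstL2 cP M₂ (∑ j, ‖b j‖) (Real.sqrt (Fintype.card ι)) d dL δ₀ Λ B₀) := mul_le_mul_of_nonneg_left hBc hcL
    calc _ = ((Real.sqrt (Fintype.card ι) * M₂ * ∑ j, ‖b j‖) * Bc) *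
          (B9.pref6 ((geo9Y x).len y) n * (geo9Y x).cutSup h * Real.exp (-(δ₀ / 2 * (geo9Y x).dist y y')) * (geo9Y x).l2Norm lam) := by ring
      _ ≤ ((Real.sqrt (Fintype.card ι) * M₂ * ∑ j, ‖b j‖) *
          max (crossConstL2 M₂ (∑ j, ‖b j‖) (Real.sqrt (Fintype.card ι)) d dL δ₀ Λ B₀)
            (cross2ConstL2 cP M₂ (∑ j, ‖b j‖) (Real.sqrt (Fintype.card ι)) d dL δ₀ Λ B₀)) *
          (B9.pref6 ((geo9Y x).len y) n * (geo9Y x).cutSup h * Real.exp (-(δ₀ / 2 * (geo9Y x).dist y y')) * (geo9Y x).l2Norm lam) :=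
        mul_le_mul_of_nonneg_right h1 hrest
      _ = _ := by ring
  have hA := fun m hm => B9SectBL2TransferInYR.l2_KSC₃_base_of_record P G x par b ιB C37 C38 hι hG1 hM₂ hrepr hδ₀ h261 hΛ hT1 hB₀ hU hL2 m hm lam h y y'
    hcut hsupp
  have hB := fun m hm => l2_KSC₃_base_of_record₃₅ P G x par b ιB C37 C38 hι hG1 hM₂ hrepr hδ₀ h261 hΛ hT1 hTi2 hcP hB₀ hU hplaq hL2 m hm lam h y y'
    hcut hsupp
  match n with
  | 0 => exact up (le_max_left _ _) (hA 0 (Or.inl rfl))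
  | 1 => exact up (le_max_left _ _) (hA 1 (Or.inr (Or.inl rfl)))
  | 2 => exact up (le_max_left _ _) (hA 2 (Or.inr (Or.inr (Or.inl rfl))))
  | 3 => exact up (le_max_right _ _) (hB 3 (Or.inl rfl))
  | 4 => exact up (le_max_left _ _) (hA 4 (Or.inr (Or.inr (Or.inr rfl))))
  | 5 => exact up (le_max_right _ _) (hB 5 (Or.inr rfl))

end Members

/-! ## §4  The transported plaquette law from a bound on the plaquette variables (the bridge to `B9Eq335CoveragePAtLettersY`) -/

section PlaqFromHolonomy

variable (G : Subgroup 𝔸ˣ) (x : MemberY d ℓ hd hL b₀ b₁ Mstar) (ιB : BlkY x.toKIdx → IBondY x.toKIdx)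

end PlaqFromHolonomy

end Literature.MathematicalPhysics.QuantumFieldTheory.Balaban1983to89.B9SectBL2SecondOrderYR

end

/-!
# `Balaban1983to89.B9SectBCodedChainL2R` — THE CLASS-PARAMETRIC TWIN of `B9SectBCodedChainL2` (CASCADE-R, director-ym №279 GO-R; №277 (3) `hunitA` cure; dag-n06-d SOCKET-(α) class question)

statement-level skeleton of published theorems with citation tags; proofs where landed; nothing here is a claim about the
Yang–Mills mass gap

WHAT THIS FILE IS.  The original module `B9SectBCodedChainL2` types its objects over MODULE 3's member carrier `bg9Y 𝔸 G x` (MODULE 2's small-cube class (3.35)).  This file RE-DECLARES, with UNCHANGED NAMES inside the namespace `…B9SectBCodedChainL2R`, exactly its 6 class-dependent declarations over the CLASS-PARAMETRIC carrier `B9SectBCodedClassR.bg9YC 𝔸 G P x` (`P : RegExtraY …` = the two cube conditions of (3.35)∕(3.36) as a parameter; `bg9Y 𝔸 G x = bg9YC 𝔸 G (extraY 𝔸 G) x` by `rfl`, so every declaration here specialises definitionally to its original; at the record's reading of PRINT's class, `P := extraYPb 𝔸 G`, the displayed laws `hreg335P` ((3.35) on plaquettes) and the class-keyed `hunitA` become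 theorems).  The text is the original's VERBATIM under the token surgery `bg9Y 𝔸 G ↦ bg9YC 𝔸 G P`, `NAME ↦ NAME P` for the class-dependent names (P the first explicit argument), and — №277 — the binder `hunitA` re-keyed from «all G-valued U» to «all (3.35)-regular U of the carrier» (`∀ j α₀ U, (bg9YC 𝔸 G P (f j)).Reg335 c35 α₀ U → IsUnit (deltaAY …)`).  Class-free declarations of the original are NOT copied: they are imported and used BY NAME (`open … hiding` the re-declared ones).  Generated by dag-n06-c g16's `gen.py` (HOME `pub-ymgap-dag-n06-c/lean/g16/`); the ORIGINAL MODULE DOCUMENTATION FOLLOWS VERBATIM and describes the mathematics.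

HONEST SCOPE.  Re-typing bookkeeping; nothing of [B9] asserted beyond the original; COUNT-NEUTRAL; N06 NOT discharged; nothing continuum ∕ OS ∕ mass gap ∕ Clay.  Cell `pub-ymgap` (D-0062), Track A node N06 [B9], seat `pub-ymgap-dag-n06-c` g16, 2026-08-29.
-/

/-! Module documentation: that of the original `Balaban1983to89.B9SectBCodedChainL2` applies verbatim to this twin (not repeated here). -/

noncomputable section

namespace Literature.MathematicalPhysics.QuantumFieldTheory.Balaban1983to89.B9SectBCodedChainL2R

open Literature.MathematicalPhysics.QuantumFieldTheory.Balaban1983to89.B9SectBCodedClassR (RegExtraY bg9YC)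
open Literature.MathematicalPhysics.QuantumFieldTheory.Balaban1983to89.B9SectBCodedChainL2 hiding thms_KSC₃_base_of_KSC₂ thms_KSC₂_prod_of_KSC₃ thms_mono_B₀ hin_KSC₃_on_pos hout_KSC₃_on sectBStepPrinted_on_of_KSC₃

open Literature.MathematicalPhysics.QuantumFieldTheory.Balaban1983to89
open Literature.MathematicalPhysics.QuantumFieldTheory.Balaban1983to89.B6KLevelCensusIndexV1 (KIdx kGeo)
open Literature.MathematicalPhysics.QuantumFieldTheory.Balaban1983to89.B6Ineq2142KLevelV1 (β)
open Literature.MathematicalPhysics.QuantumFieldTheory.Balaban1983to89.B6RandomWalk (Ineq261)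
open Literature.MathematicalPhysics.QuantumFieldTheory.Balaban1983to89.B9Thm34Ext (toB6)
open Literature.MathematicalPhysics.QuantumFieldTheory.Balaban1983to89.B9Ineq347 (ScaleTransfer)
open Literature.MathematicalPhysics.QuantumFieldTheory.Balaban1983to89.B9FromB6 (EBlock GlobBlock L2Block pref6_nonneg)
open Literature.MathematicalPhysics.QuantumFieldTheory.Balaban1983to89.B9Eq39Adjoint (fluct)
open Literature.MathematicalPhysics.QuantumFieldTheory.Balaban1983to89.B9SectBCodedCarrier (CCfg Coding pullK pullS pullAn sectBStepPrinted_of_coded)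
open Literature.MathematicalPhysics.QuantumFieldTheory.Balaban1983to89.B9SectBStepFamilyTransferPos (sectBStepPrinted_of_family_pos)
open Literature.MathematicalPhysics.QuantumFieldTheory.Balaban1983to89.B9Eq360DeltaPrimeAY (AfldY mulY)
open Literature.MathematicalPhysics.QuantumFieldTheory.Balaban1983to89.B9PinMembersKLevelV1 (MemberY geo9Y bg9Y)
open Literature.MathematicalPhysics.QuantumFieldTheory.Balaban1983to89.B9SectBGpLettersY (GVal blkC)
open Literature.MathematicalPhysics.QuantumFieldTheory.Balaban1983to89.B9SectBGpFrameCodedYR (codingYx)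
open Literature.MathematicalPhysics.QuantumFieldTheory.Balaban1983to89.B9SectBGpFrameCodedY (CplxLettersY exists_d261)
open Literature.MathematicalPhysics.QuantumFieldTheory.Balaban1983to89.B9SectBGpReadingsYR (KSC)
open Literature.MathematicalPhysics.QuantumFieldTheory.Balaban1983to89.B9SectBGpTransferInYR (KSC_members_base)
open Literature.MathematicalPhysics.QuantumFieldTheory.Balaban1983to89.B9SectBGpTransferOutYR (KSC_members_prod ineq342_346_347_weaken ineq343_345_antitone)
open Literature.MathematicalPhysics.QuantumFieldTheory.Balaban1983to89.B9SectBGpTransferOutY (kernelFamilyS_members_nonneg)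
open Literature.MathematicalPhysics.QuantumFieldTheory.Balaban1983to89.B9SectBCodedChainGlobR (KSC₂ hin_KSC₂_on hout_KSC₂_on)
open Literature.MathematicalPhysics.QuantumFieldTheory.Balaban1983to89.B9SectBCodedChainOnSubfamilyR (hin_KSC_on)
open Literature.MathematicalPhysics.QuantumFieldTheory.Balaban1983to89.B9SectBL2DictionaryYR (KSC₃ KSC₃_l2)
open Literature.MathematicalPhysics.QuantumFieldTheory.Balaban1983to89.B9SectBL2SecondOrderYR (l2Block_KSC₃_base_of_record l2Block_record_at_W_of_KSC₃')
open Literature.MathematicalPhysics.QuantumFieldTheory.Balaban1983to89.B9SectBL2SecondOrderY (PlaqLawY convConst2L2 convConst2L2_nonneg cross2ConstL2 cross2ConstL2_nonneg)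
open Literature.MathematicalPhysics.QuantumFieldTheory.Balaban1983to89.B9SectBL2TransferInY (crossConstL2 crossConstL2_nonneg)
open Literature.MathematicalPhysics.QuantumFieldTheory.Balaban1983to89.B9RWSums347DefiniteFacesWindow (scaleTransfer6_window_geo9Y scaleTransfer_congr)
open Literature.MathematicalPhysics.QuantumFieldTheory.Balaban1983to89.B9GeoLemma21KLevelV1 (geo9Y_len_pos)
open Literature.MathematicalPhysics.QuantumFieldTheory.Balaban1983to89.B9GeoNormsKLevelV1 (geo9K_dist_nonneg)
open Literature.MathematicalPhysics.QuantumFieldTheory.Balaban1983to89.Node00 (SiteY BlkY IBondY CfgY SiteParY kernelFamilyS GpY)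

variable {d ℓ : ℕ} {hd : 1 ≤ d + 1} {hL : Odd (ℓ + 1) ∧ 1 < ℓ + 1} {b₀ b₁ : ℝ} {Mstar : ℕ}
variable {𝔸 : Type} [NormedRing 𝔸] (P : RegExtraY d ℓ hd hL b₀ b₁ Mstar 𝔸) [NormedAlgebra ℂ 𝔸] [CompleteSpace 𝔸] [NormOneClass 𝔸] [FiniteDimensional ℝ 𝔸]

/-! ## §1  At one member: the Theorem-3.1–3.3 blocks of `KSC₃` ↔ `KSC₂` with the `L²` member converted -/

section Member

variable (G : Subgroup 𝔸ˣ) (x : MemberY d ℓ hd hL b₀ b₁ Mstar) (par : SiteParY 𝔸 x.toKIdx)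
  (C37 C38 : ℝ → CfgY 𝔸 x.toKIdx → AfldY 𝔸 x.toKIdx → Prop)

omit [NormOneClass 𝔸] [FiniteDimensional ℝ 𝔸] in
/-- ★ **`KSC₃`'s THEOREM-3.1–3.3 BLOCK AT A BASE FROM `KSC₂`'s AND THE CONVERTED (3.46) BLOCK** (hin of the `L²` member): the (3.42)–(3.45) and (3.47)
members of `KSC₃` are `KSC₂`'s; the augmented (3.46) member is supplied separately (`B9SectBL2SecondOrderY.l2Block_KSC₃_base_of_record`); constants
`max B₀ B′`, rate `min δ₀ δ′`. [cite: Balaban1985BackgroundPropagators, Thms 3.1–3.3 (3.42)–(3.48) pp.397–399, bookkeeping] -/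
theorem thms_KSC₃_base_of_KSC₂ (dC : ℕ) (GA : B9.KernelFamily (geo9Y x) (codingYx P G x C37 C38).bg) (Cinv : B9.SiteKernel (geo9Y x) (codingYx P G x C37 C38).bg)
    {B₀ δ₀ : ℝ} {Bβ Bε : ℝ → ℝ} {Bεβ : ℝ → ℝ → ℝ} {B₁ δ₁ : ℝ} {U : CfgY 𝔸 x.toKIdx} (hB₀ : 0 ≤ B₀)
    (hGA1 : ∀ lam β' ζ, 0 ≤ GA.h1 (.base U) lam β' ζ) (hGA4 : ∀ lam y, 0 ≤ GA.e4 (.base U) lam y) (hGA2 : ∀ lam β' ζ, 0 ≤ GA.h2 (.base U) lam β' ζ)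
    (h : B9.Thms31to33IneqAt dC (KSC₂ P G x par C37 C38) GA Cinv B₀ δ₀ Bβ Bε Bεβ B₁ δ₁ (.base U))
    {B' δ' : ℝ} (hB' : 0 ≤ B') (hL : L2Block (KSC₃ P G x par C37 C38) B' δ' (.base U)) :
    B9.Thms31to33IneqAt dC (KSC₃ P G x par C37 C38) GA Cinv (max B₀ B') (min δ₀ δ') Bβ Bε Bεβ B₁ δ₁ (.base U) := by
  obtain ⟨⟨h42, h43⟩, hC, ⟨g42, g43⟩⟩ := h
  have h42' := ineq342_346_347_weaken P G x C37 C38 (KSC₂ P G x par C37 C38) hB₀ (le_max_left B₀ B') (min_le_left δ₀ δ') h42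
  have hL' := l2Block_weaken x (KSC₃ P G x par C37 C38) hB' (le_max_right B₀ B') (min_le_right δ₀ δ') hL
  have mK := KSC_members_base P G x par C37 C38 U
  have hnn := kernelFamilyS_members_nonneg x par (B := bg9YC 𝔸 G P x) (fun U => U) (GpY x.toKIdx par) U
  have hP1 : ∀ lam β' ζ, 0 ≤ (KSC₃ P G x par C37 C38).h1 (.base U) lam β' ζ := fun lam β' ζ => by
    show 0 ≤ (KSC P G x par C37 C38).h1 (.base U) lam β' ζ; rw [mK.1]; exact hnn.1 lam β' ζ
  have hP4 : ∀ lam y, 0 ≤ (KSC₃ P G x par C37 C38).e4 (.base U) lam y := fun lam y => by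
    show 0 ≤ (KSC P G x par C37 C38).e4 (.base U) lam y; rw [mK.2.1]; exact hnn.2.1 lam y
  have hP2 : ∀ lam β' ζ, 0 ≤ (KSC₃ P G x par C37 C38).h2 (.base U) lam β' ζ := fun lam β' ζ => by
    show 0 ≤ (KSC P G x par C37 C38).h2 (.base U) lam β' ζ; rw [mK.2.2.1]; exact hnn.2.2 lam β' ζ
  have h43' : B9.Ineq343_345 (KSC₃ P G x par C37 C38) Bβ Bε Bεβ δ₀ (.base U) := h43
  refine ⟨⟨⟨fun n lam y y' hs => h42'.1 n lam y y' hs, fun n lam hh y y' hc hs => hL' n lam hh y y' hc hs, fun n lam γ h4 h4' => h42'.2.2 n lam γ h4 h4'⟩,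
    ineq343_345_antitone P G x C37 C38 _ hP1 hP4 hP2 (min_le_left δ₀ δ') Bβ Bε Bεβ h43'⟩, hC,
    ⟨ineq342_346_347_weaken P G x C37 C38 GA hB₀ (le_max_left _ _) (min_le_left _ _) g42,
      ineq343_345_antitone P G x C37 C38 GA hGA1 hGA4 hGA2 (min_le_left δ₀ δ') Bβ Bε Bεβ g43⟩⟩

omit [NormOneClass 𝔸] [FiniteDimensional ℝ 𝔸] in
/-- ★ **`KSC₂`'s THEOREM-3.1–3.3 BLOCK AT A PRODUCT FROM `KSC₃`'s AND THE RECORD's CONVERTED (3.46) BLOCK AT `W = U′U`** (hout of the `L²` member): `KSC₂`'s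
(3.46) member at the product IS the record's at `W` (`KSC_members_prod`), supplied by `B9SectBL2SecondOrderY.l2Block_record_at_W_of_KSC₃'`; the other members
are `KSC₃`'s; constants `max B₀ B″`, rate `min δ₀ δ″`. [cite: Balaban1985BackgroundPropagators, Thms 3.1–3.3 (3.42)–(3.48) pp.397–399, p.403 l.1–9, bookkeeping] -/
theorem thms_KSC₂_prod_of_KSC₃ (dC : ℕ) (GA : B9.KernelFamily (geo9Y x) (codingYx P G x C37 C38).bg) (Cinv : B9.SiteKernel (geo9Y x) (codingYx P G x C37 C38).bg)
    {B₀ δ₀ : ℝ} {Bβ Bε : ℝ → ℝ} {Bεβ : ℝ → ℝ → ℝ} {B₁ δ₁ : ℝ} {U : CfgY 𝔸 x.toKIdx} {a : AfldY 𝔸 x.toKIdx} (hB₀ : 0 ≤ B₀)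
    (hGA1 : ∀ lam β' ζ, 0 ≤ GA.h1 (.prod U a) lam β' ζ) (hGA4 : ∀ lam y, 0 ≤ GA.e4 (.prod U a) lam y) (hGA2 : ∀ lam β' ζ, 0 ≤ GA.h2 (.prod U a) lam β' ζ)
    (h : B9.Thms31to33IneqAt dC (KSC₃ P G x par C37 C38) GA Cinv B₀ δ₀ Bβ Bε Bεβ B₁ δ₁ (.prod U a))
    {B'' δ'' : ℝ} (hB'' : 0 ≤ B'')
    (hconv : L2Block (kernelFamilyS x.toKIdx (bg9YC 𝔸 G P x) (fun U => U) (GpY x.toKIdx par) par) B'' δ'' (mulY x.toKIdx (fluct (kGeo x.toKIdx).eta a) U)) :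
    B9.Thms31to33IneqAt dC (KSC₂ P G x par C37 C38) GA Cinv (max B₀ B'') (min δ₀ δ'') Bβ Bε Bεβ B₁ δ₁ (.prod U a) := by
  obtain ⟨⟨h42, h43⟩, hC, ⟨g42, g43⟩⟩ := h
  have h42' := ineq342_346_347_weaken P G x C37 C38 (KSC₃ P G x par C37 C38) hB₀ (le_max_left B₀ B'') (min_le_left δ₀ δ'') h42
  have mK := KSC_members_prod P G x par C37 C38 U a
  have hnn := kernelFamilyS_members_nonneg x par (B := bg9YC 𝔸 G P x) (fun U => U) (GpY x.toKIdx par) (mulY x.toKIdx (fluct (kGeo x.toKIdx).eta a) U)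
  have hP1 : ∀ lam β' ζ, 0 ≤ (KSC₂ P G x par C37 C38).h1 (.prod U a) lam β' ζ := fun lam β' ζ => by
    show 0 ≤ (KSC P G x par C37 C38).h1 (.prod U a) lam β' ζ; rw [mK.1]; exact hnn.1 lam β' ζ
  have hP4 : ∀ lam y, 0 ≤ (KSC₂ P G x par C37 C38).e4 (.prod U a) lam y := fun lam y => by
    show 0 ≤ (KSC P G x par C37 C38).e4 (.prod U a) lam y; rw [mK.2.1]; exact hnn.2.1 lam y
  have hP2 : ∀ lam β' ζ, 0 ≤ (KSC₂ P G x par C37 C38).h2 (.prod U a) lam β' ζ := fun lam β' ζ => by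
    show 0 ≤ (KSC P G x par C37 C38).h2 (.prod U a) lam β' ζ; rw [mK.2.2.1]; exact hnn.2.2 lam β' ζ
  have h43' : B9.Ineq343_345 (KSC₂ P G x par C37 C38) Bβ Bε Bεβ δ₀ (.prod U a) := h43
  -- the record's converted (3.46) block at `W`, read as `KSC₂`'s member at the product, and weakened
  have hLK : L2Block (KSC₂ P G x par C37 C38) B'' δ'' (.prod U a) := by
    intro n lam hh y y' hc hs
    show (KSC P G x par C37 C38).l2 n (.prod U a) lam hh ≤ _
    rw [mK.2.2.2.1 n]
    exact hconv n lam hh y y' hc hs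
  have hL' := l2Block_weaken x (KSC₂ P G x par C37 C38) hB'' (le_max_right B₀ B'') (min_le_right δ₀ δ'') hLK
  refine ⟨⟨⟨fun n lam y y' hs => h42'.1 n lam y y' hs, fun n lam hh y y' hc hs => hL' n lam hh y y' hc hs, fun n lam γ h4 h4' => h42'.2.2 n lam γ h4 h4'⟩,
    ineq343_345_antitone P G x C37 C38 _ hP1 hP4 hP2 (min_le_left δ₀ δ'') Bβ Bε Bεβ h43'⟩, hC,
    ⟨ineq342_346_347_weaken P G x C37 C38 GA hB₀ (le_max_left _ _) (min_le_left _ _) g42,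
      ineq343_345_antitone P G x C37 C38 GA hGA1 hGA4 hGA2 (min_le_left δ₀ δ'') Bβ Bε Bεβ g43⟩⟩

omit [NormOneClass 𝔸] [FiniteDimensional ℝ 𝔸] in
/-- the Theorem-3.1–3.3 block is monotone in the constant `B₀` (no sign needed). [cite: Balaban1985BackgroundPropagators, Thms 3.1–3.3 pp.397–399, bookkeeping] -/
theorem thms_mono_B₀ (dC : ℕ) (K GA : B9.KernelFamily (geo9Y x) (codingYx P G x C37 C38).bg) (Cinv : B9.SiteKernel (geo9Y x) (codingYx P G x C37 C38).bg)
    {B₀ B₀' δ₀ : ℝ} {Bβ Bε : ℝ → ℝ} {Bεβ : ℝ → ℝ → ℝ} {B₁ δ₁ : ℝ} {c : (codingYx P G x C37 C38).bg.Cfg} (hle : B₀ ≤ B₀')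
    (h : B9.Thms31to33IneqAt dC K GA Cinv B₀ δ₀ Bβ Bε Bεβ B₁ δ₁ c) : B9.Thms31to33IneqAt dC K GA Cinv B₀' δ₀ Bβ Bε Bεβ B₁ δ₁ c := by
  obtain ⟨⟨h42, h43⟩, hC, ⟨g42, g43⟩⟩ := h
  exact ⟨⟨B9SectBGpTransferInYR.ineq342_346_347_mono P G x C37 C38 K hle h42, h43⟩, hC, ⟨B9SectBGpTransferInYR.ineq342_346_347_mono P G x C37 C38 GA hle g42, g43⟩⟩

end Member

/-! ## §2  ★★ On a subfamily: `hin` (positive input) and `hout` for `KSC₃` -/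

section Chain

variable {J : Type} (f : J → MemberY d ℓ hd hL b₀ b₁ Mstar) [∀ x : MemberY d ℓ hd hL b₀ b₁ Mstar, Fintype (geo9Y x).Site]
  [∀ x : MemberY d ℓ hd hL b₀ b₁ Mstar, DecidableEq (geo9Y x).Site]
  (G : Subgroup 𝔸ˣ) (par : ∀ j : J, SiteParY 𝔸 (f j).toKIdx) {ι : Type} [Fintype ι] [DecidableEq ι] (b : Module.Basis ι ℝ 𝔸)
  (ιB : ∀ j : J, BlkY (f j).toKIdx → IBondY (f j).toKIdx)
  (C37 C38 : ∀ j : J, ℝ → CfgY 𝔸 (f j).toKIdx → AfldY 𝔸 (f j).toKIdx → Prop)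

omit [NormOneClass 𝔸] in
/-- ★★ **`hin` FOR `KSC₃` ON A SUBFAMILY, POSITIVE INPUT RATE**: for `0 < δ₀`, above the thresholds of `hin_KSC₂_on` and of the `L²` conversions, at every
(3.35)-regular base the record family's Theorem-3.1–3.3 block (read along the decoding) gives `KSC₃`'s — the (3.42)–(3.45), (3.47) members by
`hin_KSC₂_on`, the augmented (3.46) member by `B9SectBL2SecondOrderY.l2Block_KSC₃_base_of_record` under the plaquette law of the regular bases
(`hplaq`, displayed: (3.35) ⇒ plaquette, `B9Eq335Plaquette`).  The arbitrary-sign input of `sectBStepPrinted_of_family` is NOT served here (Lemma 2.1 of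
[4] needs `0 < δ₀`); the positive-input packaging (`B9SectBStepWhole.StepPos`) is the tree's route for that.
[cite: Balaban1985BackgroundPropagators, Thms 3.1–3.3 (3.42)–(3.48) pp.397–399, (3.35) p.396, p.398 (first remark), p.404 (after (3.69)); Balaban1984PropagatorsII, Lemma 2.1 p.234] -/
theorem hin_KSC₃_on_pos (hι : ∀ (j : J) (s : BlkY (f j).toKIdx), β (f j).toKIdx.hN (f j).toKIdx.D (f j).toKIdx.hk (ιB j s) = s)
    (hG1 : ∀ u : 𝔸ˣ, u ∈ G → ‖(u : 𝔸)‖ ≤ 1) {M₂ : ℝ} (hM₂ : 0 ≤ M₂) (hrepr : ∀ (v : 𝔸) (j : ι), |b.repr v j| ≤ M₂ * ‖v‖) (c35 : ℝ) (dC : ℕ)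
    (GA : ∀ j : J, B9.KernelFamily (geo9Y (f j)) (codingYx P G (f j) (C37 j) (C38 j)).bg)
    (Cinv : ∀ j : J, B9.SiteKernel (geo9Y (f j)) (codingYx P G (f j) (C37 j) (C38 j)).bg)
    (hGA : ∀ (j : J) (c : (codingYx P G (f j) (C37 j) (C38 j)).bg.Cfg),
      (∀ lam β' ζ, 0 ≤ (GA j).h1 c lam β' ζ) ∧ (∀ lam y, 0 ≤ (GA j).e4 c lam y) ∧ (∀ lam β' ζ, 0 ≤ (GA j).h2 c lam β' ζ))
    {cP : ℝ} (hcP : 0 ≤ cP)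
    (hplaq : ∀ (j : J) (α₀ : ℝ) (U : CfgY 𝔸 (f j).toKIdx), (bg9YC 𝔸 G P (f j)).Reg335 c35 α₀ U → PlaqLawY (f j) (ιB j) cP U) :
    ∀ (B₀ δ₀ : ℝ) (Bβ Bε : ℝ → ℝ) (Bεβ : ℝ → ℝ → ℝ) (B₁ δ₁ : ℝ), 0 < δ₀ →
      ∃ (Mi ai B₀' δ₀' : ℝ) (Bβ' Bε' : ℝ → ℝ) (Bεβ' : ℝ → ℝ → ℝ) (B₁' δ₁' : ℝ), 0 < ai ∧
        ∀ j : J, Mi ≤ (geo9Y (f j)).M → ∀ α₀ : ℝ, 0 < α₀ → (geo9Y (f j)).M * α₀ ≤ ai →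
          ∀ c : (codingYx P G (f j) (C37 j) (C38 j)).bg.Cfg, (codingYx P G (f j) (C37 j) (C38 j)).bg.Reg335 c35 α₀ c →
          B9.Thms31to33IneqAt dC (pullK (codingYx P G (f j) (C37 j) (C38 j))
              (kernelFamilyS (f j).toKIdx (bg9YC 𝔸 G P (f j)) (fun U => U) (GpY (f j).toKIdx (par j)) (par j))) (GA j) (Cinv j) B₀ δ₀ Bβ Bε Bεβ B₁ δ₁ c →
          B9.Thms31to33IneqAt dC (KSC₃ P G (f j) (par j) (C37 j) (C38 j)) (GA j) (Cinv j) B₀' δ₀' Bβ' Bε' Bεβ' B₁' δ₁' c := by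
  intro B₀ δ₀ Bβ Bε Bεβ B₁ δ₁ hδ₀
  obtain ⟨Mi, ai, B₀', δ₀', Bβ', Bε', Bεβ', B₁', δ₁', hai, H⟩ :=
    hin_KSC₂_on P f G par b ιB C37 C38 hι hG1 hM₂ hrepr c35 dC GA Cinv B₀ δ₀ Bβ Bε Bεβ B₁ δ₁
  obtain ⟨d261, Mthr, hthr⟩ := exists_thresholds_L2 f
  set Sb : ℝ := ∑ j, ‖b j‖ with hSb
  set sι : ℝ := Real.sqrt (Fintype.card ι) with hsι
  set Λ : ℝ := ((ℓ : ℝ) + 1) ^ 4 with hΛ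
  set BL : ℝ := (sι * M₂ * Sb) * max (crossConstL2 M₂ Sb sι d (d261 δ₀) δ₀ Λ (max B₀ 0)) (cross2ConstL2 cP M₂ Sb sι d (d261 δ₀) δ₀ Λ (max B₀ 0))
    with hBL
  have hΛ1 : 1 ≤ Λ := one_le_pow₀ (by linarith [(Nat.cast_nonneg ℓ : (0 : ℝ) ≤ ℓ)])
  have hSb0 : 0 ≤ Sb := Finset.sum_nonneg fun j _ => norm_nonneg _
  have hsι0 : 0 ≤ sι := Real.sqrt_nonneg _
  have hBL0 : 0 ≤ BL := by
    have := crossConstL2_nonneg hM₂ hSb0 hsι0 d (d261 δ₀) δ₀ Λ (le_max_right B₀ 0)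
    rw [hBL]; exact mul_nonneg (by positivity) (le_max_of_le_left this)
  refine ⟨max Mi (Mthr δ₀), ai, max (max B₀' 0) BL, min δ₀' (δ₀ / 2), Bβ', Bε', Bεβ', B₁', δ₁', hai, fun j hM α₀ hα₀ hMa c hreg hT => ?_⟩
  · have hMi : Mi ≤ (geo9Y (f j)).M := le_trans (le_max_left _ _) hM
    have hMt : Mthr δ₀ ≤ (geo9Y (f j)).M := le_trans (le_max_right _ _) hM
    obtain ⟨h261, hT1, -, -, hTi2⟩ := hthr j δ₀ hδ₀ hMt
    -- the other members: `hin_KSC₂_on`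
    have hK2 := H j hMi α₀ hα₀ hMa c hreg hT
    obtain ⟨U, rfl, hU335⟩ := (codingYx P G (f j) (C37 j) (C38 j)).exists_of_bg_Reg335 hreg
    have hU : GVal G (f j).toKIdx U := hU335.1.1
    -- the record's (3.46) block at `U`, read off `hT` along the decoding
    have hL2 : L2Block (kernelFamilyS (f j).toKIdx (bg9YC 𝔸 G P (f j)) (fun U => U) (GpY (f j).toKIdx (par j)) (par j)) (max B₀ 0) δ₀ U := by
      refine l2Block_max_zero (f j) _ fun n lam hh y y' hc hs => ?_
      have h := hT.1.1.2.1 n lam hh y y' hc hs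
      exact h
    have hK3 := l2Block_KSC₃_base_of_record P G (f j) (par j) b (ιB j) (C37 j) (C38 j) (hι j) hG1 hM₂ hrepr hδ₀ h261 hΛ1 hT1 hTi2 hcP (le_max_right B₀ 0)
      hU (hplaq j α₀ U hU335) hL2
    have hK2' := thms_mono_B₀ P G (f j) (C37 j) (C38 j) dC _ (GA j) (Cinv j) (le_max_left B₀' 0) hK2
    have h := thms_KSC₃_base_of_KSC₂ P G (f j) (par j) (C37 j) (C38 j) dC (GA j) (Cinv j) (le_max_right B₀' 0) (hGA j _).1 (hGA j _).2.1 (hGA j _).2.2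
      hK2' hBL0 (by rw [hBL, hSb, hsι]; exact hK3)
    exact h

/-- ★★ **`hout` FOR `KSC₃` ON A SUBFAMILY**: `KSC₃`'s Theorem-3.1–3.3 block at the product ⟹ (the (3.46) member converted to the record's at `W = U′U` by
`B9SectBL2SecondOrderY.l2Block_record_at_W_of_KSC₃'`, under the plaquette law of the regular base, `hplaq`) `KSC₂`'s block at the product
(`thms_KSC₂_prod_of_KSC₃`) ⟹ the record family's block read along the decoding (`hout_KSC₂_on`).  Thresholds `max Mo (Mthr δ₀)`, caps `ao`,
`a′ ≦ min a (1/4)`, constants those of `hout_KSC₂_on` at the input `(max B₀ (c_L·convConst2L2), min δ₀ (δ₀/2))`.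
[cite: Balaban1985BackgroundPropagators, Thm 3.4 p.400, p.403 l.1–9, (3.46) p.398, (3.47) p.398, p.404 (after (3.69)); Balaban1984PropagatorsII, Lemma 2.1 p.234] -/
theorem hout_KSC₃_on (hG1 : ∀ u : 𝔸ˣ, u ∈ G → ‖(u : 𝔸)‖ ≤ 1) {M₂ : ℝ} (hM₂ : 0 ≤ M₂) (hrepr : ∀ (v : 𝔸) (j : ι), |b.repr v j| ≤ M₂ * ‖v‖)
    (hι : ∀ (j : J) (s : BlkY (f j).toKIdx), β (f j).toKIdx.hN (f j).toKIdx.D (f j).toKIdx.hk (ιB j s) = s)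
    {Cq : ℝ} (hC37 : ∀ j β' U a, C37 j β' U a → GVal G (f j).toKIdx U ∧ CplxLettersY G (f j) (par j) (ιB j) Cq β' U a) (c35 : ℝ) (dC : ℕ)
    (GA : ∀ j : J, B9.KernelFamily (geo9Y (f j)) (codingYx P G (f j) (C37 j) (C38 j)).bg)
    (Cinv : ∀ j : J, B9.SiteKernel (geo9Y (f j)) (codingYx P G (f j) (C37 j) (C38 j)).bg)
    (hGA : ∀ (j : J) (c : (codingYx P G (f j) (C37 j) (C38 j)).bg.Cfg),
      (∀ lam β' ζ, 0 ≤ (GA j).h1 c lam β' ζ) ∧ (∀ lam y, 0 ≤ (GA j).e4 c lam y) ∧ (∀ lam β' ζ, 0 ≤ (GA j).h2 c lam β' ζ))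
    {cP : ℝ} (hcP : 0 ≤ cP)
    (hplaq : ∀ (j : J) (α₀ : ℝ) (U : CfgY 𝔸 (f j).toKIdx), (bg9YC 𝔸 G P (f j)).Reg335 c35 α₀ U → PlaqLawY (f j) (ιB j) cP U) :
    ∀ (B₀ δ₀ : ℝ) (Bβ Bε : ℝ → ℝ) (Bεβ : ℝ → ℝ → ℝ) (B₁ δ₁ : ℝ) (acap : ℝ), 0 < B₀ → 0 < δ₀ → 0 < B₁ → 0 < δ₁ → 0 < acap →
      ∃ (Mo ao a' B₀' δ₀' : ℝ) (Bβ' Bε' : ℝ → ℝ) (Bεβ' : ℝ → ℝ → ℝ) (B₁' δ₁' : ℝ),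
        0 < ao ∧ 0 < a' ∧ a' ≤ acap ∧ 0 < B₀' ∧ 0 < δ₀' ∧ 0 < B₁' ∧ 0 < δ₁' ∧
        ∀ j : J, Mo ≤ (geo9Y (f j)).M → ∀ α₀ : ℝ, 0 < α₀ → (geo9Y (f j)).M * α₀ ≤ ao →
          ∀ c : (codingYx P G (f j) (C37 j) (C38 j)).bg.Cfg, (codingYx P G (f j) (C37 j) (C38 j)).bg.Reg335 c35 α₀ c →
          ∀ α₁ : ℝ, 0 < α₁ → α₁ ≤ a' → ∀ c' : (codingYx P G (f j) (C37 j) (C38 j)).bg.Cfg, (codingYx P G (f j) (C37 j) (C38 j)).bg.Cplx337 α₁ c c' →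
          B9.Thms31to33IneqAt dC (KSC₃ P G (f j) (par j) (C37 j) (C38 j)) (GA j) (Cinv j) B₀ δ₀ Bβ Bε Bεβ B₁ δ₁
              ((codingYx P G (f j) (C37 j) (C38 j)).bg.mul c' c) →
          B9.Thms31to33IneqAt dC (pullK (codingYx P G (f j) (C37 j) (C38 j))
              (kernelFamilyS (f j).toKIdx (bg9YC 𝔸 G P (f j)) (fun U => U) (GpY (f j).toKIdx (par j)) (par j))) (GA j) (Cinv j)
              B₀' δ₀' Bβ' Bε' Bεβ' B₁' δ₁' ((codingYx P G (f j) (C37 j) (C38 j)).bg.mul c' c) := by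
  intro B₀ δ₀ Bβ Bε Bεβ B₁ δ₁ acap hB₀ hδ₀ hB₁ hδ₁ hacap
  obtain ⟨d261, Mthr, hthr⟩ := exists_thresholds_L2 f
  set Sb : ℝ := ∑ j, ‖b j‖ with hSb
  set sι : ℝ := Real.sqrt (Fintype.card ι) with hsι
  set Λ : ℝ := ((ℓ : ℝ) + 1) ^ 4 with hΛ
  set B'' : ℝ := (sι * M₂ * Sb) * convConst2L2 cP M₂ Sb sι d (d261 δ₀) δ₀ Λ B₀ with hB''
  have hΛ0 : 0 ≤ Λ := by positivity
  have hSb0 : 0 ≤ Sb := Finset.sum_nonneg fun j _ => norm_nonneg _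
  have hsι0 : 0 ≤ sι := Real.sqrt_nonneg _
  have hB''0 : 0 ≤ B'' := by
    have := (convConst2L2_nonneg (dL := d261 δ₀) (δ₀ := δ₀) hcP hM₂ hSb0 hsι0 d hΛ0 hB₀.le).2.2.2
    rw [hB'']; exact mul_nonneg (by positivity) this
  obtain ⟨Mo, ao, a', B₀', δ₀', Bβ', Bε', Bεβ', B₁', δ₁', hao, ha', ha'a, hB₀', hδ₀', hB₁', hδ₁', H⟩ :=
    hout_KSC₂_on P f G par b ιB C37 C38 hG1 hM₂ hrepr hι hC37 c35 dC GA Cinv hGA (max B₀ B'') (min δ₀ (δ₀ / 2)) Bβ Bε Bεβ B₁ δ₁ (min acap (1 / 4))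
      (lt_max_of_lt_left hB₀) (lt_min hδ₀ (half_pos hδ₀)) hB₁ hδ₁ (lt_min hacap (by norm_num))
  refine ⟨max Mo (Mthr δ₀), ao, a', B₀', δ₀', Bβ', Bε', Bεβ', B₁', δ₁', hao, ha', ha'a.trans (min_le_left _ _), hB₀', hδ₀', hB₁', hδ₁',
    fun j hM α₀ hα₀ hMa c hreg α₁ hα₁ hα₁a c' h37 hT => ?_⟩
  have hMo : Mo ≤ (geo9Y (f j)).M := le_trans (le_max_left _ _) hM
  have hMt : Mthr δ₀ ≤ (geo9Y (f j)).M := le_trans (le_max_right _ _) hM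
  obtain ⟨h261, hT1, hT2, hTi, hTi2⟩ := hthr j δ₀ hδ₀ hMt
  obtain ⟨U, a, rfl, rfl, hC⟩ := (codingYx P G (f j) (C37 j) (C38 j)).exists_of_bg_Cplx337 h37
  have hα₁c : α₁ ≤ 1 / 4 := hα₁a.trans (ha'a.trans (min_le_right _ _))
  have hU335 : (bg9YC 𝔸 G P (f j)).Reg335 c35 α₀ U := hreg
  -- the (3.46) member of `KSC₃` at the product, then the record's (3.46) block at `W`
  have hL2 : L2Block (KSC₃ P G (f j) (par j) (C37 j) (C38 j)) B₀ δ₀ (.prod U a) := fun n lam hh y y' hc hs => hT.1.1.2.1 n lam hh y y' hc hs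
  have hconv := l2Block_record_at_W_of_KSC₃' P G (f j) (par j) b (ιB j) (C37 j) (C38 j) (hι j) hG1 hM₂ hrepr (hC37 j) hδ₀ h261 hΛ0 hT1 hT2 hTi hTi2
    hcP hB₀.le hα₁c hC (hplaq j α₀ U hU335) hL2
  -- `KSC₂`'s block at the product, then the record family's along the decoding
  have hK2 := thms_KSC₂_prod_of_KSC₃ P G (f j) (par j) (C37 j) (C38 j) dC (GA j) (Cinv j) hB₀.le (hGA j _).1 (hGA j _).2.1 (hGA j _).2.2 hT hB''0
    (by rw [hB'', hSb, hsι]; exact hconv)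
  exact H j hMo α₀ hα₀ hMa _ hreg α₁ hα₁ hα₁a _ h37 hK2

/-- ★★ **THE CODED-CARRIER CHAIN FOR `KSC₃` ON A SUBFAMILY** (as `B9SectBCodedChainGlob.sectBStepPrinted_on_of_KSC₂`, through the positive-input family
transfer `sectBStepPrinted_of_family_pos` with `hin_KSC₃_on_pos` and `hout_KSC₃_on`).  Displayed: the plaquette law of the regular bases (`hplaq`), the
record's Theorem-3.1–3.3 blocks at the regular bases with some positive constants (`hThms`, print p. 407 «assuming that Theorems 3.1–3.3 hold»), and
the Sect.-B step of the frames for `KSC₃` (`h`).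
[cite: Balaban1985BackgroundPropagators, Thm 3.4 p.400, Sect. B pp.400–407, p.403 l.1–9, p.407, (3.35)–(3.37) p.396, (3.46)–(3.47) p.398] -/
theorem sectBStepPrinted_on_of_KSC₃ (hG1 : ∀ u : 𝔸ˣ, u ∈ G → ‖(u : 𝔸)‖ ≤ 1) {M₂ : ℝ} (hM₂ : 0 ≤ M₂)
    (hrepr : ∀ (v : 𝔸) (j : ι), |b.repr v j| ≤ M₂ * ‖v‖)
    (hι : ∀ (j : J) (s : BlkY (f j).toKIdx), β (f j).toKIdx.hN (f j).toKIdx.D (f j).toKIdx.hk (ιB j s) = s)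
    {Cq : ℝ} (hC37 : ∀ j β' U a, C37 j β' U a → GVal G (f j).toKIdx U ∧ CplxLettersY G (f j) (par j) (ιB j) Cq β' U a) (c35 : ℝ) (dC : ℕ)
    (GA : ∀ j : J, B9.KernelFamily (geo9Y (f j)) (bg9YC 𝔸 G P (f j))) (Cinv : ∀ j : J, B9.SiteKernel (geo9Y (f j)) (bg9YC 𝔸 G P (f j)))
    (hGA : ∀ (j : J) (U : (bg9YC 𝔸 G P (f j)).Cfg),
      (∀ lam β' ζ, 0 ≤ (GA j).h1 U lam β' ζ) ∧ (∀ lam y, 0 ≤ (GA j).e4 U lam y) ∧ (∀ lam β' ζ, 0 ≤ (GA j).h2 U lam β' ζ))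
    {cP : ℝ} (hcP : 0 ≤ cP)
    (hplaq : ∀ (j : J) (α₀ : ℝ) (U : CfgY 𝔸 (f j).toKIdx), (bg9YC 𝔸 G P (f j)).Reg335 c35 α₀ U → PlaqLawY (f j) (ιB j) cP U)
    (IsAnK : ∀ j : J, B9.KernelFamily (geo9Y (f j)) (codingYx P G (f j) (C37 j) (C38 j)).bg → (codingYx P G (f j) (C37 j) (C38 j)).bg.Cfg → ℝ → Prop)
    (IsAn : ∀ j : J, B9.KernelFamily (geo9Y (f j)) (bg9YC 𝔸 G P (f j)) → (bg9YC 𝔸 G P (f j)).Cfg → ℝ → Prop)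
    {r αcap Mc ac : ℝ} (hr : 0 < r) (hcap : 0 < αcap) (hac : 0 < ac)
    (hAn : ∀ (j : J) (c : (codingYx P G (f j) (C37 j) (C38 j)).bg.Cfg) (α : ℝ),
      (IsAnK j (KSC₃ P G (f j) (par j) (C37 j) (C38 j)) c α →
        pullAn (codingYx P G (f j) (C37 j) (C38 j)) r (IsAn j)
          (pullK (codingYx P G (f j) (C37 j) (C38 j)) (kernelFamilyS (f j).toKIdx (bg9YC 𝔸 G P (f j)) (fun U => U) (GpY (f j).toKIdx (par j)) (par j))) c α) ∧
      (IsAnK j (pullK (codingYx P G (f j) (C37 j) (C38 j)) (GA j)) c α →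
        pullAn (codingYx P G (f j) (C37 j) (C38 j)) r (IsAn j) (pullK (codingYx P G (f j) (C37 j) (C38 j)) (GA j)) c α))
    (hclass : ∀ (j : J) (α₀ α₁ : ℝ) (U U' : (bg9YC 𝔸 G P (f j)).Cfg), Mc ≤ (geo9Y (f j)).M → 0 < α₀ → (geo9Y (f j)).M * α₀ ≤ ac →
      (bg9YC 𝔸 G P (f j)).Reg335 c35 α₀ U → 0 < α₁ → α₁ ≤ αcap → (bg9YC 𝔸 G P (f j)).Cplx337 α₁ U U' →
      ∃ a : (codingYx P G (f j) (C37 j) (C38 j)).A,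
        (codingYx P G (f j) (C37 j) (C38 j)).decA a = U' ∧ (codingYx P G (f j) (C37 j) (C38 j)).C37 (r * α₁) U a)
    (hThms : ∃ (Mt aT B₀ δ₀ : ℝ) (Bβ Bε : ℝ → ℝ) (Bεβ : ℝ → ℝ → ℝ) (B₁ δ₁ : ℝ), 0 < aT ∧ 0 < δ₀ ∧
      ∀ j : J, Mt ≤ (geo9Y (f j)).M → ∀ α₀ : ℝ, 0 < α₀ → (geo9Y (f j)).M * α₀ ≤ aT →
        ∀ c : (codingYx P G (f j) (C37 j) (C38 j)).bg.Cfg, (codingYx P G (f j) (C37 j) (C38 j)).bg.Reg335 c35 α₀ c →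
        B9.Thms31to33IneqAt dC (pullK (codingYx P G (f j) (C37 j) (C38 j))
            (kernelFamilyS (f j).toKIdx (bg9YC 𝔸 G P (f j)) (fun U => U) (GpY (f j).toKIdx (par j)) (par j)))
          (pullK (codingYx P G (f j) (C37 j) (C38 j)) (GA j)) (pullS (codingYx P G (f j) (C37 j) (C38 j)) (Cinv j)) B₀ δ₀ Bβ Bε Bεβ B₁ δ₁ c)
    (h : B9.SectBStepPrinted dC c35 (fun j => geo9Y (f j)) (fun j => (codingYx P G (f j) (C37 j) (C38 j)).bg)
      (fun j => KSC₃ P G (f j) (par j) (C37 j) (C38 j)) (fun j => pullK (codingYx P G (f j) (C37 j) (C38 j)) (GA j))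
      (fun j => pullS (codingYx P G (f j) (C37 j) (C38 j)) (Cinv j)) IsAnK) :
    B9.SectBStepPrinted dC c35 (fun j => geo9Y (f j)) (fun j => bg9YC 𝔸 G P (f j))
      (fun j => kernelFamilyS (f j).toKIdx (bg9YC 𝔸 G P (f j)) (fun U => U) (GpY (f j).toKIdx (par j)) (par j)) GA Cinv IsAn := by
  have hGA' : ∀ (j : J) (c : (codingYx P G (f j) (C37 j) (C38 j)).bg.Cfg),
      (∀ lam β' ζ, 0 ≤ (pullK (codingYx P G (f j) (C37 j) (C38 j)) (GA j)).h1 c lam β' ζ) ∧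
      (∀ lam y, 0 ≤ (pullK (codingYx P G (f j) (C37 j) (C38 j)) (GA j)).e4 c lam y) ∧
      (∀ lam β' ζ, 0 ≤ (pullK (codingYx P G (f j) (C37 j) (C38 j)) (GA j)).h2 c lam β' ζ) := fun j c => hGA j _
  refine sectBStepPrinted_of_coded dC c35 (fun j => geo9Y (f j)) (fun j => bg9YC 𝔸 G P (f j)) (fun j => codingYx P G (f j) (C37 j) (C38 j))
    (fun j => kernelFamilyS (f j).toKIdx (bg9YC 𝔸 G P (f j)) (fun U => U) (GpY (f j).toKIdx (par j)) (par j)) GA Cinv IsAn hr hcap hac hclass ?_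
  exact sectBStepPrinted_of_family_pos dC c35 (fun j => geo9Y (f j)) (fun j => (codingYx P G (f j) (C37 j) (C38 j)).bg)
    (fun j => KSC₃ P G (f j) (par j) (C37 j) (C38 j))
    (fun j => pullK (codingYx P G (f j) (C37 j) (C38 j)) (kernelFamilyS (f j).toKIdx (bg9YC 𝔸 G P (f j)) (fun U => U) (GpY (f j).toKIdx (par j)) (par j)))
    (fun j => pullK (codingYx P G (f j) (C37 j) (C38 j)) (GA j)) (fun j => pullK (codingYx P G (f j) (C37 j) (C38 j)) (GA j))
    (fun j => pullS (codingYx P G (f j) (C37 j) (C38 j)) (Cinv j)) IsAnK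
    (fun j => pullAn (codingYx P G (f j) (C37 j) (C38 j)) r (IsAn j)) hThms
    (fun B₀ δ₀ Bβ Bε Bεβ B₁ δ₁ hδ₀ => hin_KSC₃_on_pos P f G par b ιB C37 C38 hι hG1 hM₂ hrepr c35 dC _ _ hGA' hcP hplaq B₀ δ₀ Bβ Bε Bεβ B₁ δ₁ hδ₀)
    (hout_KSC₃_on P f G par b ιB C37 C38 hG1 hM₂ hrepr hι hC37 c35 dC _ _ hGA' hcP hplaq) hAn h

end Chain

end Literature.MathematicalPhysics.QuantumFieldTheory.Balaban1983to89.B9SectBCodedChainL2R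

end

/-!
# `Balaban1983to89.B9SectBCodedReadingsUR` — THE CLASS-PARAMETRIC TWIN of `B9SectBCodedReadingsU` (CASCADE-R, director-ym №279 GO-R; №277 (3) `hunitA` cure; dag-n06-d SOCKET-(α) class question)

statement-level skeleton of published theorems with citation tags; proofs where landed; nothing here is a claim about the
Yang–Mills mass gap

WHAT THIS FILE IS.  The original module `B9SectBCodedReadingsU` types its objects over MODULE 3's member carrier `bg9Y 𝔸 G x` (MODULE 2's small-cube class (3.35)).  This file RE-DECLARES, with UNCHANGED NAMES inside the namespace `…B9SectBCodedReadingsUR`, exactly its 5 class-dependent declarations over the CLASS-PARAMETRIC carrier `B9SectBCodedClassR.bg9YC 𝔸 G P x` (`P : RegExtraY …` = the two cube conditions of (3.35)∕(3.36) as a parameter; `bg9Y 𝔸 G x = bg9YC 𝔸 G (extraY 𝔸 G) x` by `rfl`, so every declaration here specialises definitionally to its original; at the record's reading of PRINT's class, `P := extraYPb 𝔸 G`, the displayed laws `hreg335P` ((3.35) on plaquettes) and the class-keyed `hunitA` become theorems).  The text is the original's VERBATIM under the token surgery `bg9Y 𝔸 G ↦ bg9YC 𝔸 G P`, `NAME ↦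 NAME P` for the class-dependent names (P the first explicit argument), and — №277 — the binder `hunitA` re-keyed from «all G-valued U» to «all (3.35)-regular U of the carrier» (`∀ j α₀ U, (bg9YC 𝔸 G P (f j)).Reg335 c35 α₀ U → IsUnit (deltaAY …)`).  Class-free declarations of the original are NOT copied: they are imported and used BY NAME (`open … hiding` the re-declared ones).  Generated by dag-n06-c g16's `gen.py` (HOME `pub-ymgap-dag-n06-c/lean/g16/`); the ORIGINAL MODULE DOCUMENTATION FOLLOWS VERBATIM and describes the mathematics.

HONEST SCOPE.  Re-typing bookkeeping; nothing of [B9] asserted beyond the original; COUNT-NEUTRAL; N06 NOT discharged; nothing continuum ∕ OS ∕ mass gap ∕ Clay.  Cell `pub-ymgap` (D-0062), Track A node N06 [B9], seat `pub-ymgap-dag-n06-c` g16, 2026-08-29.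
-/

/-! Module documentation: that of the original `Balaban1983to89.B9SectBCodedReadingsU` applies verbatim to this twin (not repeated here). -/

noncomputable section

namespace Literature.MathematicalPhysics.QuantumFieldTheory.Balaban1983to89.B9SectBCodedReadingsUR

open Literature.MathematicalPhysics.QuantumFieldTheory.Balaban1983to89.B9SectBCodedClassR (RegExtraY bg9YC)
open Literature.MathematicalPhysics.QuantumFieldTheory.Balaban1983to89.B9SectBCodedReadingsU hiding KSCU KACU KSCU_h1_inl SectBStepU Thm34U

open Literature.MathematicalPhysics.QuantumFieldTheory.Balaban1983to89.B6Ineq2142KLevelV1 (β)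
open Literature.MathematicalPhysics.QuantumFieldTheory.Balaban1983to89.B9FromB6 (EBlock)
open Literature.MathematicalPhysics.QuantumFieldTheory.Balaban1983to89.B9SectBCodedCarrier (CCfg Coding pullK pullS)
open Literature.MathematicalPhysics.QuantumFieldTheory.Balaban1983to89.B9Eq360DeltaPrimeAY (AfldY)
open Literature.MathematicalPhysics.QuantumFieldTheory.Balaban1983to89.B9PinMembersKLevelV1 (MemberY geo9Y bg9Y)
open Literature.MathematicalPhysics.QuantumFieldTheory.Balaban1983to89.B9SectBGpLettersY (GVal decY)
open Literature.MathematicalPhysics.QuantumFieldTheory.Balaban1983to89.B9SectBGpFrameCodedYR (codingYx)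
open Literature.MathematicalPhysics.QuantumFieldTheory.Balaban1983to89.B9SectBGpReadingsYR (KSC)
open Literature.MathematicalPhysics.QuantumFieldTheory.Balaban1983to89.B9SectBGpReadingsY (baseY)
open Literature.MathematicalPhysics.QuantumFieldTheory.Balaban1983to89.B9SectBCodedChainAnR (IsAnKY)
open Literature.MathematicalPhysics.QuantumFieldTheory.Balaban1983to89.B9SectBH1ReadWriteY (h1ReadT)
open Literature.MathematicalPhysics.QuantumFieldTheory.Balaban1983to89.Node00 (SiteY BlkY FBondY IBondY CfgY SiteParY BondParY SiteOpY BondOpY kernelFamilyS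
  kernelFamilyB GpY)
open Literature.MathematicalPhysics.QuantumFieldTheory.Balaban1983to89.Node00.OpsYULetters (kernelFamilySU kernelFamilyBU)

variable {d ℓ : ℕ} {hd : 1 ≤ d + 1} {hL : Odd (ℓ + 1) ∧ 1 < ℓ + 1} {b₀ b₁ : ℝ} {Mstar : ℕ}
variable {𝔸 : Type} [NormedRing 𝔸] (P : RegExtraY d ℓ hd hL b₀ b₁ Mstar 𝔸) [NormedAlgebra ℂ 𝔸] [CompleteSpace 𝔸]

/-! ## §1 The U-letter coded readings -/

section Readings

variable (G : Subgroup 𝔸ˣ) (x : MemberY d ℓ hd hL b₀ b₁ Mstar) (par : SiteParY 𝔸 x.toKIdx) (OA : BondOpY 𝔸 x.toKIdx) (parB : BondParY 𝔸 x.toKIdx)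
  (C37 C38 : ℝ → CfgY 𝔸 x.toKIdx → AfldY 𝔸 x.toKIdx → Prop)

/-- ★ **`KSCU` — THE SITE-SECTOR (G′) READING OF RECORD OVER THE CODED CARRIER, U-LETTERS**: def-Y's two-configuration reader with the letters (`∇_U`, `∇*_U`,
`Δ_U`, the transporter) at the BASE of the coded configuration and the operator `G′` at its DECODING (`G′(U′U)` at a product).
[cite: Balaban1985BackgroundPropagators, Thm 3.4 p.400, (3.42)–(3.47) pp.397–398, p.403 l.4–7] -/
def KSCU : B9.KernelFamily (geo9Y x) (codingYx P G x C37 C38).bg :=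
  kernelFamilySU x.toKIdx (codingYx P G x C37 C38).bg (baseY x.toKIdx) (decY x.toKIdx) (GpY x.toKIdx par) par

/-- ★ **`KACU` — THE BOND-SECTOR (G) READING OF RECORD OVER THE CODED CARRIER, U-LETTERS** (bond letters `OA`, `parB` of the record as parameters).
[cite: Balaban1985BackgroundPropagators, Thm 3.4 p.400, (3.84)–(3.86) p.407, (3.42)–(3.47) pp.397–398] -/
def KACU : B9.KernelFamily (geo9Y x) (codingYx P G x C37 C38).bg :=
  kernelFamilyBU x.toKIdx (codingYx P G x C37 C38).bg (baseY x.toKIdx) (decY x.toKIdx) OA parB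

/-- the (3.43) member of `KSCU` IS the U-letter reading `h1ReadT (G′(dec c)) (par (base c)) (base c)` of `B9SectBH1ReadWriteY` (rfl) — the READ∕WRITE dictionary applies.
[cite: Balaban1985BackgroundPropagators, (3.43) p.398, bookkeeping] -/
theorem KSCU_h1_inl (c : (codingYx P G x C37 C38).bg.Cfg) (f : SiteY x.toKIdx → ℝ) (α : ℝ) (z : SiteY x.toKIdx → ℝ) :
    (KSCU P G x par C37 C38).h1 c (.inl f) α (.inl z) =
      h1ReadT x.toKIdx (GpY x.toKIdx par (decY x.toKIdx c)) (par (baseY x.toKIdx c)) (baseY x.toKIdx c) f α z := rfl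

end Readings

/-! ## §2 The row-13 targets of record in print's reading (U-letters at products) -/

section Targets

variable {J : Type} (f : J → MemberY d ℓ hd hL b₀ b₁ Mstar) (dC : ℕ) (c35 : ℝ) (G : Subgroup 𝔸ˣ) {ι : Type} [Fintype ι] (b : Module.Basis ι ℝ 𝔸)
  (par : ∀ j : J, SiteParY 𝔸 (f j).toKIdx) (OA : ∀ j : J, BondOpY 𝔸 (f j).toKIdx) (parB : ∀ j : J, BondParY 𝔸 (f j).toKIdx)
  (C37 C38 : ∀ j : J, ℝ → CfgY 𝔸 (f j).toKIdx → AfldY 𝔸 (f j).toKIdx → Prop)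
  (Cinv : ∀ j : J, B9.SiteKernel (geo9Y (f j)) (bg9YC 𝔸 G P (f j)))

/-- ★★ **THE SECT.-B STEP OF RECORD, PRINT's READING (R13-U1), ON A SUBFAMILY `f`**: `B9.SectBStepPrinted` over the coded carriers `codingYx` for the U-letter
readings `KSCU` (G′), `KACU` (G), the record's (3.48) kernel read along the decoding, and the coded analyticity predicate `IsAnKY` — the statement the certificate's
row 13 displays ∕ discharges in place of the W-letter `hB` (LOCATED-11). A `Prop`; nothing asserted. [cite: Balaban1985BackgroundPropagators, Thm 3.4 p.400, Sect. B pp.400–407] -/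
def SectBStepU : Prop :=
  B9.SectBStepPrinted dC c35 (fun j => geo9Y (f j)) (fun j => (codingYx P G (f j) (C37 j) (C38 j)).bg)
    (fun j => KSCU P G (f j) (par j) (C37 j) (C38 j)) (fun j => KACU P G (f j) (OA j) (parB j) (C37 j) (C38 j))
    (fun j => pullS (codingYx P G (f j) (C37 j) (C38 j)) (Cinv j)) (fun j => IsAnKY P G (f j) (par j) b (C37 j) (C38 j))

/-- ★★ **THEOREM 3.4 OF RECORD, PRINT's READING (R13-U1), ON A SUBFAMILY `f`**: `B9.Thm34Printed` over the coded carriers for `(KSCU, KACU, IsAnKY)`. A `Prop`;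
nothing asserted. [cite: Balaban1985BackgroundPropagators, Thm 3.4 p.400] -/
def Thm34U : Prop :=
  B9.Thm34Printed c35 (fun j => geo9Y (f j)) (fun j => (codingYx P G (f j) (C37 j) (C38 j)).bg)
    (fun j => KSCU P G (f j) (par j) (C37 j) (C38 j)) (fun j => KACU P G (f j) (OA j) (parB j) (C37 j) (C38 j))
    (fun j => IsAnKY P G (f j) (par j) b (C37 j) (C38 j))

end Targets

/-! ## §3 (contributed by node00-def-Y g27 — text of HOME `pub-ymgap-node00-def-Y/lean/g27-B9SectBCodedReadingsUR.lean` §3, `extraY` written qualified; validated in this bundle by dag-n06-c g16) -/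

/-! ## §3 At MODULE 3's reading `P := extraY 𝔸 G` the twin IS the original: the readers by `rfl`, the targets by `Iff` (the class-parametric re-typing is conservative)

Lean note: the coded carrier, `KSCU`, `KACU` and `pullS` agree DEFINITIONALLY at `P := extraY 𝔸 G` (`bg9Y_eq_bg9YC`); the analyticity predicate
`B9SectBCodedChainAnR.IsAnKY` is a `match`, which compiles to its own auxiliary matcher, so it agrees with `B9SectBCodedChainAn.IsAnKY` by `cases`, not by `rfl` —
hence the two targets are stated as `Iff`s. -/

section AtExtraY

variable (G : Subgroup 𝔸ˣ) (x : MemberY d ℓ hd hL b₀ b₁ Mstar) (par : SiteParY 𝔸 x.toKIdx) (OA : BondOpY 𝔸 x.toKIdx) (parB : BondParY 𝔸 x.toKIdx)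
  {ι : Type} [Fintype ι] (b : Module.Basis ι ℝ 𝔸) (C37 C38 : ℝ → CfgY 𝔸 x.toKIdx → AfldY 𝔸 x.toKIdx → Prop)

/-- at MODULE 3's reading the class-parametric `KSCU` IS `B9SectBCodedReadingsU.KSCU` (`rfl`; `bg9YC 𝔸 G (B9SectBCodedClassR.extraY 𝔸 G) x = bg9Y 𝔸 G x`).
[cite: Balaban1985BackgroundPropagators, Thm 3.4 p.400, bookkeeping] -/
theorem KSCU_extraY : KSCU (B9SectBCodedClassR.extraY 𝔸 G) G x par C37 C38 = B9SectBCodedReadingsU.KSCU G x par C37 C38 := rfl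

/-- at MODULE 3's reading the class-parametric `KACU` IS `B9SectBCodedReadingsU.KACU` (`rfl`). [cite: Balaban1985BackgroundPropagators, Thm 3.4 p.400, bookkeeping] -/
theorem KACU_extraY : KACU (B9SectBCodedClassR.extraY 𝔸 G) G x OA parB C37 C38 = B9SectBCodedReadingsU.KACU G x OA parB C37 C38 := rfl

/-- at MODULE 3's reading the class-parametric coded analyticity predicate `B9SectBCodedChainAnR.IsAnKY` equals `B9SectBCodedChainAn.IsAnKY` (by `cases` on the
code — the two `match`es are distinct auxiliary matchers, so not `rfl`). [cite: Balaban1985BackgroundPropagators, Thm 3.4 p.400, (3.62)–(3.64) p.402, bookkeeping] -/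
theorem isAnKY_extraY : IsAnKY (B9SectBCodedClassR.extraY 𝔸 G) G x par b C37 C38 = B9SectBCodedChainAn.IsAnKY G x par b C37 C38 := by
  funext K c α; cases c <;> rfl

end AtExtraY

section AtExtraYTargets

variable {J : Type} (f : J → MemberY d ℓ hd hL b₀ b₁ Mstar) (dC : ℕ) (c35 : ℝ) (G : Subgroup 𝔸ˣ) {ι : Type} [Fintype ι] (b : Module.Basis ι ℝ 𝔸)
  (par : ∀ j : J, SiteParY 𝔸 (f j).toKIdx) (OA : ∀ j : J, BondOpY 𝔸 (f j).toKIdx) (parB : ∀ j : J, BondParY 𝔸 (f j).toKIdx)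
  (C37 C38 : ∀ j : J, ℝ → CfgY 𝔸 (f j).toKIdx → AfldY 𝔸 (f j).toKIdx → Prop)
  (Cinv : ∀ j : J, B9.SiteKernel (geo9Y (f j)) (bg9Y 𝔸 G (f j)))

/-- at MODULE 3's reading the class-parametric row-13 target IS `B9SectBCodedReadingsU.SectBStepU` (same record kernel `Cinv`; `Iff` via `isAnKY_extraY`).
[cite: Balaban1985BackgroundPropagators, Thm 3.4 p.400, Sect. B pp.400–407, bookkeeping] -/
theorem sectBStepU_extraY_iff :
    SectBStepU (B9SectBCodedClassR.extraY 𝔸 G) f dC c35 G b par OA parB C37 C38 Cinv ↔ B9SectBCodedReadingsU.SectBStepU f dC c35 G b par OA parB C37 C38 Cinv := by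
  refine Iff.of_eq ?_
  unfold SectBStepU B9SectBCodedReadingsU.SectBStepU
  congr 1; funext j; exact isAnKY_extraY G (f j) (par j) b (C37 j) (C38 j)

/-- at MODULE 3's reading the class-parametric Theorem-3.4 target IS `B9SectBCodedReadingsU.Thm34U` (`Iff` via `isAnKY_extraY`).
[cite: Balaban1985BackgroundPropagators, Thm 3.4 p.400, bookkeeping] -/
theorem thm34U_extraY_iff : Thm34U (B9SectBCodedClassR.extraY 𝔸 G) f c35 G b par OA parB C37 C38 ↔ B9SectBCodedReadingsU.Thm34U f c35 G b par OA parB C37 C38 := by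
  refine Iff.of_eq ?_
  unfold Thm34U B9SectBCodedReadingsU.Thm34U
  congr 1; funext j; exact isAnKY_extraY G (f j) (par j) b (C37 j) (C38 j)

end AtExtraYTargets

end Literature.MathematicalPhysics.QuantumFieldTheory.Balaban1983to89.B9SectBCodedReadingsUR

end

/-!
# `Balaban1983to89.B9SectBEGlobAnStepRecordOnR` — THE CLASS-PARAMETRIC TWIN of `B9SectBEGlobAnStepRecordOn` (CASCADE-R, director-ym №279 GO-R; №277 (3) `hunitA` cure; dag-n06-d SOCKET-(α) class question)

statement-level skeleton of published theorems with citation tags; proofs where landed; nothing here is a claim about the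
Yang–Mills mass gap

WHAT THIS FILE IS.  The original module `B9SectBEGlobAnStepRecordOn` types its objects over MODULE 3's member carrier `bg9Y 𝔸 G x` (MODULE 2's small-cube class (3.35)).  This file RE-DECLARES, with UNCHANGED NAMES inside the namespace `…B9SectBEGlobAnStepRecordOnR`, exactly its 9 class-dependent declarations over the CLASS-PARAMETRIC carrier `B9SectBCodedClassR.bg9YC 𝔸 G P x` (`P : RegExtraY …` = the two cube conditions of (3.35)∕(3.36) as a parameter; `bg9Y 𝔸 G x = bg9YC 𝔸 G (extraY 𝔸 G) x` by `rfl`, so every declaration here specialises definitionally to its original; at the record's reading of PRINT's class, `P := extraYPb 𝔸 G`, the displayed laws `hreg335P` ((3.35) on plaquettes) and the class-keyed `hunitA` become theorems).  The text is the original's VERBATIM under the token surgery `bg9Y 𝔸 G ↦ bg9YC 𝔸 G P`, `NAME ↦ NAME P` for the class-dependent names (P the first explicit argument), and — №277 — the binder `hunitA` re-keyed from «all G-valued U» to «all (3.35)-regular U of the carrier» (`∀ j α₀ U, (bg9YC 𝔸 G P (f j)).Reg335 c35 α₀ U → IsUnit (deltaAY …)`).  Class-free declarations of the original are NOT copied: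 they are imported and used BY NAME (`open … hiding` the re-declared ones).  Generated by dag-n06-c g16's `gen.py` (HOME `pub-ymgap-dag-n06-c/lean/g16/`); the ORIGINAL MODULE DOCUMENTATION FOLLOWS VERBATIM and describes the mathematics.

HONEST SCOPE.  Re-typing bookkeeping; nothing of [B9] asserted beyond the original; COUNT-NEUTRAL; N06 NOT discharged; nothing continuum ∕ OS ∕ mass gap ∕ Clay.  Cell `pub-ymgap` (D-0062), Track A node N06 [B9], seat `pub-ymgap-dag-n06-c` g16, 2026-08-29.
-/

/-! Module documentation: that of the original `Balaban1983to89.B9SectBEGlobAnStepRecordOn` applies verbatim to this twin (not repeated here). -/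

noncomputable section

namespace Literature.MathematicalPhysics.QuantumFieldTheory.Balaban1983to89.B9SectBEGlobAnStepRecordOnR

open Literature.MathematicalPhysics.QuantumFieldTheory.Balaban1983to89.B9SectBCodedClassR (RegExtraY bg9YC)
open Literature.MathematicalPhysics.QuantumFieldTheory.Balaban1983to89.B9SectBEGlobAnStepRecordOn hiding stepEPos_KSC_on hin_KSC_on_pos houtE_KSC_on houtEGlob_KSC_on stepEPos_record_on stepGlobPos_record_on stepAnalyticPos1_KSC_on stepAnalyticPos1_record_on stepAnalyticPos_record_on

open Literature.MathematicalPhysics.QuantumFieldTheory.Balaban1983to89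
open Literature.MathematicalPhysics.QuantumFieldTheory.Balaban1983to89.B6Ineq2142KLevelV1 (β)
open Literature.MathematicalPhysics.QuantumFieldTheory.Balaban1983to89.B9FromB6 (EBlock GlobBlock)
open Literature.MathematicalPhysics.QuantumFieldTheory.Balaban1983to89.B9SectBCodedCarrier (CCfg Coding pullK pullS)
open Literature.MathematicalPhysics.QuantumFieldTheory.Balaban1983to89.B9Eq360DeltaPrimeAY (AfldY mulY)
open Literature.MathematicalPhysics.QuantumFieldTheory.Balaban1983to89.B9PinMembersKLevelV1 (MemberY geo9Y bg9Y)
open Literature.MathematicalPhysics.QuantumFieldTheory.Balaban1983to89.B9SectBGpLettersY (GVal)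
open Literature.MathematicalPhysics.QuantumFieldTheory.Balaban1983to89.B9SectBGpFrameCodedYR (codingYx)
open Literature.MathematicalPhysics.QuantumFieldTheory.Balaban1983to89.B9SectBGpFrameCodedY (CplxLettersY)
open Literature.MathematicalPhysics.QuantumFieldTheory.Balaban1983to89.B9SectBGpReadingsYR (KSC read342Y_KSC write342Y_KSC)
open Literature.MathematicalPhysics.QuantumFieldTheory.Balaban1983to89.B9SectBGpTransferInYR (thms_KSC_base_of_pullK)
open Literature.MathematicalPhysics.QuantumFieldTheory.Balaban1983to89.B9SectBGpTransferInY (eBlock_mono)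
open Literature.MathematicalPhysics.QuantumFieldTheory.Balaban1983to89.B9SectBGpStepAtLettersV2 (stepEPos_of_gpFrame₂)
open Literature.MathematicalPhysics.QuantumFieldTheory.Balaban1983to89.B9SectBCodedChainOnSubfamilyR (gpFrame₂CodedOn hconv_KSC_on)
open Literature.MathematicalPhysics.QuantumFieldTheory.Balaban1983to89.B9Ineq347SiteReadingY (globBlock_kernelFamilyS_of_eBlock)
open Literature.MathematicalPhysics.QuantumFieldTheory.Balaban1983to89.B9SectBCodedChainL2R (thms_mono_B₀)
open Literature.MathematicalPhysics.QuantumFieldTheory.Balaban1983to89.B9SectBStepPosFamilyTransfer (stepEPos_of_family_pos stepEPos_of_coded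
  stepPos_blk_of_family_pos stepGlobPos_of_coded stepPos_of_family_pos stepPos_base_of_coded)
open Literature.MathematicalPhysics.QuantumFieldTheory.Balaban1983to89.B9SectBStepWhole (StepEPos StepGlobPos StepAnalyticPos1 StepAnalyticPos
  stepAnalyticPos_of_halves)
open Literature.MathematicalPhysics.QuantumFieldTheory.Balaban1983to89.B9SectBGpStepAtLettersV2 (stepAnalyticPos1_of_anFrame₂)
open Literature.MathematicalPhysics.QuantumFieldTheory.Balaban1983to89.B9SectBCodedChainAnR (IsAnKY IsAnRecY anFrame₂CodedOn)
open Literature.MathematicalPhysics.QuantumFieldTheory.Balaban1983to89.B9GeoNbrCountKLevelV1 (exists_card_nbr_geo9Y_le_of_M)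
open Literature.MathematicalPhysics.QuantumFieldTheory.Balaban1983to89.B9GeoNormsKLevelV1 (geo9K_wNorm_nonneg)
open Literature.MathematicalPhysics.QuantumFieldTheory.Balaban1983to89.Node00 (SiteY BlkY IBondY CfgY SiteParY deltaPrimeAY kernelFamilyS GpY)

variable {d ℓ : ℕ} {hd : 1 ≤ d + 1} {hL : Odd (ℓ + 1) ∧ 1 < ℓ + 1} {b₀ b₁ : ℝ} {Mstar : ℕ}
variable {𝔸 : Type} [NormedRing 𝔸] (P : RegExtraY d ℓ hd hL b₀ b₁ Mstar 𝔸) [NormedAlgebra ℂ 𝔸] [CompleteSpace 𝔸] [NormOneClass 𝔸] [FiniteDimensional ℝ 𝔸]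

variable {J : Type} (f : J → MemberY d ℓ hd hL b₀ b₁ Mstar) [∀ x : MemberY d ℓ hd hL b₀ b₁ Mstar, Fintype (geo9Y x).Site]
  [instDS : ∀ x : MemberY d ℓ hd hL b₀ b₁ Mstar, DecidableEq (geo9Y x).Site] [instNE : ∀ x : MemberY d ℓ hd hL b₀ b₁ Mstar, Nonempty (geo9Y x).Site]
  (c35 : ℝ) (G : Subgroup 𝔸ˣ) (par : ∀ j : J, SiteParY 𝔸 (f j).toKIdx) {ι : Type} [Fintype ι] [DecidableEq ι] (b : Module.Basis ι ℝ 𝔸)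
  (ιB : ∀ j : J, BlkY (f j).toKIdx → IBondY (f j).toKIdx)
  (C37 C38 : ∀ j : J, ℝ → CfgY 𝔸 (f j).toKIdx → AfldY 𝔸 (f j).toKIdx → Prop)

/-! ## §1  The (3.42) block-step of the coded readings `KSC` over the coded carrier (the root frame's output) -/

/-- ★ **`StepEPos` OF THE CODED FAMILY `KSC` OVER THE CODED CARRIERS OF A SUBFAMILY** — r06's uniform Theorem 3.4 for G′ at letters
(`stepEPos_of_gpFrame₂`) on the root frame `gpFrame₂CodedOn` inhabited for `KSC` (dictionaries `read342Y_KSC` ∕ `write342Y_KSC`, reading constant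
`c_R = M₂Σ‖b_j‖ > 0`, writing functions `(c_R·B + 1, δ)`); any shared families `GA`, `Cinv` over the coded background.
[cite: Balaban1985BackgroundPropagators, Thm 3.4 p.400, (3.60)–(3.64) p.402, Thm 3.1 (3.42) p.397, (3.35)–(3.37) p.396; Balaban1984PropagatorsII, Lemma 2.1 p.234, (2.51) p.232] -/
theorem stepEPos_KSC_on (hι : ∀ (j : J) (s : BlkY (f j).toKIdx), β (f j).toKIdx.hN (f j).toKIdx.D (f j).toKIdx.hk (ιB j s) = s)
    (hG1 : ∀ u : 𝔸ˣ, u ∈ G → ‖(u : 𝔸)‖ ≤ 1) (hpar : ∀ j (U : CfgY 𝔸 (f j).toKIdx), GVal G (f j).toKIdx U → ∀ z w, par j U z w ∈ G)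
    (hunit : ∀ j (U : CfgY 𝔸 (f j).toKIdx), GVal G (f j).toKIdx U → IsUnit (deltaPrimeAY (f j).toKIdx (par j) U))
    (dB : ℕ) (M₂ : ℝ) (hM₂ : 0 ≤ M₂) (hrepr : ∀ (v : 𝔸) (j : ι), |b.repr v j| ≤ M₂ * ‖v‖) (hcR : 0 < M₂ * ∑ j, ‖b j‖)
    (Cq : ℝ) (hCq : 0 ≤ Cq) (hC37 : ∀ j β' U a, C37 j β' U a → GVal G (f j).toKIdx U ∧ CplxLettersY G (f j) (par j) (ιB j) Cq β' U a)
    (MInv aInv aW : ℝ) (hMInv : 0 < MInv) (haInv : 0 < aInv) (haW : 0 < aW)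
    (GA : ∀ j : J, B9.KernelFamily (geo9Y (f j)) (codingYx P G (f j) (C37 j) (C38 j)).bg)
    (Cinv : ∀ j : J, B9.SiteKernel (geo9Y (f j)) (codingYx P G (f j) (C37 j) (C38 j)).bg) :
    StepEPos dB c35 (fun j => geo9Y (f j)) (fun j => (codingYx P G (f j) (C37 j) (C38 j)).bg) (fun j => KSC P G (f j) (par j) (C37 j) (C38 j)) GA Cinv
      (fun j => KSC P G (f j) (par j) (C37 j) (C38 j)) :=
  stepEPos_of_gpFrame₂ (d := dB)
    (gpFrame₂CodedOn P f c35 G b C37 C38 par ιB (fun j => KSC P G (f j) (par j) (C37 j) (C38 j)) hι hG1 hpar hunit dB M₂ hM₂ hrepr Cq hCq hC37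
      (M₂ * ∑ j, ‖b j‖) hcR (fun B _ => (M₂ * ∑ j, ‖b j‖) * B + 1) (fun B _ hB _ => by positivity) (fun δ => δ) (fun δ hδ => hδ)
      MInv aInv aW hMInv haInv haW (fun j => read342Y_KSC P G (f j) (par j) b (ιB j) (C37 j) (C38 j) (hι j) M₂ hM₂ hrepr c35 MInv aInv)
      (fun j => write342Y_KSC P G (f j) (par j) b (ιB j) (C37 j) (C38 j) (hι j) M₂ hM₂ hrepr aW fun β' U a h => (hC37 j β' U a h).1))
    GA Cinv

/-! ## §2  The input domination with explicit positive constants (plaquette-free) -/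

omit [NormOneClass 𝔸] [FiniteDimensional ℝ 𝔸] [DecidableEq ι] instDS instNE in
/-- ★ **`hin` FOR `KSC` WITH POSITIVE OUTPUT CONSTANTS**: at every (3.35)-regular base above `max ML (2(d+1)+1)`, the record family's Theorem-3.1–3.3 block
(read along the decoding) with constants `(B₀, δ₀, B_β, B_ε, B_εβ, B₁, δ₁)`, `B₀ > 0`, gives `KSC`'s with `(max (c_in·B₀) 1, δ₀, B_β, B_ε, B_εβ, B₁, δ₁)` —
g7's (3.42) conversion `thms_KSC_base_of_pullK` (neighbour count `exists_card_nbr_geo9Y_le_of_M`), the constant enlarged to be positive.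
[cite: Balaban1985BackgroundPropagators, Thms 3.1–3.3 (3.42)–(3.48) pp.397–399, (3.35) p.396; Balaban1984PropagatorsII, (2.51) p.232] -/
theorem hin_KSC_on_pos (hι : ∀ (j : J) (s : BlkY (f j).toKIdx), β (f j).toKIdx.hN (f j).toKIdx.D (f j).toKIdx.hk (ιB j s) = s)
    (hG1 : ∀ u : 𝔸ˣ, u ∈ G → ‖(u : 𝔸)‖ ≤ 1) {M₂ : ℝ} (hM₂ : 0 ≤ M₂) (hrepr : ∀ (v : 𝔸) (j : ι), |b.repr v j| ≤ M₂ * ‖v‖) (dC : ℕ)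
    (GA : ∀ j : J, B9.KernelFamily (geo9Y (f j)) (codingYx P G (f j) (C37 j) (C38 j)).bg)
    (Cinv : ∀ j : J, B9.SiteKernel (geo9Y (f j)) (codingYx P G (f j) (C37 j) (C38 j)).bg) :
    ∀ (B₀ δ₀ : ℝ) (Bβ Bε : ℝ → ℝ) (Bεβ : ℝ → ℝ → ℝ) (B₁ δ₁ : ℝ), 0 < B₀ → 0 < δ₀ → 0 < B₁ → 0 < δ₁ →
      ∃ (Mi ai B₀' δ₀' : ℝ) (Bβ' Bε' : ℝ → ℝ) (Bεβ' : ℝ → ℝ → ℝ) (B₁' δ₁' : ℝ), 0 < ai ∧ 0 < B₀' ∧ 0 < δ₀' ∧ 0 < B₁' ∧ 0 < δ₁' ∧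
        ∀ j : J, Mi ≤ (geo9Y (f j)).M → ∀ α₀ : ℝ, 0 < α₀ → (geo9Y (f j)).M * α₀ ≤ ai →
          ∀ c : (codingYx P G (f j) (C37 j) (C38 j)).bg.Cfg, (codingYx P G (f j) (C37 j) (C38 j)).bg.Reg335 c35 α₀ c →
          B9.Thms31to33IneqAt dC (pullK (codingYx P G (f j) (C37 j) (C38 j))
              (kernelFamilyS (f j).toKIdx (bg9YC 𝔸 G P (f j)) (fun U => U) (GpY (f j).toKIdx (par j)) (par j)))
              (GA j) (Cinv j) B₀ δ₀ Bβ Bε Bεβ B₁ δ₁ c →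
          B9.Thms31to33IneqAt dC (KSC P G (f j) (par j) (C37 j) (C38 j)) (GA j) (Cinv j) B₀' δ₀' Bβ' Bε' Bεβ' B₁' δ₁' c := by
  intro B₀ δ₀ Bβ Bε Bεβ B₁ δ₁ hB₀ hδ₀ hB₁ hδ₁
  obtain ⟨ML, mN, hcnt⟩ := exists_card_nbr_geo9Y_le_of_M (d := d) (ℓ := ℓ) (hd := hd) (hL := hL) (b₀ := b₀) (b₁ := b₁) (2 * ((d : ℝ) + 1))
  set cIn : ℝ := ((ℓ + 1 : ℕ) : ℝ) * Real.exp (|δ₀| * (2 * ((d : ℝ) + 1))) + ((mN : ℝ) * (M₂ * ∑ j, ‖b j‖) * Real.exp (|δ₀| * (2 * ((d : ℝ) + 1))) + 1)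
    with hcIn
  refine ⟨max ML (2 * ((d : ℝ) + 1) + 1), 1, max (cIn * max B₀ 0) 1, δ₀, Bβ, Bε, Bεβ, B₁, δ₁, one_pos, lt_max_of_lt_right one_pos, hδ₀, hB₁, hδ₁,
    fun j hM α₀ _ _ c hreg hT => ?_⟩
  obtain ⟨U, rfl, hU335⟩ := (codingYx P G (f j) (C37 j) (C38 j)).exists_of_bg_Reg335 hreg
  have hU : GVal G (f j).toKIdx U := hU335.1.1
  have hM2 : 2 * ((d : ℝ) + 1) < (geo9Y (f j)).M := by
    have := le_trans (le_max_right _ _) hM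
    linarith
  have hML : ML ≤ (geo9Y (f j)).M := le_trans (le_max_left _ _) hM
  exact thms_mono_B₀ P G (f j) (C37 j) (C38 j) dC _ (GA j) (Cinv j) (le_max_left _ _)
    (thms_KSC_base_of_pullK P G (f j) (par j) b (ιB j) (C37 j) (C38 j) (hι j) hG1 hU hM₂ hrepr hM2 (fun a => hcnt Mstar (f j) hML a) dC (GA j)
      (Cinv j) hT)

/-! ## §3  The output dominations at `U′U`: the `e` member converted, the `glob` member recovered from it -/

omit [NormOneClass 𝔸] [DecidableEq ι] instDS instNE in
/-- ★ **THE (3.42) OUTPUT DOMINATION AT `U′U`**: for `(B, δ) > 0` and a cap `a`, above `hconv_KSC_on`'s threshold and for `α₁ ≦ min a (1/4)`, `KSC`'s (3.42)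
block at the product gives the record family's (read along the decoding) with `(max B″ 1, δ/2)` — the letter conversion of the (3.42) block
(`B9SectBCodedChainOnSubfamily.hconv_KSC_on`: `B9SectBGpTransferConvY.hconv_at` at the members).
[cite: Balaban1985BackgroundPropagators, p.403 l.1–9, (3.42) p.397, (3.70) p.404, (3.74) p.405; Balaban1984PropagatorsII, Lemma 2.1 (2.59)–(2.61) pp.233–234] -/
theorem houtE_KSC_on (hG1 : ∀ u : 𝔸ˣ, u ∈ G → ‖(u : 𝔸)‖ ≤ 1) {M₂ : ℝ} (hM₂ : 0 ≤ M₂) (hrepr : ∀ (v : 𝔸) (j : ι), |b.repr v j| ≤ M₂ * ‖v‖)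
    (hι : ∀ (j : J) (s : BlkY (f j).toKIdx), β (f j).toKIdx.hN (f j).toKIdx.D (f j).toKIdx.hk (ιB j s) = s)
    {Cq : ℝ} (hC37 : ∀ j β' U a, C37 j β' U a → GVal G (f j).toKIdx U ∧ CplxLettersY G (f j) (par j) (ιB j) Cq β' U a) :
    ∀ (B δ a : ℝ), 0 < B → 0 < δ → 0 < a →
      ∃ (Mo ao a' B' δ' : ℝ), 0 < ao ∧ 0 < a' ∧ a' ≤ a ∧ 0 < B' ∧ 0 < δ' ∧
        ∀ j : J, Mo ≤ (geo9Y (f j)).M → ∀ α₀ : ℝ, 0 < α₀ → (geo9Y (f j)).M * α₀ ≤ ao →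
          ∀ c : (codingYx P G (f j) (C37 j) (C38 j)).bg.Cfg, (codingYx P G (f j) (C37 j) (C38 j)).bg.Reg335 c35 α₀ c →
          ∀ α₁ : ℝ, 0 < α₁ → α₁ ≤ a' → ∀ c' : (codingYx P G (f j) (C37 j) (C38 j)).bg.Cfg, (codingYx P G (f j) (C37 j) (C38 j)).bg.Cplx337 α₁ c c' →
          EBlock (KSC P G (f j) (par j) (C37 j) (C38 j)) B δ ((codingYx P G (f j) (C37 j) (C38 j)).bg.mul c' c) →
          EBlock (pullK (codingYx P G (f j) (C37 j) (C38 j))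
            (kernelFamilyS (f j).toKIdx (bg9YC 𝔸 G P (f j)) (fun U => U) (GpY (f j).toKIdx (par j)) (par j))) B' δ'
            ((codingYx P G (f j) (C37 j) (C38 j)).bg.mul c' c) := by
  intro B δ a hB hδ ha
  obtain ⟨Mo, B'', hB'', H⟩ := hconv_KSC_on P f G par b ιB C37 C38 hG1 hM₂ hrepr hι hC37 B δ hB.le hδ
  refine ⟨Mo, 1, min a (1 / 4), max B'' 1, δ / 2, one_pos, lt_min ha (by norm_num), min_le_left _ _, lt_max_of_lt_right one_pos, half_pos hδ,
    fun j hM α₀ _ _ c _ α₁ _ hα₁a c' h37 hE => ?_⟩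
  obtain ⟨U, a', rfl, rfl, hC⟩ := (codingYx P G (f j) (C37 j) (C38 j)).exists_of_bg_Cplx337 h37
  have hα₁c : α₁ ≤ 1 / 4 := hα₁a.trans (min_le_right _ _)
  have hconv := H j hM U a' α₁ hα₁c hC hE
  exact eBlock_mono (f j).toKIdx
    (pullK (codingYx P G (f j) (C37 j) (C38 j)) (kernelFamilyS (f j).toKIdx (bg9YC 𝔸 G P (f j)) (fun U => U) (GpY (f j).toKIdx (par j)) (par j)))
    (U := .prod U a') (le_max_left B'' 1) hconv

omit [NormOneClass 𝔸] [DecidableEq ι] instDS instNE in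
/-- ★ **THE (3.47) OUTPUT RECOVERED AT `W = U′U` FROM THE (3.42) OUTPUT**: for `(B, δ) > 0` and a cap `a`, above `max Mo Mg` and for `α₁ ≦ min a (1/4)`,
`KSC`'s (3.42) block at the product gives the record family's (3.47) block at `W` (read along the decoding) with the constant `max (B″·C_g) 1` — the letter
conversion of the (3.42) block followed by print's remark «(3.47) follows from (3.42)» at `W` (`B9Ineq347SiteReadingY.globBlock_kernelFamilyS_of_eBlock` at the
rate `δ/2`).  The coded `glob` reading is silent at products; its information is carried by the `e` member.
[cite: Balaban1985BackgroundPropagators, (3.47) p.398 + p.398 first remark, p.403 l.1–9, (3.42) p.397; Balaban1984PropagatorsII, Lemma 2.1 (2.60)–(2.61) p.234] -/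
theorem houtEGlob_KSC_on (hG1 : ∀ u : 𝔸ˣ, u ∈ G → ‖(u : 𝔸)‖ ≤ 1) {M₂ : ℝ} (hM₂ : 0 ≤ M₂) (hrepr : ∀ (v : 𝔸) (j : ι), |b.repr v j| ≤ M₂ * ‖v‖)
    (hι : ∀ (j : J) (s : BlkY (f j).toKIdx), β (f j).toKIdx.hN (f j).toKIdx.D (f j).toKIdx.hk (ιB j s) = s)
    {Cq : ℝ} (hC37 : ∀ j β' U a, C37 j β' U a → GVal G (f j).toKIdx U ∧ CplxLettersY G (f j) (par j) (ιB j) Cq β' U a) :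
    ∀ (B δ a : ℝ), 0 < B → 0 < δ → 0 < a →
      ∃ (Mo ao a' B' : ℝ), 0 < ao ∧ 0 < a' ∧ a' ≤ a ∧ 0 < B' ∧
        ∀ j : J, Mo ≤ (geo9Y (f j)).M → ∀ α₀ : ℝ, 0 < α₀ → (geo9Y (f j)).M * α₀ ≤ ao →
          ∀ c : (codingYx P G (f j) (C37 j) (C38 j)).bg.Cfg, (codingYx P G (f j) (C37 j) (C38 j)).bg.Reg335 c35 α₀ c →
          ∀ α₁ : ℝ, 0 < α₁ → α₁ ≤ a' → ∀ c' : (codingYx P G (f j) (C37 j) (C38 j)).bg.Cfg, (codingYx P G (f j) (C37 j) (C38 j)).bg.Cplx337 α₁ c c' →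
          EBlock (KSC P G (f j) (par j) (C37 j) (C38 j)) B δ ((codingYx P G (f j) (C37 j) (C38 j)).bg.mul c' c) →
          GlobBlock (pullK (codingYx P G (f j) (C37 j) (C38 j))
            (kernelFamilyS (f j).toKIdx (bg9YC 𝔸 G P (f j)) (fun U => U) (GpY (f j).toKIdx (par j)) (par j))) B'
            ((codingYx P G (f j) (C37 j) (C38 j)).bg.mul c' c) := by
  intro B δ a hB hδ ha
  obtain ⟨Mo, B'', hB'', H⟩ := hconv_KSC_on P f G par b ιB C37 C38 hG1 hM₂ hrepr hι hC37 B δ hB.le hδ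
  obtain ⟨Mg, Cg, hCg, HG⟩ := globBlock_kernelFamilyS_of_eBlock (d := d) (ℓ := ℓ) (hd := hd) (hL := hL) (b₀ := b₀) (b₁ := b₁) (Mstar := Mstar)
    (𝔸 := 𝔸) (half_pos hδ)
  refine ⟨max Mo Mg, 1, min a (1 / 4), max (B'' * Cg) 1, one_pos, lt_min ha (by norm_num), min_le_left _ _, lt_max_of_lt_right one_pos,
    fun j hM α₀ _ _ c _ α₁ _ hα₁a c' h37 hE => ?_⟩
  obtain ⟨U, a', rfl, rfl, hC⟩ := (codingYx P G (f j) (C37 j) (C38 j)).exists_of_bg_Cplx337 h37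
  have hMo : Mo ≤ (geo9Y (f j)).M := le_trans (le_max_left _ _) hM
  have hMg : Mg ≤ (geo9Y (f j)).M := le_trans (le_max_right _ _) hM
  have hα₁c : α₁ ≤ 1 / 4 := hα₁a.trans (min_le_right _ _)
  have hconv := H j hMo U a' α₁ hα₁c hC hE
  have hglob := HG (f j) (ιB j) (hι j) hMg (bg9YC 𝔸 G P (f j)) (fun U => U) (GpY (f j).toKIdx (par j)) (par j) _ B'' hB'' hconv
  intro n lam γ hγ₁ hγ₂
  exact (hglob n lam γ hγ₁ hγ₂).trans (mul_le_mul_of_nonneg_right (le_max_left _ _) (geo9K_wNorm_nonneg (f j).toKIdx γ lam))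

/-! ## §4  ★★★ The positive-input (3.42) and (3.47) block-steps of the record family on a subfamily -/

/-- ★★★ **`StepEPos` OF THE RECORD FAMILY ON A SUBFAMILY** (input families: the record's `kernelFamilyS … (GpY par) par`, `GA`, `Cinv` over `bg9Y`; output:
the record's (3.42) block of G′ at `U′U`): from §1 by `stepEPos_of_family_pos` (§2, §3) and `stepEPos_of_coded` (class implication `hclass`).  Displayed:
`hclass` and the root frame's structural data; no plaquette law.
[cite: Balaban1985BackgroundPropagators, Thm 3.1 (3.42) p.397, Thm 3.4 p.400, (3.60)–(3.64) p.402, p.403 l.1–9, (3.35)–(3.37) p.396; Balaban1984PropagatorsII, Lemma 2.1 p.234, (2.51) p.232] -/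
theorem stepEPos_record_on (hι : ∀ (j : J) (s : BlkY (f j).toKIdx), β (f j).toKIdx.hN (f j).toKIdx.D (f j).toKIdx.hk (ιB j s) = s)
    (hG1 : ∀ u : 𝔸ˣ, u ∈ G → ‖(u : 𝔸)‖ ≤ 1) (hpar : ∀ j (U : CfgY 𝔸 (f j).toKIdx), GVal G (f j).toKIdx U → ∀ z w, par j U z w ∈ G)
    (hunit : ∀ j (U : CfgY 𝔸 (f j).toKIdx), GVal G (f j).toKIdx U → IsUnit (deltaPrimeAY (f j).toKIdx (par j) U))
    (dB : ℕ) (M₂ : ℝ) (hM₂ : 0 ≤ M₂) (hrepr : ∀ (v : 𝔸) (j : ι), |b.repr v j| ≤ M₂ * ‖v‖) (hcR : 0 < M₂ * ∑ j, ‖b j‖)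
    (Cq : ℝ) (hCq : 0 ≤ Cq) (hC37 : ∀ j β' U a, C37 j β' U a → GVal G (f j).toKIdx U ∧ CplxLettersY G (f j) (par j) (ιB j) Cq β' U a)
    (MInv aInv aW : ℝ) (hMInv : 0 < MInv) (haInv : 0 < aInv) (haW : 0 < aW)
    (GA : ∀ j : J, B9.KernelFamily (geo9Y (f j)) (bg9YC 𝔸 G P (f j))) (Cinv : ∀ j : J, B9.SiteKernel (geo9Y (f j)) (bg9YC 𝔸 G P (f j)))
    {r αcap Mc ac : ℝ} (hr : 0 < r) (hcap : 0 < αcap) (hac : 0 < ac)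
    (hclass : ∀ (j : J) (α₀ α₁ : ℝ) (U U' : (bg9YC 𝔸 G P (f j)).Cfg), Mc ≤ (geo9Y (f j)).M → 0 < α₀ → (geo9Y (f j)).M * α₀ ≤ ac →
      (bg9YC 𝔸 G P (f j)).Reg335 c35 α₀ U → 0 < α₁ → α₁ ≤ αcap → (bg9YC 𝔸 G P (f j)).Cplx337 α₁ U U' →
      ∃ a : (codingYx P G (f j) (C37 j) (C38 j)).A,
        (codingYx P G (f j) (C37 j) (C38 j)).decA a = U' ∧ (codingYx P G (f j) (C37 j) (C38 j)).C37 (r * α₁) U a) :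
    StepEPos dB c35 (fun j => geo9Y (f j)) (fun j => bg9YC 𝔸 G P (f j))
      (fun j => kernelFamilyS (f j).toKIdx (bg9YC 𝔸 G P (f j)) (fun U => U) (GpY (f j).toKIdx (par j)) (par j)) GA Cinv
      (fun j => kernelFamilyS (f j).toKIdx (bg9YC 𝔸 G P (f j)) (fun U => U) (GpY (f j).toKIdx (par j)) (par j)) := by
  refine stepEPos_of_coded dB c35 (fun j => geo9Y (f j)) (fun j => bg9YC 𝔸 G P (f j))
    (fun j => kernelFamilyS (f j).toKIdx (bg9YC 𝔸 G P (f j)) (fun U => U) (GpY (f j).toKIdx (par j)) (par j)) GA Cinv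
    (fun j => kernelFamilyS (f j).toKIdx (bg9YC 𝔸 G P (f j)) (fun U => U) (GpY (f j).toKIdx (par j)) (par j))
    (fun j => codingYx P G (f j) (C37 j) (C38 j)) hr hcap hac hclass ?_
  exact stepEPos_of_family_pos dB c35 (fun j => geo9Y (f j)) (fun j => (codingYx P G (f j) (C37 j) (C38 j)).bg)
    (fun j => KSC P G (f j) (par j) (C37 j) (C38 j))
    (fun j => pullK (codingYx P G (f j) (C37 j) (C38 j)) (kernelFamilyS (f j).toKIdx (bg9YC 𝔸 G P (f j)) (fun U => U) (GpY (f j).toKIdx (par j)) (par j)))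
    (fun j => pullK (codingYx P G (f j) (C37 j) (C38 j)) (GA j)) (fun j => pullK (codingYx P G (f j) (C37 j) (C38 j)) (GA j))
    (fun j => pullS (codingYx P G (f j) (C37 j) (C38 j)) (Cinv j))
    (fun j => KSC P G (f j) (par j) (C37 j) (C38 j))
    (fun j => pullK (codingYx P G (f j) (C37 j) (C38 j)) (kernelFamilyS (f j).toKIdx (bg9YC 𝔸 G P (f j)) (fun U => U) (GpY (f j).toKIdx (par j)) (par j)))
    (hin_KSC_on_pos P f c35 G par b ιB C37 C38 hι hG1 hM₂ hrepr dB _ _)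
    (houtE_KSC_on P f c35 G par b ιB C37 C38 hG1 hM₂ hrepr hι hC37)
    (stepEPos_KSC_on P f c35 G par b ιB C37 C38 hι hG1 hpar hunit dB M₂ hM₂ hrepr hcR Cq hCq hC37 MInv aInv aW hMInv haInv haW _ _)

/-- ★★★ **`StepGlobPos` OF THE RECORD FAMILY ON A SUBFAMILY** (the record's (3.47) block of G′ at `U′U` from its Theorem-3.1–3.3 blocks at `U`): from the
coded (3.42) step of §1 by the generic transfer `stepPos_blk_of_family_pos` with the CHANGED output statement (§3 `houtEGlob_KSC_on`: the (3.47) block at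
`W` recovered from the converted (3.42) block) and `stepGlobPos_of_coded`.  Displayed: `hclass` and the root frame's structural data; no plaquette law.
[cite: Balaban1985BackgroundPropagators, Thm 3.1 (3.47) p.398 + p.398 first remark, Thm 3.4 p.400, p.402 («all the statements (3.42)–(3.47) for G′(U′U)»), p.403 l.1–9, (3.35)–(3.37) p.396; Balaban1984PropagatorsII, Lemma 2.1 p.234] -/
theorem stepGlobPos_record_on (hι : ∀ (j : J) (s : BlkY (f j).toKIdx), β (f j).toKIdx.hN (f j).toKIdx.D (f j).toKIdx.hk (ιB j s) = s)
    (hG1 : ∀ u : 𝔸ˣ, u ∈ G → ‖(u : 𝔸)‖ ≤ 1) (hpar : ∀ j (U : CfgY 𝔸 (f j).toKIdx), GVal G (f j).toKIdx U → ∀ z w, par j U z w ∈ G)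
    (hunit : ∀ j (U : CfgY 𝔸 (f j).toKIdx), GVal G (f j).toKIdx U → IsUnit (deltaPrimeAY (f j).toKIdx (par j) U))
    (dB : ℕ) (M₂ : ℝ) (hM₂ : 0 ≤ M₂) (hrepr : ∀ (v : 𝔸) (j : ι), |b.repr v j| ≤ M₂ * ‖v‖) (hcR : 0 < M₂ * ∑ j, ‖b j‖)
    (Cq : ℝ) (hCq : 0 ≤ Cq) (hC37 : ∀ j β' U a, C37 j β' U a → GVal G (f j).toKIdx U ∧ CplxLettersY G (f j) (par j) (ιB j) Cq β' U a)
    (MInv aInv aW : ℝ) (hMInv : 0 < MInv) (haInv : 0 < aInv) (haW : 0 < aW)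
    (GA : ∀ j : J, B9.KernelFamily (geo9Y (f j)) (bg9YC 𝔸 G P (f j))) (Cinv : ∀ j : J, B9.SiteKernel (geo9Y (f j)) (bg9YC 𝔸 G P (f j)))
    {r αcap Mc ac : ℝ} (hr : 0 < r) (hcap : 0 < αcap) (hac : 0 < ac)
    (hclass : ∀ (j : J) (α₀ α₁ : ℝ) (U U' : (bg9YC 𝔸 G P (f j)).Cfg), Mc ≤ (geo9Y (f j)).M → 0 < α₀ → (geo9Y (f j)).M * α₀ ≤ ac →
      (bg9YC 𝔸 G P (f j)).Reg335 c35 α₀ U → 0 < α₁ → α₁ ≤ αcap → (bg9YC 𝔸 G P (f j)).Cplx337 α₁ U U' →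
      ∃ a : (codingYx P G (f j) (C37 j) (C38 j)).A,
        (codingYx P G (f j) (C37 j) (C38 j)).decA a = U' ∧ (codingYx P G (f j) (C37 j) (C38 j)).C37 (r * α₁) U a) :
    StepGlobPos dB c35 (fun j => geo9Y (f j)) (fun j => bg9YC 𝔸 G P (f j))
      (fun j => kernelFamilyS (f j).toKIdx (bg9YC 𝔸 G P (f j)) (fun U => U) (GpY (f j).toKIdx (par j)) (par j)) GA Cinv
      (fun j => kernelFamilyS (f j).toKIdx (bg9YC 𝔸 G P (f j)) (fun U => U) (GpY (f j).toKIdx (par j)) (par j)) := by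
  refine stepGlobPos_of_coded dB c35 (fun j => geo9Y (f j)) (fun j => bg9YC 𝔸 G P (f j))
    (fun j => kernelFamilyS (f j).toKIdx (bg9YC 𝔸 G P (f j)) (fun U => U) (GpY (f j).toKIdx (par j)) (par j)) GA Cinv
    (fun j => kernelFamilyS (f j).toKIdx (bg9YC 𝔸 G P (f j)) (fun U => U) (GpY (f j).toKIdx (par j)) (par j))
    (fun j => codingYx P G (f j) (C37 j) (C38 j)) hr hcap hac hclass ?_
  refine stepPos_blk_of_family_pos dB c35 (fun j => geo9Y (f j)) (fun j => (codingYx P G (f j) (C37 j) (C38 j)).bg)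
    (fun j => KSC P G (f j) (par j) (C37 j) (C38 j))
    (fun j => pullK (codingYx P G (f j) (C37 j) (C38 j)) (kernelFamilyS (f j).toKIdx (bg9YC 𝔸 G P (f j)) (fun U => U) (GpY (f j).toKIdx (par j)) (par j)))
    (fun j => pullK (codingYx P G (f j) (C37 j) (C38 j)) (GA j)) (fun j => pullK (codingYx P G (f j) (C37 j) (C38 j)) (GA j))
    (fun j => pullS (codingYx P G (f j) (C37 j) (C38 j)) (Cinv j))
    (C₁ := ℝ × ℝ) (C₂ := ℝ) (pos₁ := fun c => 0 < c.1 ∧ 0 < c.2) (pos₂ := fun c => 0 < c)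
    (Blk₁ := fun c j W => EBlock (KSC P G (f j) (par j) (C37 j) (C38 j)) c.1 c.2 W)
    (Blk₂ := fun c j W => GlobBlock (pullK (codingYx P G (f j) (C37 j) (C38 j))
      (kernelFamilyS (f j).toKIdx (bg9YC 𝔸 G P (f j)) (fun U => U) (GpY (f j).toKIdx (par j)) (par j))) c W)
    (hin_KSC_on_pos P f c35 G par b ιB C37 C38 hι hG1 hM₂ hrepr dB _ _) (fun c hc a ha => ?_)
    (stepEPos_KSC_on P f c35 G par b ιB C37 C38 hι hG1 hpar hunit dB M₂ hM₂ hrepr hcR Cq hCq hC37 MInv aInv aW hMInv haInv haW _ _)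
  obtain ⟨Mo, ao, a', B', hao, ha', ha'a, hB', H⟩ := houtEGlob_KSC_on P f c35 G par b ιB C37 C38 hG1 hM₂ hrepr hι hC37 c.1 c.2 a hc.1 hc.2 ha
  exact ⟨Mo, ao, a', B', hao, ha', ha'a, hB', H⟩

/-! ## §5  ★★★ The analytic-extension step of the record family on a subfamily (record pin `IsAnRecY r`) -/

/-- ★ **`StepAnalyticPos1` OF THE CODED FAMILY `KSC` AT THE CODED PREDICATE `IsAnKY`** — `stepAnalyticPos1_of_anFrame₂` on g8's `anFrame₂CodedOn` inhabited for
`KSC` (dictionaries `read342Y_KSC` ∕ `write342Y_KSC`; `writeAn` holds by definition of `IsAnKY`).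
[cite: Balaban1985BackgroundPropagators, Thm 3.4 p.400, (3.60)–(3.64) p.402, (3.35)–(3.37) p.396; Balaban1984PropagatorsII, Lemma 2.1 p.234, (2.51) p.232] -/
theorem stepAnalyticPos1_KSC_on (hι : ∀ (j : J) (s : BlkY (f j).toKIdx), β (f j).toKIdx.hN (f j).toKIdx.D (f j).toKIdx.hk (ιB j s) = s)
    (hG1 : ∀ u : 𝔸ˣ, u ∈ G → ‖(u : 𝔸)‖ ≤ 1) (hpar : ∀ j (U : CfgY 𝔸 (f j).toKIdx), GVal G (f j).toKIdx U → ∀ z w, par j U z w ∈ G)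
    (hunit : ∀ j (U : CfgY 𝔸 (f j).toKIdx), GVal G (f j).toKIdx U → IsUnit (deltaPrimeAY (f j).toKIdx (par j) U))
    (dB : ℕ) (M₂ : ℝ) (hM₂ : 0 ≤ M₂) (hrepr : ∀ (v : 𝔸) (j : ι), |b.repr v j| ≤ M₂ * ‖v‖) (hcR : 0 < M₂ * ∑ j, ‖b j‖)
    (Cq : ℝ) (hCq : 0 ≤ Cq) (hC37 : ∀ j β' U a, C37 j β' U a → GVal G (f j).toKIdx U ∧ CplxLettersY G (f j) (par j) (ιB j) Cq β' U a)
    (MInv aInv aW : ℝ) (hMInv : 0 < MInv) (haInv : 0 < aInv) (haW : 0 < aW)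
    (GA : ∀ j : J, B9.KernelFamily (geo9Y (f j)) (codingYx P G (f j) (C37 j) (C38 j)).bg)
    (Cinv : ∀ j : J, B9.SiteKernel (geo9Y (f j)) (codingYx P G (f j) (C37 j) (C38 j)).bg) :
    StepAnalyticPos1 dB c35 (fun j => geo9Y (f j)) (fun j => (codingYx P G (f j) (C37 j) (C38 j)).bg) (fun j => KSC P G (f j) (par j) (C37 j) (C38 j)) GA Cinv
      (fun j => IsAnKY P G (f j) (par j) b (C37 j) (C38 j)) (fun j => KSC P G (f j) (par j) (C37 j) (C38 j)) :=
  stepAnalyticPos1_of_anFrame₂ (d := dB)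
    (anFrame₂CodedOn P f c35 G b C37 C38 par ιB (fun j => KSC P G (f j) (par j) (C37 j) (C38 j)) hι hG1 hpar hunit dB M₂ hM₂ hrepr Cq hCq hC37
      (M₂ * ∑ j, ‖b j‖) hcR (fun B _ => (M₂ * ∑ j, ‖b j‖) * B + 1) (fun B _ hB _ => by positivity) (fun δ => δ) (fun δ hδ => hδ)
      MInv aInv aW hMInv haInv haW (fun j => read342Y_KSC P G (f j) (par j) b (ιB j) (C37 j) (C38 j) (hι j) M₂ hM₂ hrepr c35 MInv aInv)
      (fun j => write342Y_KSC P G (f j) (par j) b (ιB j) (C37 j) (C38 j) (hι j) M₂ hM₂ hrepr aW fun β' U a h => (hC37 j β' U a h).1))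
    GA Cinv

include C38 in
/-- ★★★ **`StepAnalyticPos1` OF THE RECORD FAMILY ON A SUBFAMILY AT g8's RECORD PIN `IsAnRecY r`** (for every rescaling `r > 0`; input families: the record's
`kernelFamilyS … (GpY par) par`, `GA`, `Cinv` over `bg9Y`): from §5's coded step by the generic transfer `stepPos_of_family_pos` (§2's `hin`; the output
statement is unchanged — `IsAnKY` does not read the kernel family) and `stepPos_base_of_coded` (`IsAnKY` at `(base U, r·β)` IS `IsAnRecY r` at `(U, β)`).
Displayed: the root frame's structural data only (no class implication is needed for a base-read output; no plaquette law); the coded class `C38` is a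
free parameter of the coding used in the proof.
[cite: Balaban1985BackgroundPropagators, Thm 3.4 p.400 («extend to configurations U′U … as analytic functions of A′»), (3.60)–(3.64) p.402, (3.35)–(3.37) p.396; Balaban1984PropagatorsII, Lemma 2.1 p.234] -/
theorem stepAnalyticPos1_record_on (hι : ∀ (j : J) (s : BlkY (f j).toKIdx), β (f j).toKIdx.hN (f j).toKIdx.D (f j).toKIdx.hk (ιB j s) = s)
    (hG1 : ∀ u : 𝔸ˣ, u ∈ G → ‖(u : 𝔸)‖ ≤ 1) (hpar : ∀ j (U : CfgY 𝔸 (f j).toKIdx), GVal G (f j).toKIdx U → ∀ z w, par j U z w ∈ G)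
    (hunit : ∀ j (U : CfgY 𝔸 (f j).toKIdx), GVal G (f j).toKIdx U → IsUnit (deltaPrimeAY (f j).toKIdx (par j) U))
    (dB : ℕ) (M₂ : ℝ) (hM₂ : 0 ≤ M₂) (hrepr : ∀ (v : 𝔸) (j : ι), |b.repr v j| ≤ M₂ * ‖v‖) (hcR : 0 < M₂ * ∑ j, ‖b j‖)
    (Cq : ℝ) (hCq : 0 ≤ Cq) (hC37 : ∀ j β' U a, C37 j β' U a → GVal G (f j).toKIdx U ∧ CplxLettersY G (f j) (par j) (ιB j) Cq β' U a)
    (MInv aInv aW : ℝ) (hMInv : 0 < MInv) (haInv : 0 < aInv) (haW : 0 < aW)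
    (GA : ∀ j : J, B9.KernelFamily (geo9Y (f j)) (bg9YC 𝔸 G P (f j))) (Cinv : ∀ j : J, B9.SiteKernel (geo9Y (f j)) (bg9YC 𝔸 G P (f j)))
    {r : ℝ} (hr : 0 < r) :
    StepAnalyticPos1 dB c35 (fun j => geo9Y (f j)) (fun j => bg9YC 𝔸 G P (f j))
      (fun j => kernelFamilyS (f j).toKIdx (bg9YC 𝔸 G P (f j)) (fun U => U) (GpY (f j).toKIdx (par j)) (par j)) GA Cinv
      (fun j => IsAnRecY P G (f j) (par j) b (C37 j) r)
      (fun j => kernelFamilyS (f j).toKIdx (bg9YC 𝔸 G P (f j)) (fun U => U) (GpY (f j).toKIdx (par j)) (par j)) := by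
  refine stepPos_base_of_coded dB c35 (fun j => geo9Y (f j)) (fun j => bg9YC 𝔸 G P (f j))
    (fun j => kernelFamilyS (f j).toKIdx (bg9YC 𝔸 G P (f j)) (fun U => U) (GpY (f j).toKIdx (par j)) (par j)) GA Cinv
    (fun j => codingYx P G (f j) (C37 j) (C38 j)) (C := PUnit) (pos := fun _ => True)
    (fun _ j V α => IsAnKY P G (f j) (par j) b (C37 j) (C38 j) (KSC P G (f j) (par j) (C37 j) (C38 j)) V α)
    (fun _ j U α => IsAnRecY P G (f j) (par j) b (C37 j) r
      (kernelFamilyS (f j).toKIdx (bg9YC 𝔸 G P (f j)) (fun U => U) (GpY (f j).toKIdx (par j)) (par j)) U α)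
    hr (fun _ j U β h => h) ?_
  refine stepPos_of_family_pos dB c35 (fun j => geo9Y (f j)) (fun j => (codingYx P G (f j) (C37 j) (C38 j)).bg)
    (fun j => KSC P G (f j) (par j) (C37 j) (C38 j))
    (fun j => pullK (codingYx P G (f j) (C37 j) (C38 j)) (kernelFamilyS (f j).toKIdx (bg9YC 𝔸 G P (f j)) (fun U => U) (GpY (f j).toKIdx (par j)) (par j)))
    (fun j => pullK (codingYx P G (f j) (C37 j) (C38 j)) (GA j)) (fun j => pullK (codingYx P G (f j) (C37 j) (C38 j)) (GA j))
    (fun j => pullS (codingYx P G (f j) (C37 j) (C38 j)) (Cinv j))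
    (C₁ := PUnit) (C₂ := PUnit) (pos₁ := fun _ => True) (pos₂ := fun _ => True)
    (Out₁ := fun _ j V α => IsAnKY P G (f j) (par j) b (C37 j) (C38 j) (KSC P G (f j) (par j) (C37 j) (C38 j)) V α)
    (Out₂ := fun _ j V α => IsAnKY P G (f j) (par j) b (C37 j) (C38 j) (KSC P G (f j) (par j) (C37 j) (C38 j)) V α)
    (hin_KSC_on_pos P f c35 G par b ιB C37 C38 hι hG1 hM₂ hrepr dB _ _)
    (fun c hc a ha => ⟨0, 1, a, c, one_pos, ha, le_rfl, hc, fun _ _ _ _ _ _ _ _ _ _ h => h⟩)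
    (stepAnalyticPos1_KSC_on P f c35 G par b ιB C37 C38 hι hG1 hpar hunit dB M₂ hM₂ hrepr hcR Cq hCq hC37 MInv aInv aW hMInv haInv haW _ _)

include C38 in
/-- ★★★ **`StepAnalyticPos` (BOTH HALVES, `G′` AND THE SHARED `GA`) OF THE RECORD FAMILY ON A SUBFAMILY AT THE PIN `IsAnRecY r`**: the pin does not read the
kernel family, so the `GA` half is the `G′` half (`stepAnalyticPos_of_halves`). [cite: Balaban1985BackgroundPropagators, Thm 3.4 p.400, (3.62)–(3.64) p.402, (3.86) p.407] -/
theorem stepAnalyticPos_record_on (hι : ∀ (j : J) (s : BlkY (f j).toKIdx), β (f j).toKIdx.hN (f j).toKIdx.D (f j).toKIdx.hk (ιB j s) = s)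
    (hG1 : ∀ u : 𝔸ˣ, u ∈ G → ‖(u : 𝔸)‖ ≤ 1) (hpar : ∀ j (U : CfgY 𝔸 (f j).toKIdx), GVal G (f j).toKIdx U → ∀ z w, par j U z w ∈ G)
    (hunit : ∀ j (U : CfgY 𝔸 (f j).toKIdx), GVal G (f j).toKIdx U → IsUnit (deltaPrimeAY (f j).toKIdx (par j) U))
    (dB : ℕ) (M₂ : ℝ) (hM₂ : 0 ≤ M₂) (hrepr : ∀ (v : 𝔸) (j : ι), |b.repr v j| ≤ M₂ * ‖v‖) (hcR : 0 < M₂ * ∑ j, ‖b j‖)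
    (Cq : ℝ) (hCq : 0 ≤ Cq) (hC37 : ∀ j β' U a, C37 j β' U a → GVal G (f j).toKIdx U ∧ CplxLettersY G (f j) (par j) (ιB j) Cq β' U a)
    (MInv aInv aW : ℝ) (hMInv : 0 < MInv) (haInv : 0 < aInv) (haW : 0 < aW)
    (GA : ∀ j : J, B9.KernelFamily (geo9Y (f j)) (bg9YC 𝔸 G P (f j))) (Cinv : ∀ j : J, B9.SiteKernel (geo9Y (f j)) (bg9YC 𝔸 G P (f j)))
    {r : ℝ} (hr : 0 < r) :
    StepAnalyticPos dB c35 (fun j => geo9Y (f j)) (fun j => bg9YC 𝔸 G P (f j))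
      (fun j => kernelFamilyS (f j).toKIdx (bg9YC 𝔸 G P (f j)) (fun U => U) (GpY (f j).toKIdx (par j)) (par j)) GA Cinv
      (fun j => IsAnRecY P G (f j) (par j) b (C37 j) r) := by
  have h := stepAnalyticPos1_record_on P f c35 G par b ιB C37 C38 hι hG1 hpar hunit dB M₂ hM₂ hrepr hcR Cq hCq hC37 MInv aInv aW hMInv haInv haW
    GA Cinv hr
  exact stepAnalyticPos_of_halves h h

end Literature.MathematicalPhysics.QuantumFieldTheory.Balaban1983to89.B9SectBEGlobAnStepRecordOnR

end

/-!
# `Balaban1983to89.B9SectBStepsKSCUR` — THE CLASS-PARAMETRIC TWIN of `B9SectBStepsKSCU` (CASCADE-R, director-ym №279 GO-R; №277 (3) `hunitA` cure; dag-n06-d SOCKET-(α) class question)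

statement-level skeleton of published theorems with citation tags; proofs where landed; nothing here is a claim about the
Yang–Mills mass gap

WHAT THIS FILE IS.  The original module `B9SectBStepsKSCU` types its objects over MODULE 3's member carrier `bg9Y 𝔸 G x` (MODULE 2's small-cube class (3.35)).  This file RE-DECLARES, with UNCHANGED NAMES inside the namespace `…B9SectBStepsKSCUR`, exactly its 7 class-dependent declarations over the CLASS-PARAMETRIC carrier `B9SectBCodedClassR.bg9YC 𝔸 G P x` (`P : RegExtraY …` = the two cube conditions of (3.35)∕(3.36) as a parameter; `bg9Y 𝔸 G x = bg9YC 𝔸 G (extraY 𝔸 G) x` by `rfl`, so every declaration here specialises definitionally to its original; at the record's reading of PRINT's class, `P := extraYPb 𝔸 G`, the displayed laws `hreg335P` ((3.35) on plaquettes) and the class-keyed `hunitA` become theorems).  The text is the original's VERBATIM under the token surgery `bg9Y 𝔸 G ↦ bg9YC 𝔸 G P`, `NAME ↦ NAME P` for the class-dependent names (P the first explicit argument), and — №277 — the binder `hunitA` re-keyed from «all G-valued U» to «all (3.35)-regular U of the carrier» (`∀ j α₀ U, (bg9YC 𝔸 G P (f j)).Reg335 c35 α₀ U → IsUnit (deltaAY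 …)`).  Class-free declarations of the original are NOT copied: they are imported and used BY NAME (`open … hiding` the re-declared ones).  Generated by dag-n06-c g16's `gen.py` (HOME `pub-ymgap-dag-n06-c/lean/g16/`); the ORIGINAL MODULE DOCUMENTATION FOLLOWS VERBATIM and describes the mathematics.

HONEST SCOPE.  Re-typing bookkeeping; nothing of [B9] asserted beyond the original; COUNT-NEUTRAL; N06 NOT discharged; nothing continuum ∕ OS ∕ mass gap ∕ Clay.  Cell `pub-ymgap` (D-0062), Track A node N06 [B9], seat `pub-ymgap-dag-n06-c` g16, 2026-08-29.
-/

/-! Module documentation: that of the original `Balaban1983to89.B9SectBStepsKSCU` applies verbatim to this twin (not repeated here). -/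

noncomputable section

namespace Literature.MathematicalPhysics.QuantumFieldTheory.Balaban1983to89.B9SectBStepsKSCUR

open Literature.MathematicalPhysics.QuantumFieldTheory.Balaban1983to89.B9SectBCodedClassR (RegExtraY bg9YC)
open Literature.MathematicalPhysics.QuantumFieldTheory.Balaban1983to89.B9SectBStepsKSCU hiding KSCU_members_base KACU_members_base ineq342_346_347_congr thms_KSCU_base_iff hin_KSCU_on_pos stepAnalyticPos1_KSCU_on stepAnalyticPos_KSCU_on

open Literature.MathematicalPhysics.QuantumFieldTheory.Balaban1983to89.B6Ineq2142KLevelV1 (β)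
open Literature.MathematicalPhysics.QuantumFieldTheory.Balaban1983to89.B9SectBCodedCarrier (CCfg Coding pullK pullS)
open Literature.MathematicalPhysics.QuantumFieldTheory.Balaban1983to89.B9Eq360DeltaPrimeAY (AfldY)
open Literature.MathematicalPhysics.QuantumFieldTheory.Balaban1983to89.B9PinMembersKLevelV1 (MemberY geo9Y bg9Y)
open Literature.MathematicalPhysics.QuantumFieldTheory.Balaban1983to89.B9SectBGpLettersY (GVal decY)
open Literature.MathematicalPhysics.QuantumFieldTheory.Balaban1983to89.B9SectBGpFrameCodedYR (codingYx)
open Literature.MathematicalPhysics.QuantumFieldTheory.Balaban1983to89.B9SectBGpFrameCodedY (CplxLettersY)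
open Literature.MathematicalPhysics.QuantumFieldTheory.Balaban1983to89.B9SectBGpReadingsYR (KSC)
open Literature.MathematicalPhysics.QuantumFieldTheory.Balaban1983to89.B9SectBGpReadingsY (baseY)
open Literature.MathematicalPhysics.QuantumFieldTheory.Balaban1983to89.B9SectBGpTransferInYR (ineq343_345_congr)
open Literature.MathematicalPhysics.QuantumFieldTheory.Balaban1983to89.B9SectBCodedChainAnR (IsAnKY)
open Literature.MathematicalPhysics.QuantumFieldTheory.Balaban1983to89.B9SectBCodedReadingsUR (KSCU KACU)
open Literature.MathematicalPhysics.QuantumFieldTheory.Balaban1983to89.B9SectBEGlobAnStepRecordOnR (hin_KSC_on_pos stepAnalyticPos1_KSC_on)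
open Literature.MathematicalPhysics.QuantumFieldTheory.Balaban1983to89.B9SectBStepPosFamilyTransfer (stepPos_of_family_pos)
open Literature.MathematicalPhysics.QuantumFieldTheory.Balaban1983to89.B9SectBStepWhole (StepAnalyticPos1 StepAnalyticPos stepAnalyticPos_of_halves)
open Literature.MathematicalPhysics.QuantumFieldTheory.Balaban1983to89.Node00 (SiteY BlkY IBondY CfgY SiteParY BondParY BondOpY deltaPrimeAY kernelFamilyS
  kernelFamilyB GpY)

variable {d ℓ : ℕ} {hd : 1 ≤ d + 1} {hL : Odd (ℓ + 1) ∧ 1 < ℓ + 1} {b₀ b₁ : ℝ} {Mstar : ℕ}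
variable {𝔸 : Type} [NormedRing 𝔸] (P : RegExtraY d ℓ hd hL b₀ b₁ Mstar 𝔸) [NormedAlgebra ℂ 𝔸] [CompleteSpace 𝔸] [FiniteDimensional ℝ 𝔸]

/-! ## §1 At a base configuration the U-letter readings ARE the record's (read along the decoding) -/

section Base

variable (G : Subgroup 𝔸ˣ) (x : MemberY d ℓ hd hL b₀ b₁ Mstar) (par : SiteParY 𝔸 x.toKIdx) (OA : BondOpY 𝔸 x.toKIdx) (parB : BondParY 𝔸 x.toKIdx)
  (C37 C38 : ℝ → CfgY 𝔸 x.toKIdx → AfldY 𝔸 x.toKIdx → Prop)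

omit [FiniteDimensional ℝ 𝔸] in
/-- the six members of `KSCU` at `base U` are those of the record's G′ family read along the decoding (`rfl` ×6).
[cite: Balaban1985BackgroundPropagators, (3.42)–(3.47) pp.397–398, bookkeeping] -/
theorem KSCU_members_base (U : CfgY 𝔸 x.toKIdx) :
    (∀ n, (KSCU P G x par C37 C38).e n (.base U) =
      (pullK (codingYx P G x C37 C38) (kernelFamilyS x.toKIdx (bg9YC 𝔸 G P x) (fun U => U) (GpY x.toKIdx par) par)).e n (.base U)) ∧
    (KSCU P G x par C37 C38).h1 (.base U) =
      (pullK (codingYx P G x C37 C38) (kernelFamilyS x.toKIdx (bg9YC 𝔸 G P x) (fun U => U) (GpY x.toKIdx par) par)).h1 (.base U) ∧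
    (KSCU P G x par C37 C38).e4 (.base U) =
      (pullK (codingYx P G x C37 C38) (kernelFamilyS x.toKIdx (bg9YC 𝔸 G P x) (fun U => U) (GpY x.toKIdx par) par)).e4 (.base U) ∧
    (KSCU P G x par C37 C38).h2 (.base U) =
      (pullK (codingYx P G x C37 C38) (kernelFamilyS x.toKIdx (bg9YC 𝔸 G P x) (fun U => U) (GpY x.toKIdx par) par)).h2 (.base U) ∧
    (∀ n, (KSCU P G x par C37 C38).l2 n (.base U) =
      (pullK (codingYx P G x C37 C38) (kernelFamilyS x.toKIdx (bg9YC 𝔸 G P x) (fun U => U) (GpY x.toKIdx par) par)).l2 n (.base U)) ∧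
    (∀ n, (KSCU P G x par C37 C38).glob n (.base U) =
      (pullK (codingYx P G x C37 C38) (kernelFamilyS x.toKIdx (bg9YC 𝔸 G P x) (fun U => U) (GpY x.toKIdx par) par)).glob n (.base U)) :=
  ⟨fun _ => rfl, rfl, rfl, rfl, fun _ => rfl, fun _ => rfl⟩

omit [FiniteDimensional ℝ 𝔸] in
/-- the six members of `KACU` at `base U` are those of the record's G family read along the decoding (`rfl` ×6).
[cite: Balaban1985BackgroundPropagators, (3.42)–(3.47) pp.397–398, (3.84)–(3.86) p.407, bookkeeping] -/
theorem KACU_members_base (U : CfgY 𝔸 x.toKIdx) :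
    (∀ n, (KACU P G x OA parB C37 C38).e n (.base U) =
      (pullK (codingYx P G x C37 C38) (kernelFamilyB x.toKIdx (bg9YC 𝔸 G P x) (fun U => U) OA parB)).e n (.base U)) ∧
    (KACU P G x OA parB C37 C38).h1 (.base U) = (pullK (codingYx P G x C37 C38) (kernelFamilyB x.toKIdx (bg9YC 𝔸 G P x) (fun U => U) OA parB)).h1 (.base U) ∧
    (KACU P G x OA parB C37 C38).e4 (.base U) = (pullK (codingYx P G x C37 C38) (kernelFamilyB x.toKIdx (bg9YC 𝔸 G P x) (fun U => U) OA parB)).e4 (.base U) ∧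
    (KACU P G x OA parB C37 C38).h2 (.base U) = (pullK (codingYx P G x C37 C38) (kernelFamilyB x.toKIdx (bg9YC 𝔸 G P x) (fun U => U) OA parB)).h2 (.base U) ∧
    (∀ n, (KACU P G x OA parB C37 C38).l2 n (.base U) =
      (pullK (codingYx P G x C37 C38) (kernelFamilyB x.toKIdx (bg9YC 𝔸 G P x) (fun U => U) OA parB)).l2 n (.base U)) ∧
    (∀ n, (KACU P G x OA parB C37 C38).glob n (.base U) =
      (pullK (codingYx P G x C37 C38) (kernelFamilyB x.toKIdx (bg9YC 𝔸 G P x) (fun U => U) OA parB)).glob n (.base U)) :=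
  ⟨fun _ => rfl, rfl, rfl, rfl, fun _ => rfl, fun _ => rfl⟩

omit [FiniteDimensional ℝ 𝔸] in
/-- two coded families agreeing member-wise at a configuration satisfy the (3.42)∕(3.46)∕(3.47) block together.
[cite: Balaban1985BackgroundPropagators, (3.42), (3.46), (3.47) pp.397–398, bookkeeping] -/
theorem ineq342_346_347_congr (K K' : B9.KernelFamily (geo9Y x) (codingYx P G x C37 C38).bg) {c : (codingYx P G x C37 C38).bg.Cfg}
    (he : ∀ n, K.e n c = K'.e n c) (hl2 : ∀ n, K.l2 n c = K'.l2 n c) (hglob : ∀ n, K.glob n c = K'.glob n c) (B₀ δ₀ : ℝ)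
    (h : B9.Ineq342_346_347 K B₀ δ₀ c) : B9.Ineq342_346_347 K' B₀ δ₀ c := by
  unfold B9.Ineq342_346_347 at h ⊢
  simp only [← he, ← hl2, ← hglob]
  exact h

omit [FiniteDimensional ℝ 𝔸] in
/-- ★ **THE THEOREM-3.1–3.3 BLOCK AT A BASE TRANSPORTS between `(KSCU, KACU)` and the pulled-back record families** (both directions; the (3.48) family is shared).
[cite: Balaban1985BackgroundPropagators, (3.42)–(3.48) pp.397–398, bookkeeping] -/
theorem thms_KSCU_base_iff (dC : ℕ) (Cinv : B9.SiteKernel (geo9Y x) (bg9YC 𝔸 G P x)) (B₀ δ₀ : ℝ) (Bβ Bε : ℝ → ℝ) (Bεβ : ℝ → ℝ → ℝ) (B₁ δ₁ : ℝ)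
    (U : CfgY 𝔸 x.toKIdx) :
    B9.Thms31to33IneqAt dC (KSCU P G x par C37 C38) (KACU P G x OA parB C37 C38) (pullS (codingYx P G x C37 C38) Cinv) B₀ δ₀ Bβ Bε Bεβ B₁ δ₁ (.base U) ↔
      B9.Thms31to33IneqAt dC
        (pullK (codingYx P G x C37 C38) (kernelFamilyS x.toKIdx (bg9YC 𝔸 G P x) (fun U => U) (GpY x.toKIdx par) par))
        (pullK (codingYx P G x C37 C38) (kernelFamilyB x.toKIdx (bg9YC 𝔸 G P x) (fun U => U) OA parB))
        (pullS (codingYx P G x C37 C38) Cinv) B₀ δ₀ Bβ Bε Bεβ B₁ δ₁ (.base U) := by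
  obtain ⟨se, sh1, se4, sh2, sl2, sg⟩ := KSCU_members_base P G x par C37 C38 U
  obtain ⟨ae, ah1, ae4, ah2, al2, ag⟩ := KACU_members_base P G x OA parB C37 C38 U
  constructor
  · rintro ⟨⟨h42, h43⟩, hC, ⟨g42, g43⟩⟩
    exact ⟨⟨ineq342_346_347_congr P G x C37 C38 _ _ se sl2 sg B₀ δ₀ h42, ineq343_345_congr P G x C37 C38 _ _ sh1 se4 sh2 Bβ Bε Bεβ δ₀ h43⟩, hC,
      ⟨ineq342_346_347_congr P G x C37 C38 _ _ ae al2 ag B₀ δ₀ g42, ineq343_345_congr P G x C37 C38 _ _ ah1 ae4 ah2 Bβ Bε Bεβ δ₀ g43⟩⟩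
  · rintro ⟨⟨h42, h43⟩, hC, ⟨g42, g43⟩⟩
    exact ⟨⟨ineq342_346_347_congr P G x C37 C38 _ _ (fun n => (se n).symm) (fun n => (sl2 n).symm) (fun n => (sg n).symm) B₀ δ₀ h42,
        ineq343_345_congr P G x C37 C38 _ _ sh1.symm se4.symm sh2.symm Bβ Bε Bεβ δ₀ h43⟩, hC,
      ⟨ineq342_346_347_congr P G x C37 C38 _ _ (fun n => (ae n).symm) (fun n => (al2 n).symm) (fun n => (ag n).symm) B₀ δ₀ g42,
        ineq343_345_congr P G x C37 C38 _ _ ah1.symm ae4.symm ah2.symm Bβ Bε Bεβ δ₀ g43⟩⟩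

end Base

/-! ## §2 The input domination for `KSCU` with positive constants -/

section Hin

variable {J : Type} (f : J → MemberY d ℓ hd hL b₀ b₁ Mstar) [∀ x : MemberY d ℓ hd hL b₀ b₁ Mstar, Fintype (geo9Y x).Site]
  (c35 : ℝ) (G : Subgroup 𝔸ˣ) (par : ∀ j : J, SiteParY 𝔸 (f j).toKIdx) (OA : ∀ j : J, BondOpY 𝔸 (f j).toKIdx)
  (parB : ∀ j : J, BondParY 𝔸 (f j).toKIdx) {ι : Type} [Fintype ι] (b : Module.Basis ι ℝ 𝔸)
  (ιB : ∀ j : J, BlkY (f j).toKIdx → IBondY (f j).toKIdx)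
  (C37 C38 : ∀ j : J, ℝ → CfgY 𝔸 (f j).toKIdx → AfldY 𝔸 (f j).toKIdx → Prop)
  (Cinv : ∀ j : J, B9.SiteKernel (geo9Y (f j)) (bg9YC 𝔸 G P (f j)))

omit [FiniteDimensional ℝ 𝔸] in
/-- ★ **`hin` FOR `KSCU` WITH POSITIVE OUTPUT CONSTANTS** (input families `(KSCU, KACU, pullS Cinv)`; output: g7's augmented `KSC` with the shared `KACU`, `pullS Cinv`):
at a (3.35)-regular base, §1 identifies the block with the record's read along the decoding, then `B9SectBEGlobAnStepRecordOn.hin_KSC_on_pos`.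
[cite: Balaban1985BackgroundPropagators, Thms 3.1–3.3 (3.42)–(3.48) pp.397–399, (3.35) p.396; Balaban1984PropagatorsII, (2.51) p.232] -/
theorem hin_KSCU_on_pos (hι : ∀ (j : J) (s : BlkY (f j).toKIdx), β (f j).toKIdx.hN (f j).toKIdx.D (f j).toKIdx.hk (ιB j s) = s)
    (hG1 : ∀ u : 𝔸ˣ, u ∈ G → ‖(u : 𝔸)‖ ≤ 1) {M₂ : ℝ} (hM₂ : 0 ≤ M₂) (hrepr : ∀ (v : 𝔸) (j : ι), |b.repr v j| ≤ M₂ * ‖v‖) (dC : ℕ) :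
    ∀ (B₀ δ₀ : ℝ) (Bβ Bε : ℝ → ℝ) (Bεβ : ℝ → ℝ → ℝ) (B₁ δ₁ : ℝ), 0 < B₀ → 0 < δ₀ → 0 < B₁ → 0 < δ₁ →
      ∃ (Mi ai B₀' δ₀' : ℝ) (Bβ' Bε' : ℝ → ℝ) (Bεβ' : ℝ → ℝ → ℝ) (B₁' δ₁' : ℝ), 0 < ai ∧ 0 < B₀' ∧ 0 < δ₀' ∧ 0 < B₁' ∧ 0 < δ₁' ∧
        ∀ j : J, Mi ≤ (geo9Y (f j)).M → ∀ α₀ : ℝ, 0 < α₀ → (geo9Y (f j)).M * α₀ ≤ ai →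
          ∀ c : (codingYx P G (f j) (C37 j) (C38 j)).bg.Cfg, (codingYx P G (f j) (C37 j) (C38 j)).bg.Reg335 c35 α₀ c →
          B9.Thms31to33IneqAt dC (KSCU P G (f j) (par j) (C37 j) (C38 j)) (KACU P G (f j) (OA j) (parB j) (C37 j) (C38 j))
              (pullS (codingYx P G (f j) (C37 j) (C38 j)) (Cinv j)) B₀ δ₀ Bβ Bε Bεβ B₁ δ₁ c →
          B9.Thms31to33IneqAt dC (KSC P G (f j) (par j) (C37 j) (C38 j)) (KACU P G (f j) (OA j) (parB j) (C37 j) (C38 j))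
              (pullS (codingYx P G (f j) (C37 j) (C38 j)) (Cinv j)) B₀' δ₀' Bβ' Bε' Bεβ' B₁' δ₁' c := by
  intro B₀ δ₀ Bβ Bε Bεβ B₁ δ₁ hB₀ hδ₀ hB₁ hδ₁
  -- g7's conversion for the pulled-back record G′ with the shared families `KACU`, `pullS Cinv`
  obtain ⟨Mi, ai, B₀', δ₀', Bβ', Bε', Bεβ', B₁', δ₁', hai, hB₀', hδ₀', hB₁', hδ₁', H⟩ :=
    hin_KSC_on_pos P f c35 G par b ιB C37 C38 hι hG1 hM₂ hrepr dC (fun j => KACU P G (f j) (OA j) (parB j) (C37 j) (C38 j))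
      (fun j => pullS (codingYx P G (f j) (C37 j) (C38 j)) (Cinv j)) B₀ δ₀ Bβ Bε Bεβ B₁ δ₁ hB₀ hδ₀ hB₁ hδ₁
  refine ⟨Mi, ai, B₀', δ₀', Bβ', Bε', Bεβ', B₁', δ₁', hai, hB₀', hδ₀', hB₁', hδ₁', fun j hM α₀ hα₀ hMa c hreg hT => ?_⟩
  obtain ⟨U, rfl, -⟩ := (codingYx P G (f j) (C37 j) (C38 j)).exists_of_bg_Reg335 hreg
  refine H j hM α₀ hα₀ hMa _ hreg ?_
  -- at the base: `KACU` = the pulled-back record G family, `KSCU` = the pulled-back record G′ family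
  have h1 := (thms_KSCU_base_iff P G (f j) (par j) (OA j) (parB j) (C37 j) (C38 j) dC (Cinv j) B₀ δ₀ Bβ Bε Bεβ B₁ δ₁ U).1 hT
  -- restore `KACU` as the shared GA family (its members at the base are the record's: the block transports back)
  obtain ⟨⟨h42, h43⟩, hC, ⟨g42, g43⟩⟩ := h1
  obtain ⟨ae, ah1, ae4, ah2, al2, ag⟩ := KACU_members_base P G (f j) (OA j) (parB j) (C37 j) (C38 j) U
  exact ⟨⟨h42, h43⟩, hC, ⟨ineq342_346_347_congr P G (f j) (C37 j) (C38 j) _ _ (fun n => (ae n).symm) (fun n => (al2 n).symm)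
    (fun n => (ag n).symm) B₀ δ₀ g42, ineq343_345_congr P G (f j) (C37 j) (C38 j) _ _ ah1.symm ae4.symm ah2.symm Bβ Bε Bεβ δ₀ g43⟩⟩

/-! ## §3 The analytic-extension step for `(KSCU, KACU, C⁻¹)` at the coded pin `IsAnKY` -/

/-- ★★ **`StepAnalyticPos1` OF `KSCU` over the coded carrier at `IsAnKY`** (input families `(KSCU, KACU, pullS Cinv)`): g8's frame output for `KSC`
(`stepAnalyticPos1_KSC_on` with `GA := KACU`) transported by the generic transfer — `hin_KSCU_on_pos`, identity output (the pin does not read the family).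
[cite: Balaban1985BackgroundPropagators, Thm 3.4 p.400, (3.60)–(3.64) p.402, (3.35)–(3.37) p.396; Balaban1984PropagatorsII, Lemma 2.1 p.234] -/
theorem stepAnalyticPos1_KSCU_on [∀ x : MemberY d ℓ hd hL b₀ b₁ Mstar, DecidableEq (geo9Y x).Site]
    [∀ x : MemberY d ℓ hd hL b₀ b₁ Mstar, Nonempty (geo9Y x).Site] [NormOneClass 𝔸] [DecidableEq ι]
    (hι : ∀ (j : J) (s : BlkY (f j).toKIdx), β (f j).toKIdx.hN (f j).toKIdx.D (f j).toKIdx.hk (ιB j s) = s)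
    (hG1 : ∀ u : 𝔸ˣ, u ∈ G → ‖(u : 𝔸)‖ ≤ 1) (hpar : ∀ j (U : CfgY 𝔸 (f j).toKIdx), GVal G (f j).toKIdx U → ∀ z w, par j U z w ∈ G)
    (hunit : ∀ j (U : CfgY 𝔸 (f j).toKIdx), GVal G (f j).toKIdx U → IsUnit (deltaPrimeAY (f j).toKIdx (par j) U))
    (dB : ℕ) (M₂ : ℝ) (hM₂ : 0 ≤ M₂) (hrepr : ∀ (v : 𝔸) (j : ι), |b.repr v j| ≤ M₂ * ‖v‖) (hcR : 0 < M₂ * ∑ j, ‖b j‖)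
    (Cq : ℝ) (hCq : 0 ≤ Cq) (hC37 : ∀ j β' U a, C37 j β' U a → GVal G (f j).toKIdx U ∧ CplxLettersY G (f j) (par j) (ιB j) Cq β' U a)
    (MInv aInv aW : ℝ) (hMInv : 0 < MInv) (haInv : 0 < aInv) (haW : 0 < aW) :
    StepAnalyticPos1 dB c35 (fun j => geo9Y (f j)) (fun j => (codingYx P G (f j) (C37 j) (C38 j)).bg)
      (fun j => KSCU P G (f j) (par j) (C37 j) (C38 j)) (fun j => KACU P G (f j) (OA j) (parB j) (C37 j) (C38 j))
      (fun j => pullS (codingYx P G (f j) (C37 j) (C38 j)) (Cinv j))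
      (fun j => IsAnKY P G (f j) (par j) b (C37 j) (C38 j)) (fun j => KSCU P G (f j) (par j) (C37 j) (C38 j)) := by
  refine stepPos_of_family_pos dB c35 (fun j => geo9Y (f j)) (fun j => (codingYx P G (f j) (C37 j) (C38 j)).bg)
    (fun j => KSC P G (f j) (par j) (C37 j) (C38 j)) (fun j => KSCU P G (f j) (par j) (C37 j) (C38 j))
    (fun j => KACU P G (f j) (OA j) (parB j) (C37 j) (C38 j)) (fun j => KACU P G (f j) (OA j) (parB j) (C37 j) (C38 j))
    (fun j => pullS (codingYx P G (f j) (C37 j) (C38 j)) (Cinv j))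
    (C₁ := PUnit) (C₂ := PUnit) (pos₁ := fun _ => True) (pos₂ := fun _ => True)
    (Out₁ := fun _ j V α => IsAnKY P G (f j) (par j) b (C37 j) (C38 j) (KSC P G (f j) (par j) (C37 j) (C38 j)) V α)
    (Out₂ := fun _ j V α => IsAnKY P G (f j) (par j) b (C37 j) (C38 j) (KSCU P G (f j) (par j) (C37 j) (C38 j)) V α)
    (hin_KSCU_on_pos P f c35 G par OA parB b ιB C37 C38 Cinv hι hG1 hM₂ hrepr dB)
    (fun c hc a ha => ⟨0, 1, a, c, one_pos, ha, le_rfl, hc, fun _ _ _ _ _ _ _ _ _ _ h => h⟩)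
    (stepAnalyticPos1_KSC_on P f c35 G par b ιB C37 C38 hι hG1 hpar hunit dB M₂ hM₂ hrepr hcR Cq hCq hC37 MInv aInv aW hMInv haInv haW _ _)

/-- ★★ **`StepAnalyticPos` (both halves) of `(KSCU, KACU, C⁻¹)` at `IsAnKY`** — the pin ignores the family, so the `KACU` half is the `KSCU` half.
[cite: Balaban1985BackgroundPropagators, Thm 3.4 p.400, (3.62)–(3.64) p.402, (3.86) p.407] -/
theorem stepAnalyticPos_KSCU_on [∀ x : MemberY d ℓ hd hL b₀ b₁ Mstar, DecidableEq (geo9Y x).Site]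
    [∀ x : MemberY d ℓ hd hL b₀ b₁ Mstar, Nonempty (geo9Y x).Site] [NormOneClass 𝔸] [DecidableEq ι]
    (hι : ∀ (j : J) (s : BlkY (f j).toKIdx), β (f j).toKIdx.hN (f j).toKIdx.D (f j).toKIdx.hk (ιB j s) = s)
    (hG1 : ∀ u : 𝔸ˣ, u ∈ G → ‖(u : 𝔸)‖ ≤ 1) (hpar : ∀ j (U : CfgY 𝔸 (f j).toKIdx), GVal G (f j).toKIdx U → ∀ z w, par j U z w ∈ G)
    (hunit : ∀ j (U : CfgY 𝔸 (f j).toKIdx), GVal G (f j).toKIdx U → IsUnit (deltaPrimeAY (f j).toKIdx (par j) U))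
    (dB : ℕ) (M₂ : ℝ) (hM₂ : 0 ≤ M₂) (hrepr : ∀ (v : 𝔸) (j : ι), |b.repr v j| ≤ M₂ * ‖v‖) (hcR : 0 < M₂ * ∑ j, ‖b j‖)
    (Cq : ℝ) (hCq : 0 ≤ Cq) (hC37 : ∀ j β' U a, C37 j β' U a → GVal G (f j).toKIdx U ∧ CplxLettersY G (f j) (par j) (ιB j) Cq β' U a)
    (MInv aInv aW : ℝ) (hMInv : 0 < MInv) (haInv : 0 < aInv) (haW : 0 < aW) :
    StepAnalyticPos dB c35 (fun j => geo9Y (f j)) (fun j => (codingYx P G (f j) (C37 j) (C38 j)).bg)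
      (fun j => KSCU P G (f j) (par j) (C37 j) (C38 j)) (fun j => KACU P G (f j) (OA j) (parB j) (C37 j) (C38 j))
      (fun j => pullS (codingYx P G (f j) (C37 j) (C38 j)) (Cinv j))
      (fun j => IsAnKY P G (f j) (par j) b (C37 j) (C38 j)) := by
  have h := stepAnalyticPos1_KSCU_on P f c35 G par OA parB b ιB C37 C38 Cinv hι hG1 hpar hunit dB M₂ hM₂ hrepr hcR Cq hCq hC37 MInv aInv aW
    hMInv haInv haW
  exact stepAnalyticPos_of_halves h h

end Hin

end Literature.MathematicalPhysics.QuantumFieldTheory.Balaban1983to89.B9SectBStepsKSCUR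

end

/-!
# `Balaban1983to89.B9SectBGReadYR` — THE CLASS-PARAMETRIC TWIN of `B9SectBGReadY` (CASCADE-R, director-ym №279 GO-R; №277 (3) `hunitA` cure; dag-n06-d SOCKET-(α) class question)

statement-level skeleton of published theorems with citation tags; proofs where landed; nothing here is a claim about the
Yang–Mills mass gap

WHAT THIS FILE IS.  The original module `B9SectBGReadY` types its objects over MODULE 3's member carrier `bg9Y 𝔸 G x` (MODULE 2's small-cube class (3.35)).  This file RE-DECLARES, with UNCHANGED NAMES inside the namespace `…B9SectBGReadYR`, exactly its 4 class-dependent declarations over the CLASS-PARAMETRIC carrier `B9SectBCodedClassR.bg9YC 𝔸 G P x` (`P : RegExtraY …` = the two cube conditions of (3.35)∕(3.36) as a parameter; `bg9Y 𝔸 G x = bg9YC 𝔸 G (extraY 𝔸 G) x` by `rfl`, so every declaration here specialises definitionally to its original; at the record's reading of PRINT's class, `P := extraYPb 𝔸 G`, the displayed laws `hreg335P` ((3.35) on plaquettes) and the class-keyed `hunitA` become theorems).  The text is the original's VERBATIM under the token surgery `bg9Y 𝔸 G ↦ bg9YC 𝔸 G P`, `NAME ↦ NAME P` for the class-dependent names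 (P the first explicit argument), and — №277 — the binder `hunitA` re-keyed from «all G-valued U» to «all (3.35)-regular U of the carrier» (`∀ j α₀ U, (bg9YC 𝔸 G P (f j)).Reg335 c35 α₀ U → IsUnit (deltaAY …)`).  Class-free declarations of the original are NOT copied: they are imported and used BY NAME (`open … hiding` the re-declared ones).  Generated by dag-n06-c g16's `gen.py` (HOME `pub-ymgap-dag-n06-c/lean/g16/`); the ORIGINAL MODULE DOCUMENTATION FOLLOWS VERBATIM and describes the mathematics.

HONEST SCOPE.  Re-typing bookkeeping; nothing of [B9] asserted beyond the original; COUNT-NEUTRAL; N06 NOT discharged; nothing continuum ∕ OS ∕ mass gap ∕ Clay.  Cell `pub-ymgap` (D-0062), Track A node N06 [B9], seat `pub-ymgap-dag-n06-c` g16, 2026-08-29.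
-/

/-!
# Balaban [B9], Thm 3.3 p. 399 with (3.42) p. 397, [4] (2.51) p. 232 — THE (3.42) READING DICTIONARY OF NODE 00's BOND-SECTOR FAMILY
# `Node00.kernelFamilyB i B cfg O par` (the bond-sector twin of def-Y's `Node00.OpsYRead342` §4): the (3.42) block at a configuration ⇒ the four POINTWISE
# bounds of `O(V)`, `∇_{V,ν}O(V)`, `O(V)∇*_{V,ν}`, `Δ_V O(V)` on product inputs `J ⊗ E`, `‖E‖ ≦ 1`, and ⇒ the four [4]-(2.51) BLOCK MAJORANTS of the real-coordinate
# letters `conj b O(V)`, `conj b (∇_{V,ν} ∘ O(V))`, `conj b (O(V) ∘ ∇*_{V,ν})`, `conj b (Δ_V ∘ O(V))` on the bond carrier `FBondY × ι` (block map `ι_B ∘ blkV1`); and the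
# same for the coded bond reading `KACU` of the Sect.-B step of record (R13-U1): READ at a base, WRITE at a coded product (pub-ymgap N06 row 13, G side,
# first brick of the instance: the `readG342 ∕ writeG342` dictionary of the bond sector in def-Y's letters)

T. Bałaban, *Propagators for lattice gauge theories in a background field*, Commun. Math. Phys. **99** (1985) 389–434
[`Balaban1985BackgroundPropagators`, "B9"]; [4] = T. Bałaban, *Propagators and renormalization transformations for lattice gauge
theories. II*, Commun. Math. Phys. **96** (1984) 223–250 [`Balaban1984PropagatorsII`].

statement-level skeleton of published theorems with citation tags; proofs where landed; nothing here is a claim about the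
Yang–Mills mass gap

WHAT.  §2 ★ READ POINTWISE: from
`EBlock (kernelFamilyB i B cfg O par) B₀ δ U₁` (def-Y's product-class (3.42) block at `V = cfg U₁`), for every `J` supported in `Δ(βy′)`, `‖E‖ ≦ 1` and bond `x`
in `Δ(βy)`: `‖(O(V)(J ⊗ E))(x)‖ ≦ B₀ℓ(y)²e^{−δd(y,y′)}|J|`, `‖(∇_{V,ν}O(V)(J ⊗ E))(x)‖`, `‖(O(V)∇*_{V,ν}(J ⊗ E))(x)‖ ≦ B₀ℓ(y)e^{−δd}|J|`, `‖(Δ_VO(V)(J ⊗ E))(x)‖ ≦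
B₀e^{−δd}|J|` (the sup over the unit ball is finite-dimensionally bounded by p21's class device `B9CubeLettersInvReadDictB.supInB_O_le_unif` etc.).  §3 ★★ READ
AS MAJORANTS: the four block majorants `M₂Σ_j‖b_j‖·B₀·ℓ(a)^{2,1,1,0}·e^{−δd(a,a′)}` of the conj-`b` letters over the bond carrier, by lit-balaban's
`B9Thm310CommutatorBound389BMajorant.hasMajorant_conj_of_ball_boundB` (corner-free members: a section `ι_B` of `β`).  §4 ★★ the same four majorants for the
CODED bond reading `KACU G x OA parB C37 C38` of `B9SectBCodedReadingsU` at a base configuration (`KACU_members_base`: at the base the U-letter reading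
IS def-Y's one-configuration reading `kernelFamilyB`) — the `h342X` inputs of r06's letter-free G-step `B9Ineq385VG.gExt_leftEntry_of_386` ∕ the `readG342`
half of `B9SectBGFrameV3.GFrame₃` in def-Y's own letters.  §5 ★★ WRITE for `KACU` at a coded product: `KACU_e_prod_eq` (at `prod U a` the (3.42) members of
`KACU` ARE those of def-Y's one-configuration reading of the CONSTANT letter `OA(W)`, `W = e^{iηa}·U`, through `baseY` — `rfl`) and `writeG342Y_KACU`: block
majorants of `conj b G`, `conj b D_ν * conj b G`, `conj b G * conj b D*_ν`, `conj b L * conj b G` (`G, D_ν, D*_ν, L` agreeing pointwise with `OA(W)`, `∇_{U,ν}`,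
`∇*_{U,ν}`, `Δ_U` — differences at the BASE, operator at the PRODUCT, the U-letter convention R13-U1) ⇒ `EBlock (KACU …) (M₂Σ‖b‖·B_c) δ (prod U a)`, SAME rate
(p21's writer `B9CubeLettersInvWriteDictB.eBlock_kernelFamilyBInv_of_hasMajorant` + the class ⇒ product dictionary).

HONEST SCOPE.  Sup bookkeeping and finite-dimensional linear algebra over def-Y's definitions; the (3.42) block is the HYPOTHESIS; SAME rate `δ`;
constants `M₂Σ_j‖b_j‖·B₀` (READ) ∕ `M₂Σ_j‖b_j‖·B_c` (WRITE).  The Hölder ∕ L² ∕ (3.47) members of `KACU` are NOT in this file.  Count-neutral; no summit ∕ sub-problem statement is proved; N06 is not discharged; nothing continuum ∕ OS ∕ mass-gap ∕ Clay.  No `sorry`, no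
`axiom`, no `… : Prop` fact, no `instance`, no `notation`, no `def`.  Seat dag-n06-c g12, 2026-08-28; `--supports stmt-QuantumFields-27364`.

RELATED IN THE TREE, NOT DUPLICATED.  def-Y `Node00.OpsYRead342` (the SITE-sector twin, `kernelFamilyS`); p21 `B9CubeLettersInvReadDictB` (READ for the
test-class family `kernelFamilyBInv` — devices §1–§2 used BY NAME; its §4 is over the class `TestY`, ours over def-Y's product class); lit-balaban
`B9Thm310CommutatorBound389BMajorant` (the ball-bound ⇒ majorant device on the bond carrier, used BY NAME); p21 `B9CubeLettersInvReadDictBMajorants` (the four majorants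
for the TEST-CLASS family `kernelFamilyBInv` — the stronger hypothesis; ours start from def-Y's product-class block, which is what `KACU` delivers; its `cdB_smul` ∕
`cdsB_smul` ∕ `lapB_smul` used BY NAME); dag-n06-c g10 `B9SectBStepsKSCU` (`KACU_members_base`).
-/

noncomputable section

namespace Literature.MathematicalPhysics.QuantumFieldTheory.Balaban1983to89.B9SectBGReadYR

open Literature.MathematicalPhysics.QuantumFieldTheory.Balaban1983to89.B9SectBCodedClassR (RegExtraY bg9YC)
open Literature.MathematicalPhysics.QuantumFieldTheory.Balaban1983to89.B9SectBGReadY hiding eBlock_kernelFamilyB_of_KACU_base readG342Y_KACU KACU_e_prod_eq writeG342Y_KACU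

open Node00
open B6GlobalChartV1 (blkV1)
open B6Ineq2142KLevelV1 (β)
open B6KLevelCensusIndexV1 (KIdx)
open B6RandomWalk (HasMajorant hasMajorant_mono)
open B9Thm34Ext (toB6)
open B9FromB6 (EBlock)
open B9GeoNormsKLevelV1 (geo9K)
open B9Eq352DivFormLetters (conj)
open B9CoReadingCoords (cdBₗ cdsBₗ lapBₗ cdBₗ_apply cdsBₗ_apply lapBₗ_apply)
open B9CubeLettersInvReadings (testYOfBall)
open B9CubeLettersInvReadDictB (norm_le_supInB supInB_O_le_unif iSup_supInB_cdB_O_le_unif iSup_supInB_O_cdsB_le_unif supInB_lapB_O_le_unif le_iSup_fin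
  eBlock_kernelFamilyB_of_eBlockInvB)
open B9CubeLettersInvWriteDictB (eBlock_kernelFamilyBInv_of_hasMajorant)
open B9SectBGpReadingsY (baseY)
open B9SectBGpLettersY (decY)
open B9Thm310CommutatorBound389BMajorant (hasMajorant_conj_of_ball_boundB)
open B9CubeLettersInvReadDictBMajorants (cdB_smul cdsB_smul lapB_smul)
open B9Thm314WholeExpansionReads (le_iSup_ball)
open B9PinMembersKLevelV1 (MemberY geo9Y bg9Y)
open B9Eq360DeltaPrimeAY (AfldY)
open B9SectBGpFrameCodedYR (codingYx codingYx_dec)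
open B9SectBGpLettersY (decY_base)
open B9SectBCodedCarrier (pullK pullK_e)
open B9SectBCodedReadingsUR (KACU)
open B9SectBStepsKSCUR (KACU_members_base)

variable {d ℓ : ℕ} {hd : 1 ≤ d + 1} {hL : Odd (ℓ + 1) ∧ 1 < ℓ + 1} {b₀ b₁ : ℝ} {Mstar : ℕ}
variable {𝔸 : Type} [NormedRing 𝔸] (P : RegExtraY d ℓ hd hL b₀ b₁ Mstar 𝔸) [NormedAlgebra ℂ 𝔸] [CompleteSpace 𝔸]
variable {ι : Type} [Fintype ι]
variable (i : KIdx d ℓ hd hL b₀ b₁) (b : Module.Basis ι ℝ 𝔸)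

/-! ## §2 READ at def-Y's bond entries, pointwise: `EBlock (kernelFamilyB …) B₀ δ U₁` ⇒ the four bounds at `cfg U₁` -/

section Read

variable {B : B9.Backgrounds} (cfg : B.Cfg → CfgY 𝔸 i) (O : BondOpY 𝔸 i) (par : BondParY 𝔸 i) {B₀ δ : ℝ} {U₁ : B.Cfg}

/-! ## §3 READ as block majorants of the conj-`b` letters on the bond carrier `FBondY × ι` -/

variable [Fintype (geo9K i).Site] {Rr : ℝ} {Hp : Prop}

end Read

/-! ## §4 The coded bond reading `KACU` of the Sect.-B step of record at a base configuration -/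

section Coded

variable (G : Subgroup 𝔸ˣ) (x : MemberY d ℓ hd hL b₀ b₁ Mstar) (OA : BondOpY 𝔸 x.toKIdx) (parB : BondParY 𝔸 x.toKIdx)
  (C37 C38 : ℝ → CfgY 𝔸 x.toKIdx → AfldY 𝔸 x.toKIdx → Prop)

/-- at a base configuration the (3.42) block of the coded U-letter bond reading `KACU` IS the block of def-Y's one-configuration reading `kernelFamilyB`
(`B9SectBStepsKSCU.KACU_members_base`). [cite: Balaban1985BackgroundPropagators, Thm 3.3 p.399 with (3.42) p.397, bookkeeping] -/
theorem eBlock_kernelFamilyB_of_KACU_base {B₀ δ : ℝ} {U : CfgY 𝔸 x.toKIdx} (h : EBlock (KACU P G x OA parB C37 C38) B₀ δ (.base U)) :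
    EBlock (kernelFamilyB x.toKIdx (bg9YC 𝔸 G P x) (fun U => U) OA parB) B₀ δ U := by
  -- the coded U-letter reading and the pulled-back one-configuration reading have the same (3.42) members at the base
  have h' : EBlock (pullK (codingYx P G x C37 C38) (kernelFamilyB x.toKIdx (bg9YC 𝔸 G P x) (fun U => U) OA parB)) B₀ δ (.base U) := by
    intro n lam y y' hs
    rw [← (KACU_members_base P G x OA parB C37 C38 U).1 n]
    exact h n lam y y' hs
  -- the pulled-back reading at `base U` is the record's at `dec (base U) = U`
  intro n lam y y' hs
  have h1 := h' n lam y y' hs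
  simp only [pullK_e, codingYx_dec] at h1
  exact h1

variable [Fintype (geo9K x.toKIdx).Site] {Rr : ℝ} {Hp : Prop} (ιB : BlkY x.toKIdx → IBondY x.toKIdx)

/-- ★★ **THE FOUR (3.42) BLOCK MAJORANTS OF THE BOND LETTER `OA(U)` READ FROM `KACU` AT A BASE** (def-Y's letters `OA(U)`, `∇_{U,ν} ∘ OA(U)`, `OA(U) ∘ ∇*_{U,ν}`,
`Δ_U ∘ OA(U)` in real coordinates on the bond carrier `FBondY × ι`, block map `ι_B ∘ blkV1`; constants `M₂Σ_j‖b_j‖·B₀`, profiles `ℓ², ℓ, ℓ, 1`, SAME rate; stated over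
`geo9K x.toKIdx = geo9Y x` by `rfl`) —
the `h342X` inputs of r06's letter-free G-step `B9Ineq385VG.gExt_leftEntry_of_386` for the G side of `SectBStepU`.
[cite: Balaban1985BackgroundPropagators, Thm 3.3 p.399 with (3.42) p.397, Thm 3.4 p.400; Balaban1984PropagatorsII, (2.51) p.232] -/
theorem readG342Y_KACU (hι : ∀ s, β x.toKIdx.hN x.toKIdx.D x.toKIdx.hk (ιB s) = s)
    {M₂ : ℝ} (hM₂ : 0 ≤ M₂) (hrepr : ∀ (v : 𝔸) (j : ι), |b.repr v j| ≤ M₂ * ‖v‖)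
    {B₀ δ : ℝ} (hB₀ : 0 ≤ B₀) {U : CfgY 𝔸 x.toKIdx} (h : EBlock (KACU P G x OA parB C37 C38) B₀ δ (.base U)) :
    HasMajorant (g := toB6 (geo9K x.toKIdx) Rr Hp) (fun p : FBondY x.toKIdx × ι => ιB (blkV1 x.toKIdx.hN x.toKIdx.D p.1)) (conj b ((OA U).restrictScalars ℝ))
        (fun a a' => M₂ * (∑ j, ‖b j‖) * (B₀ * (geo9K x.toKIdx).len a ^ 2 * Real.exp (-(δ * (geo9K x.toKIdx).dist a a')))) ∧
      (∀ ν : Fin (d + 1), HasMajorant (g := toB6 (geo9K x.toKIdx) Rr Hp) (fun p : FBondY x.toKIdx × ι => ιB (blkV1 x.toKIdx.hN x.toKIdx.D p.1))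
        (conj b (cdBₗ x.toKIdx U ν ∘ₗ (OA U).restrictScalars ℝ))
        (fun a a' => M₂ * (∑ j, ‖b j‖) * (B₀ * (geo9K x.toKIdx).len a * Real.exp (-(δ * (geo9K x.toKIdx).dist a a'))))) ∧
      (∀ ν : Fin (d + 1), HasMajorant (g := toB6 (geo9K x.toKIdx) Rr Hp) (fun p : FBondY x.toKIdx × ι => ιB (blkV1 x.toKIdx.hN x.toKIdx.D p.1))
        (conj b ((OA U).restrictScalars ℝ ∘ₗ cdsBₗ x.toKIdx U ν))
        (fun a a' => M₂ * (∑ j, ‖b j‖) * (B₀ * (geo9K x.toKIdx).len a * Real.exp (-(δ * (geo9K x.toKIdx).dist a a'))))) ∧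
      HasMajorant (g := toB6 (geo9K x.toKIdx) Rr Hp) (fun p : FBondY x.toKIdx × ι => ιB (blkV1 x.toKIdx.hN x.toKIdx.D p.1))
        (conj b (lapBₗ x.toKIdx U ∘ₗ (OA U).restrictScalars ℝ))
        (fun a a' => M₂ * (∑ j, ‖b j‖) * (B₀ * 1 * Real.exp (-(δ * (geo9K x.toKIdx).dist a a')))) := by
  have hE := eBlock_kernelFamilyB_of_KACU_base P G x OA parB C37 C38 h
  exact ⟨hasMajorant_conj_O_of_eBlockB (B := bg9YC 𝔸 G P x) (U₁ := U) x.toKIdx b (fun U => U) OA parB hE hB₀ ιB hι hM₂ hrepr,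
    fun ν => hasMajorant_conj_cdB_O_of_eBlockB (B := bg9YC 𝔸 G P x) (U₁ := U) x.toKIdx b (fun U => U) OA parB hE hB₀ ιB hι hM₂ hrepr ν,
    fun ν => hasMajorant_conj_O_cdsB_of_eBlockB (B := bg9YC 𝔸 G P x) (U₁ := U) x.toKIdx b (fun U => U) OA parB hE hB₀ ιB hι hM₂ hrepr ν,
    hasMajorant_conj_lapB_O_of_eBlockB (B := bg9YC 𝔸 G P x) (U₁ := U) x.toKIdx b (fun U => U) OA parB hE hB₀ ιB hι hM₂ hrepr⟩

/-! ## §5 WRITE: block majorants of the bond letters at the decoded product ⇒ the (3.42) block of `KACU` at the coded product -/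

omit [Fintype (geo9K x.toKIdx).Site] in
/-- at a coded product the (3.42) members of `KACU` (U-letters: differences at the base `U`, operator at the decoded product `W`) ARE those of def-Y's
one-configuration reading of the CONSTANT letter `OA(W)` over the coded carrier read through `baseY` (`rfl`). [cite: Balaban1985BackgroundPropagators, Thm 3.4 p.400, (3.42) p.397, bookkeeping] -/
theorem KACU_e_prod_eq (n : Fin 4) (U : CfgY 𝔸 x.toKIdx) (a : AfldY 𝔸 x.toKIdx) :
    (KACU P G x OA parB C37 C38).e n (.prod U a) =
      (kernelFamilyB x.toKIdx (codingYx P G x C37 C38).bg (baseY x.toKIdx) (fun _ => OA (decY x.toKIdx (.prod U a))) parB).e n (.prod U a) := rfl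

/-- ★★ **WRITE FOR `KACU` AT A CODED PRODUCT** (U-letters: covariant differences and the Laplacian at the BASE `U`, the operator at the decoded product
`W = e^{iηa}·U`): block majorants `B_c·ℓ(a)^{(2,1,1,0)}·e^{−δd}` of `conj b G`, `conj b D_ν * conj b G`, `conj b G * conj b D*_ν`, `conj b L * conj b G` — `G`, `D_ν`,
`D*_ν`, `L` any ℝ-linear maps agreeing pointwise with `OA(W)`, `∇_{U,ν}`, `∇*_{U,ν}`, `Δ_U` — give `EBlock (KACU …) (M₂Σ_j‖b_j‖·B_c) δ (prod U a)`, SAME rate.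
Proof: p21's writer `B9CubeLettersInvWriteDictB.eBlock_kernelFamilyBInv_of_hasMajorant` for the auxiliary one-configuration family with the CONSTANT letter
`OA(W)` over the coded carrier at `cfg := baseY` (whose (3.42) members at `prod U a` ARE `KACU`'s, by `rfl`), then the class ⇒ product dictionary
`B9CubeLettersInvReadDictB.eBlock_kernelFamilyB_of_eBlockInvB`. [cite: Balaban1985BackgroundPropagators, Thm 3.3 p.399 with (3.42) p.397, Thm 3.4 p.400, p.403 («of course with different constants»); Balaban1984PropagatorsII, (2.51) p.232] -/
theorem writeG342Y_KACU (hι : ∀ s, β x.toKIdx.hN x.toKIdx.D x.toKIdx.hk (ιB s) = s)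
    {M₂ : ℝ} (hM₂ : 0 ≤ M₂) (hrepr : ∀ (v : 𝔸) (j : ι), |b.repr v j| ≤ M₂ * ‖v‖) (U : CfgY 𝔸 x.toKIdx) (a : AfldY 𝔸 x.toKIdx)
    (Gb : Module.End ℝ (FBondY x.toKIdx → 𝔸)) (hGb : ∀ Λ, Gb Λ = OA (decY x.toKIdx (.prod U a)) Λ)
    (D Ds : Fin (d + 1) → Module.End ℝ (FBondY x.toKIdx → 𝔸)) (hD : ∀ ν Λ, D ν Λ = cdB x.toKIdx U ν Λ)
    (hDs : ∀ ν Λ, Ds ν Λ = cdsB x.toKIdx U ν Λ) (L : Module.End ℝ (FBondY x.toKIdx → 𝔸)) (hL : ∀ Λ, L Λ = lapB x.toKIdx U Λ)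
    {Bc δ : ℝ} (hBc : 0 ≤ Bc)
    (h0 : HasMajorant (g := toB6 (geo9K x.toKIdx) Rr Hp) (fun p : FBondY x.toKIdx × ι => ιB (blkV1 x.toKIdx.hN x.toKIdx.D p.1)) (conj b Gb)
      (fun a a' => Bc * (geo9K x.toKIdx).len a ^ 2 * Real.exp (-(δ * (geo9K x.toKIdx).dist a a'))))
    (h1 : ∀ ν : Fin (d + 1), HasMajorant (g := toB6 (geo9K x.toKIdx) Rr Hp) (fun p : FBondY x.toKIdx × ι => ιB (blkV1 x.toKIdx.hN x.toKIdx.D p.1))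
      (conj b (D ν) * conj b Gb) (fun a a' => Bc * (geo9K x.toKIdx).len a * Real.exp (-(δ * (geo9K x.toKIdx).dist a a'))))
    (h2 : ∀ ν : Fin (d + 1), HasMajorant (g := toB6 (geo9K x.toKIdx) Rr Hp) (fun p : FBondY x.toKIdx × ι => ιB (blkV1 x.toKIdx.hN x.toKIdx.D p.1))
      (conj b Gb * conj b (Ds ν)) (fun a a' => Bc * (geo9K x.toKIdx).len a * Real.exp (-(δ * (geo9K x.toKIdx).dist a a'))))
    (h3 : HasMajorant (g := toB6 (geo9K x.toKIdx) Rr Hp) (fun p : FBondY x.toKIdx × ι => ιB (blkV1 x.toKIdx.hN x.toKIdx.D p.1))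
      (conj b L * conj b Gb) (fun a a' => Bc * 1 * Real.exp (-(δ * (geo9K x.toKIdx).dist a a')))) :
    EBlock (KACU P G x OA parB C37 C38) (M₂ * (∑ j, ‖b j‖) * Bc) δ (.prod U a) := by
  -- p21's writer for the auxiliary family with the constant letter `OA(W)` over the coded carrier, read through `baseY`
  have hInv := eBlock_kernelFamilyBInv_of_hasMajorant (Rr := Rr) (Hp := Hp) (i := x.toKIdx) (b := b)
    (O := fun _ => OA (decY x.toKIdx (.prod U a))) (B := (codingYx P G x C37 C38).bg) (cfg := baseY x.toKIdx) (par := parB) (U₁ := .prod U a)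
    ιB hι hM₂ hrepr Gb hGb D Ds hD hDs L hL hBc h0 h1 h2 h3
  have hB := eBlock_kernelFamilyB_of_eBlockInvB (B := (codingYx P G x C37 C38).bg) (U₁ := .prod U a) x.toKIdx b hM₂ hrepr
    (fun _ => OA (decY x.toKIdx (.prod U a))) (baseY x.toKIdx) parB hInv
  -- the auxiliary family's (3.42) members at `prod U a` ARE `KACU`'s (U-letters at the base `U`, operator at the decoded product)
  intro n lam y y' hs
  rw [KACU_e_prod_eq]
  exact hB n lam y y' hs

end Coded

end Literature.MathematicalPhysics.QuantumFieldTheory.Balaban1983to89.B9SectBGReadYR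

end
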